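import Literature.NumberTheory.EllipticCurves.DescendedFrobeniusNineIntegers
import Mathlib.Data.Rat.Star
import Literature.NumberTheory.EllipticCurves.ManinConstantSemistableTwistProofs
import Literature.NumberTheory.EllipticCurves.FormalMulTwoLowOrderProofs
import HarnessLib

/-!
# The descended crystalline Frobenius matrix at `3` over `ℚ₃(ζ₉)` (Katz 1981, Berthelot–Ogus 1983), 3/5 — formal endomorphism digits, bounded logarithms and divisibility, formal-group coefficients, the `η`-coboundary, good-model transport, Honda estimates (re-homed proofs)

**The named fact `WeierstrassCurve.isDescendedFrobeniusMatrix_exists` (`DescendedFrobeniusMatrix.lean`: for `W/ℚ` with a good model over `𝓞_L`,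
`L = ℚ₃(ζ₉)`, of supersingular special fibre, a descended crystalline Frobenius matrix `M ∈ M₂(ℚ₃)` exists and `tr M = a`) HOLDS — EXACT name
`WeierstrassCurve.isDescendedFrobeniusMatrix_exists_holds`** ([Katz1981CrystallineDieudonne] N. Katz, *Crystalline cohomology, Dieudonné modules, and Jacobi sums*,
Thm. 5.1.4, 5.3.3, (5.5.7), 5.7.2, (6.1.1); [BerthelotOgus1983] (2.4), (3.14); Honda's theory of formal groups and the Katz–Messing point-count relation
`φ² − aφ + 3 = 0`).  Contents: (1, definitions file) `μ`, `λ`, the reduction mod `p` and the `p`-free part of a power series over `ℤ_p`;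
(2–4) the ring `𝓞_L = ℤ₃[ζ₉]` (`ONine`: integers, residue map, local structure, integral coordinates), transfer of the descended Frobenius along good
models (semantics, basis, good-model transport and its calculus), the formal endomorphism algebra and its `p`-adic digits, Katz's Frobenius modulo `ϖ` and
the Frobenius relation, bounded formal logarithms `⇔` divisibility, the `p`-adic rank-two assembly, coefficient computations in the formal group of a
Weierstrass curve (`formalW`, `formalΩ`, `formalLog`), the formal `η`-coboundary and residue, Honda estimates and congruences, unbounded `log`, `η`-integrality,
independence of the classes `[ω], [η]`, the second-kind logarithm, the Katz rank of a `p`-adic rank, the supersingular Katz rank, the `p`-adic digit limit;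
(5) Galois descent from `L` to `ℚ₃`, the named fact from the Katz rank, the rank-two reduction, and the discharge.
RE-HOMED into `Literature/` by the Hodge foundations lane (`lit-hodgefound`, seat p20, generation 40): verbatim DECLARATION-LEVEL ports (the 331 declarations needed, in
dependency order; each Part is a slice of one Summits module) of 45 theorem modules `Summits/BirchSwinnertonDyer/BirchSwinnertonDyer/Theorems/CyclotomicUntwist*.lean`
(+ three formal-group coefficient files and `Rank1Residual/{X1/MuLambdaAlgebra,O5/…}`); the namespace `Summit.BirchSwinnertonDyer.BirchSwinnertonDyer.Theorems` is re-rooted at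
`Literature.NumberTheory.EllipticCurves.DescendedFrobenius` (module sub-namespaces kept; the coefficient lemmas gathered in `….FormalGroupCoefficients`, the two `3`-adic norm lemmas in
`….PadicNormAux`, `μ`/`λ` in `Literature.NumberTheory.EllipticCurves.MuLambda`).  No new named fact (D-0026); imports Mathlib/Literature only; every declaration carries the citation of the
printed statement it formalises or serves.  The Summits originals stay in place (transitional duplication).  WHAT THIS IS NOT: nothing here bears on BSD; it is the
crystalline / formal-group computation of the Frobenius matrix at `3` for curves acquiring good reduction over `ℚ₃(ζ₉)`.  (This is file 3 of 5.)
-/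

noncomputable section

/-!
## Part 1 — port of `Summits/BirchSwinnertonDyer/BirchSwinnertonDyer/Theorems/ClassRecordThreeRung62310y1HeightEvalFormalLog.lean` (9 declarations kept)

# Coefficients of the formal group of a Weierstrass curve, I: `w(z)` to order `5`, `w/z³`, the invariant differential `ω(z)` to order `2`, and the formal logarithm to third order `log_W(z) = z + (a₁/2)z² + ((a₁²+a₂)/3)z³ + O(z⁴)`

Declarations of this Part (verbatim port; each keeps its own docstring and citation): `coeff_iterate_formalWStep`, `coeff_four_formalW`, `coeff_five_formalW`, `coeff_one_formalWDivCube`, `coeff_two_formalWDivCube`, `coeff_formalOmegaDenom`, `coeff_one_formalOmega`, `coeff_two_formalOmega`, `coeff_three_formalLog`.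

Reference keys (see `references.bib` and the declarations' citations): [SilvermanAEC2009].
-/

section Part1

open scoped _root_.Classical

open _root_.PowerSeries Literature.NumberTheory.EllipticCurves

namespace Literature.NumberTheory.EllipticCurves.DescendedFrobenius.FormalGroupCoefficients

section Ring

variable {R : Type*} [CommRing R] (W : WeierstrassCurve R)

/-- The iterates `fᵐ(0)` of the contraction `f(w) = z³ + a₁zw + a₂z²w + a₃w² + a₄zw² + a₆w³` satisfy
`coeff 3 = 1` (`m ≥ 1`), `coeff 4 = a₁` (`m ≥ 2`), `coeff 5 = a₁² + a₂` (`m ≥ 3`). [Silverman AEC IV.1.1(a)]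
[cite: SilvermanAEC2009, IV.1.1] -/
theorem coeff_iterate_formalWStep (m : ℕ) :
    coeff 3 ((W.formalWStep)^[m + 1] 0) = 1 ∧
    (1 ≤ m → coeff 4 ((W.formalWStep)^[m + 1] 0) = W.a₁) ∧
    (2 ≤ m → coeff 5 ((W.formalWStep)^[m + 1] 0) = W.a₁ ^ 2 + W.a₂) := by
  induction m with
  | zero =>
    refine ⟨?_, fun h => absurd h (by norm_num), fun h => absurd h (by norm_num)⟩
    rw [zero_add, Function.iterate_one]
    obtain ⟨u, hu⟩ := W.X_pow_three_dvd_iterate_formalWStep 0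
    rw [Function.iterate_zero, id_eq] at hu
    rw [hu, W.formalWStep_X_pow_mul, map_add, coeff_X_pow_mul', coeff_X_pow]
    simp
  | succ k ih =>
    obtain ⟨h3, h4, h5⟩ := ih
    obtain ⟨u, hu⟩ := W.X_pow_three_dvd_iterate_formalWStep (k + 1)
    -- coefficients of `u` from those of `fᵏ⁺¹(0) = z³ u`
    have hu0 : coeff 0 u = 1 := by
      have := h3; rw [hu, coeff_X_pow_mul'] at this; simpa using this
    have hu1 : 1 ≤ k → coeff 1 u = W.a₁ := fun hk => by
      have := h4 hk; rw [hu, coeff_X_pow_mul'] at this; simpa using this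
    have hstep : (W.formalWStep)^[k + 1 + 1] 0 = W.formalWStep (X ^ 3 * u) := by
      rw [Function.iterate_succ_apply', hu]
    rw [hstep, W.formalWStep_X_pow_mul]
    refine ⟨?_, fun _ => ?_, fun hk => ?_⟩
    · rw [map_add, coeff_X_pow_mul', coeff_X_pow]; simp
    · rw [map_add, coeff_X_pow_mul', coeff_X_pow]
      simp only [show ¬ (4 : ℕ) = 3 by norm_num, if_false, show (4 : ℕ) ≤ 4 by norm_num, if_true, zero_add,
        Nat.sub_self, map_add, mul_assoc, coeff_C_mul, coeff_zero_X_mul, coeff_X_pow_mul']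
      simp [hu0]
    · rw [map_add, coeff_X_pow_mul', coeff_X_pow]
      simp only [show ¬ (5 : ℕ) = 3 by norm_num, if_false, show (4 : ℕ) ≤ 5 by norm_num, if_true, zero_add,
        show (5 : ℕ) - 4 = 1 by norm_num, map_add, mul_assoc, coeff_C_mul, coeff_succ_X_mul, coeff_X_pow_mul']
      simp [hu0, hu1 (by omega)]
      ring

/-- `coeff 4 w(z) = a₁`. [Silverman AEC IV.1.1(a)] [cite: SilvermanAEC2009, IV.1.1] -/
theorem coeff_four_formalW : coeff 4 W.formalW = W.a₁ := by
  rw [WeierstrassCurve.formalW, coeff_mk]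
  exact ((coeff_iterate_formalWStep W) 3).2.1 (by norm_num)

/-- `coeff 5 w(z) = a₁² + a₂`. [Silverman AEC IV.1.1(a)] [cite: SilvermanAEC2009, IV.1.1] -/
theorem coeff_five_formalW : coeff 5 W.formalW = W.a₁ ^ 2 + W.a₂ := by
  rw [WeierstrassCurve.formalW, coeff_mk]
  exact ((coeff_iterate_formalWStep W) 4).2.2 (by norm_num)

/-- `coeff 1 B = a₁` for `B = w/z³`. [Silverman AEC IV.1.1(a)] [cite: SilvermanAEC2009, IV.1.1] -/
theorem coeff_one_formalWDivCube : coeff 1 W.formalWDivCube = W.a₁ := by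
  rw [WeierstrassCurve.formalWDivCube, coeff_mk]; exact (coeff_four_formalW W)

/-- `coeff 2 B = a₁² + a₂` for `B = w/z³`. [Silverman AEC IV.1.1(a)] [cite: SilvermanAEC2009, IV.1.1] -/
theorem coeff_two_formalWDivCube : coeff 2 W.formalWDivCube = W.a₁ ^ 2 + W.a₂ := by
  rw [WeierstrassCurve.formalWDivCube, coeff_mk]; exact (coeff_five_formalW W)

end Ring

section RatAlgebra

variable {A : Type*} [CommRing A] [Algebra ℚ A] (W : WeierstrassCurve A)

omit [Algebra ℚ A] in
/-- Coefficients `0, 1, 2` of the denominator `D = B·(2 − a₁z − a₃z³B)` of `ω`: `2`, `a₁`, `a₁² + 2a₂`. [folklore] -/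
private theorem coeff_formalOmegaDenom :
    coeff 0 (W.formalWDivCube * (2 - C W.a₁ * X - C W.a₃ * X ^ 3 * W.formalWDivCube)) = 2 ∧
    coeff 1 (W.formalWDivCube * (2 - C W.a₁ * X - C W.a₃ * X ^ 3 * W.formalWDivCube)) = W.a₁ ∧
    coeff 2 (W.formalWDivCube * (2 - C W.a₁ * X - C W.a₃ * X ^ 3 * W.formalWDivCube)) = W.a₁ ^ 2 + 2 * W.a₂ := by
  have hD : W.formalWDivCube * (2 - C W.a₁ * X - C W.a₃ * X ^ 3 * W.formalWDivCube) =
      C (2 : A) * W.formalWDivCube - C W.a₁ * (X * W.formalWDivCube) -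
        C W.a₃ * (X ^ 3 * (W.formalWDivCube * W.formalWDivCube)) := by
    rw [map_ofNat]; ring
  have h0 : coeff 0 W.formalWDivCube = 1 := by
    rw [coeff_zero_eq_constantCoeff]; exact W.constantCoeff_formalWDivCube
  rw [hD]
  refine ⟨?_, ?_, ?_⟩
  · simp only [map_sub, coeff_C_mul, coeff_zero_X_mul, coeff_X_pow_mul', h0]; simp
  · simp only [map_sub, coeff_C_mul, coeff_succ_X_mul, coeff_X_pow_mul', h0, (coeff_one_formalWDivCube W)]
    simp; ring
  · simp only [map_sub, coeff_C_mul, coeff_succ_X_mul, coeff_X_pow_mul', (coeff_one_formalWDivCube W),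
      (coeff_two_formalWDivCube W)]
    simp; ring

/-- **`coeff 1 ω = a₁`** (comparing degree-1 coefficients in `ω·D = 2B + zB′`: `a₁ + 2ω₁ = 3a₁`, `2 ∈ Aˣ`).
[Silverman AEC IV.1 (expansion of `ω`)] [cite: SilvermanAEC2009, IV.1.1] -/
theorem coeff_one_formalOmega : coeff 1 W.formalOmega = W.a₁ := by
  have h := congrArg (coeff 1) W.formalOmega_mul_denom
  obtain ⟨d0, d1, -⟩ := (coeff_formalOmegaDenom W)
  have hω0 : coeff 0 W.formalOmega = 1 := by
    rw [coeff_zero_eq_constantCoeff]; exact W.constantCoeff_formalOmega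
  rw [PowerSeries.coeff_mul, Finset.Nat.sum_antidiagonal_succ] at h
  simp only [Finset.Nat.antidiagonal_zero, Finset.sum_singleton, zero_add] at h
  rw [hω0, d1, d0, map_add, show (2 : A⟦X⟧) * W.formalWDivCube = C (2 : A) * W.formalWDivCube by rw [map_ofNat],
    coeff_C_mul, (coeff_one_formalWDivCube W), coeff_succ_X_mul, coeff_derivative, (coeff_one_formalWDivCube W)] at h
  -- `h : 1 * a₁ + ω₁ * 2 = 2 * a₁ + a₁ * (0 + 1)`
  have h2 : IsUnit (2 : A) := ⟨WeierstrassCurve.unitTwo, rfl⟩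
  refine h2.mul_left_cancel ?_
  have : (2 : A) * coeff 1 W.formalOmega = coeff 1 W.formalOmega * 2 := mul_comm _ _
  rw [this]
  push_cast at h
  linear_combination h

/-- **`coeff 2 ω = a₁² + a₂`** (degree-2 coefficients in `ω·D = 2B + zB′`). [Silverman AEC IV.1 (expansion of `ω`)]
[cite: SilvermanAEC2009, IV.1.1] -/
theorem coeff_two_formalOmega : coeff 2 W.formalOmega = W.a₁ ^ 2 + W.a₂ := by
  have h := congrArg (coeff 2) W.formalOmega_mul_denom
  obtain ⟨d0, d1, d2⟩ := (coeff_formalOmegaDenom W)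
  have hω0 : coeff 0 W.formalOmega = 1 := by
    rw [coeff_zero_eq_constantCoeff]; exact W.constantCoeff_formalOmega
  have hω1 := (coeff_one_formalOmega W)
  rw [PowerSeries.coeff_mul, Finset.Nat.sum_antidiagonal_succ, Finset.Nat.sum_antidiagonal_succ] at h
  simp only [Finset.Nat.antidiagonal_zero, Finset.sum_singleton, zero_add] at h
  rw [hω0, hω1, d2, d1, d0, map_add, show (2 : A⟦X⟧) * W.formalWDivCube = C (2 : A) * W.formalWDivCube by
      rw [map_ofNat], coeff_C_mul, (coeff_two_formalWDivCube W), coeff_succ_X_mul, coeff_derivative,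
    (coeff_two_formalWDivCube W)] at h
  have h2 : IsUnit (2 : A) := ⟨WeierstrassCurve.unitTwo, rfl⟩
  refine h2.mul_left_cancel ?_
  have : (2 : A) * coeff 2 W.formalOmega = coeff 2 W.formalOmega * 2 := mul_comm _ _
  rw [this]
  push_cast at h
  linear_combination h

/-- **`coeff 3 log_W = (a₁² + a₂)/3`**. [Silverman AEC IV.5.5] [cite: SilvermanAEC2009, IV.5.5] -/
theorem coeff_three_formalLog : coeff 3 W.formalLog = algebraMap ℚ A (1 / 3) * (W.a₁ ^ 2 + W.a₂) := by
  rw [WeierstrassCurve.formalLog, coeff_mk]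
  show algebraMap ℚ A (1 / ((1 : ℕ) + 2 : ℚ)) * coeff (1 + 1) W.formalOmega = _
  rw [(coeff_two_formalOmega W)]; norm_num

end RatAlgebra

end Literature.NumberTheory.EllipticCurves.DescendedFrobenius.FormalGroupCoefficients

end Part1

/-!
## Part 2 — port of `Summits/BirchSwinnertonDyer/BirchSwinnertonDyer/Theorems/CyclotomicUntwistFormalEtaResidue.lean` (3 declarations kept)

# The second-kind differential `η = x·ω` has residue zero at `O` — the expansion `z²x(z)·ω(z)/dz = 1 + 0·z + ⋯`, certifying the regular representative `∫(xω − dz/z²)` (`formalEtaIntegral`) of the class `[η]` used by `Lite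

Declarations of this Part (verbatim port; each keeps its own docstring and citation): `constantCoeff_formalXMulSq_mul_formalOmega`, `coeff_one_formalXMulSq_mul_formalOmega`, `coeff_one_formalEtaIntegral`.

Reference keys (see `references.bib` and the declarations' citations): [SilvermanAEC2009], [Katz1981CrystallineDieudonne].
-/

section Part2

open _root_.PowerSeries

namespace Literature.NumberTheory.EllipticCurves.DescendedFrobenius.FormalEtaResidue

section RatAlgebra

variable {A : Type*} [CommRing A] [Algebra ℚ A] (W : WeierstrassCurve A)

/-- **`P₀ = 1`**: the double poles of `x·ω` and `dz/z²` cancel (`z²x(z) = 1 + ⋯`, `ω/dz = 1 + ⋯`).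
[cite: SilvermanAEC2009, IV.1] -/
theorem constantCoeff_formalXMulSq_mul_formalOmega : constantCoeff (W.formalXMulSq * W.formalOmega) = 1 := by
  rw [map_mul, W.constantCoeff_formalXMulSq, W.constantCoeff_formalOmega, one_mul]

/-- **`P₁ = 0`: the residue of `η = x·ω` at `O` vanishes** (`[z](z²x) = −a₁`, `[z](ω/dz) = a₁`) — `η` is of the
SECOND KIND, so `xω − dz/z² = Σ_{n≥0} P_{n+2}zⁿ dz` is regular at `O` and `formalEtaIntegral` is its honest integral.
[cite: SilvermanAEC2009, IV.1] [cite: Katz1981CrystallineDieudonne, §5 Lemma 5.1.2] -/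
theorem coeff_one_formalXMulSq_mul_formalOmega : coeff 1 (W.formalXMulSq * W.formalOmega) = 0 := by
  rw [PowerSeries.coeff_one_mul, W.coeff_one_formalXMulSq, W.constantCoeff_formalOmega,
    Literature.NumberTheory.EllipticCurves.DescendedFrobenius.FormalGroupCoefficients.coeff_one_formalOmega,
    W.constantCoeff_formalXMulSq]
  ring

/-- The linear coefficient of the representative: `[z] ∫(xω − dz/z²) = P₂ = [z²](z²x·ω/dz)` (the formal integral
starts at the `z²`-coefficient of `P`, consistent with `P₀ = 1`, `P₁ = 0` being dropped).
[cite: Katz1981CrystallineDieudonne, §5 Lemma 5.1.2] -/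
theorem coeff_one_formalEtaIntegral :
    coeff 1 W.formalEtaIntegral = coeff 2 (W.formalXMulSq * W.formalOmega) := by
  rw [show (1 : ℕ) = 0 + 1 from rfl, W.coeff_succ_formalEtaIntegral 0]
  norm_num

end RatAlgebra

end Literature.NumberTheory.EllipticCurves.DescendedFrobenius.FormalEtaResidue

end Part2

/-!
## Part 3 — port of `Summits/BirchSwinnertonDyer/BirchSwinnertonDyer/Theorems/CyclotomicUntwistNineGoodModelTransport.lean` (10 declarations kept)

# Transport of Katz's Néron classes along the `𝓞`-integral change between two good models over `𝓞 = 𝓞_{ℚ₃(ζ₉)}`: `classOmega 𝓜₂ ∘ θ = classOmega 𝓜₁` exactly and `classEta 𝓜₂ ∘ θ = classEta 𝓜₁ + u₂·(𝓞-series)`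

Declarations of this Part (verbatim port; each keeps its own docstring and citation): `isIntegral_coeff_map`, `X_sq_mul_derivative_formalEtaIntegral`, `exists_formalEtaIntegral_smul_subst_formalVariableChange`, `exists_map_eq_formalVariableChange_baseChange`, `smul_curve_eq`, `C_eq`, `u_eq`, `r_eq`, `classOmega_subst`, `exists_classEta_subst`.

Reference keys (see `references.bib` and the declarations' citations): [SilvermanAEC2009], [Katz1981CrystallineDieudonne].
-/

section Part3

open scoped _root_.Classical
open _root_.PowerSeries _root_.WeierstrassCurve Literature.NumberTheory.EllipticCurves.DescendedFrobenius
  Literature.NumberTheory.EllipticCurves.DescendedFrobenius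

namespace Literature.NumberTheory.EllipticCurves.DescendedFrobenius.NineGoodModelTransport

/-- Coefficients of the image of an `𝓞`-series are `ℤ₃`-integral. [cite: SilvermanAEC2009, III.1] -/
theorem isIntegral_coeff_map (G : ONine⟦X⟧) (n : ℕ) :
    IsIntegral ℤ_[3] (coeff n (G.map (algebraMap ONine KNine))) := by
  rw [coeff_map]
  exact (coeff n G).2

/-! ### §1 `z²·d∫η = P − 1`: the derivative of the second-kind representative -/

/-- **`z² · (∫(xω − dz/z²))′ = (z²x)·(ω/dz) − 1`** over any `ℚ`-algebra (`P₀ = 1`, `P₁ = 0`: the pole and the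
residue of `x·ω` are removed, `FormalEtaResidue`). [cite: Katz1981CrystallineDieudonne, §5 Lemma 5.1.2] -/
theorem X_sq_mul_derivative_formalEtaIntegral {A : Type*} [CommRing A] [Algebra ℚ A] (V : WeierstrassCurve A) :
    X ^ 2 * d⁄dX A V.formalEtaIntegral = V.formalXMulSq * V.formalOmega - 1 := by
  ext n
  rw [coeff_X_pow_mul', map_sub, coeff_one]
  rcases n with _ | _ | m
  · simp [FormalEtaResidue.constantCoeff_formalXMulSq_mul_formalOmega]
  · simp [FormalEtaResidue.coeff_one_formalXMulSq_mul_formalOmega]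
  · rw [if_pos (by omega), if_neg (by omega), sub_zero, show m + 2 - 2 = m by omega, coeff_derivative,
      V.coeff_succ_formalEtaIntegral m, mul_comm, ← mul_assoc,
      show ((m : A) + 1) * algebraMap ℚ A (1 / (m + 1 : ℚ)) = 1 by
        rw [show ((m : A) + 1) = algebraMap ℚ A (m + 1 : ℚ) by rw [map_add, map_natCast, map_one],
          ← map_mul, mul_one_div_cancel (by positivity), map_one], one_mul]

/-! ### §2 The second-kind representative under an `𝓞`-integral change of variables -/

section EtaCore

/-- **`∫η` under an integral change of variables.** Let `V/𝓞` be a Weierstrass equation, `D = (u; r, s, t)` a change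
of variables OVER `𝓞` (`u ∈ 𝓞ˣ`), `𝓥 = V ⊗ K`, `𝓥' = D • 𝓥`, and `θ = u(z − rw)/(1 + sz + (t − sr)w) ∈ z𝓞⟦z⟧` the induced
isomorphism of formal groups (`formalVariableChange`). Then
`(∫η_{𝓥'}) ∘ θ = u⁻¹·∫η_𝓥 − u⁻¹r·log_𝓥 + g` with `g ∈ 𝓞⟦z⟧`: from `x' = u⁻²(x − r)`, `ω'∘θ·θ' = u·ω`
(`η' = x'ω'` pulls back to `u⁻¹η − u⁻¹r·ω`) and `d(1/θ − u⁻¹/z) ∈ 𝓞⟦z⟧dz` (the pole parts `dz'/z'²`, `u⁻¹dz/z²` differ by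
an INTEGRAL exact form because `θ = uz·(unit of 𝓞⟦z⟧)`). [cite: Katz1981CrystallineDieudonne, §5.1 (p. 193)]
[cite: SilvermanAEC2009, III.1 Table 3.1 and IV.1] -/
theorem exists_formalEtaIntegral_smul_subst_formalVariableChange (V : WeierstrassCurve ONine)
    (D : VariableChange ONine) :
    ∃ g : ONine⟦X⟧,
      ((D.baseChange KNine) • V.map (algebraMap ONine KNine)).formalEtaIntegral.subst
          ((V.map (algebraMap ONine KNine)).formalVariableChange (D.baseChange KNine)) =
        PowerSeries.C (((D.baseChange KNine).u⁻¹ : KNineˣ) : KNine) *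
            (V.map (algebraMap ONine KNine)).formalEtaIntegral -
          PowerSeries.C ((((D.baseChange KNine).u⁻¹ : KNineˣ) : KNine) * (D.baseChange KNine).r) *
            (V.map (algebraMap ONine KNine)).formalLog +
          g.map (algebraMap ONine KNine) := by
  set ι := algebraMap ONine KNine with hι
  set DK := D.baseChange KNine with hDK
  set VK := V.map ι with hVK
  set θ := VK.formalVariableChange DK with hθdef
  have hθs : HasSubst θ := VK.hasSubst_formalVariableChange DK
  have hθ0 : constantCoeff θ = 0 := VK.constantCoeff_formalVariableChange DK
  -- the integral avatar `θ₀` of `θ`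
  obtain ⟨θ₀, hθ₀, hθ₀0, hθ₀1⟩ := exists_map_eq_formalVariableChange V DK D.u D.r D.s D.t
    (by simp [hDK, VariableChange.baseChange]) (by simp [hDK, VariableChange.baseChange])
    (by simp [hDK, VariableChange.baseChange]) (by simp [hDK, VariableChange.baseChange])
  replace hθ₀ : θ₀.map ι = θ := by rw [hθdef, hVK, hι]; exact hθ₀
  -- `θ₀ = X·T₀`, `T₀(0) = u`, `T₀·Ti₀ = 1`, `Ti₀ = X·G₀ + u⁻¹`
  set T₀ : ONine⟦X⟧ := PowerSeries.mk fun n => coeff (n + 1) θ₀ with hT₀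
  have hθT₀ : θ₀ = X * T₀ := by
    have h := eq_X_mul_shift_add_const θ₀
    rwa [hθ₀0, map_zero, add_zero] at h
  have hT₀0 : constantCoeff T₀ = D.u := by
    rw [← coeff_zero_eq_constantCoeff, hT₀, coeff_mk, zero_add, hθ₀1]
  set Ti₀ : ONine⟦X⟧ := invOfUnit T₀ D.u with hTi₀
  have hTT₀ : T₀ * Ti₀ = 1 := mul_invOfUnit T₀ D.u hT₀0
  set G₀ : ONine⟦X⟧ := PowerSeries.mk fun n => coeff (n + 1) Ti₀ with hG₀
  have hTi₀ : Ti₀ = X * G₀ + PowerSeries.C ((D.u⁻¹ : ONineˣ) : ONine) := by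
    have h := eq_X_mul_shift_add_const Ti₀
    rwa [hTi₀, constantCoeff_invOfUnit, ← hTi₀] at h
  -- read over `K`
  set T := T₀.map ι with hT
  set Ti := Ti₀.map ι with hTidef
  set G := G₀.map ι with hG
  have hθT : θ = X * T := by rw [← hθ₀, hθT₀, map_mul, map_X]
  have hTT : T * Ti = 1 := by rw [hT, hTidef, ← map_mul, hTT₀, map_one]
  have huinv : ((DK.u⁻¹ : KNineˣ) : KNine) = ι ((D.u⁻¹ : ONineˣ) : ONine) := by
    simp [hDK, VariableChange.baseChange, hι]
  have hTi : Ti = X * G + PowerSeries.C ((DK.u⁻¹ : KNineˣ) : KNine) := by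
    rw [hTidef, hTi₀, map_add, map_mul, map_X, map_C, huinv]
  have huu : PowerSeries.C ((DK.u⁻¹ : KNineˣ) : KNine) * PowerSeries.C (DK.u : KNine) = (1 : KNine⟦X⟧) := by
    rw [← map_mul, Units.inv_mul, map_one]
  -- derivatives of the structure relations
  have hdθ : d⁄dX KNine θ = T + X * d⁄dX KNine T := by
    rw [hθT, Derivation.leibniz, derivative_X, smul_eq_mul, smul_eq_mul, mul_one]; ring
  have hdTT : d⁄dX KNine T * Ti + T * d⁄dX KNine Ti = 0 := by
    have h := congrArg (d⁄dX KNine) hTT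
    rw [Derivation.leibniz, smul_eq_mul, smul_eq_mul, Derivation.map_one_eq_zero] at h
    linear_combination h
  have hdTi : d⁄dX KNine Ti = G + X * d⁄dX KNine G := by
    rw [hTi, map_add, derivative_C, add_zero, Derivation.leibniz, derivative_X, smul_eq_mul, smul_eq_mul,
      mul_one]; ring
  -- the formal-group identities under `θ`
  have h1 := VK.formalXMulSq_variableChange_subst_mul_X_sq DK
  have h2 := VK.formalOmega_variableChange_subst_mul_derivative DK
  have hP1 := X_sq_mul_derivative_formalEtaIntegral VK
  have hP2 := X_sq_mul_derivative_formalEtaIntegral (DK • VK)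
  have hCθ : ∀ a : KNine, (PowerSeries.C a).subst θ = PowerSeries.C a := fun a => PowerSeries.subst_C a
  have hA : θ ^ 2 * (d⁄dX KNine (DK • VK).formalEtaIntegral).subst θ =
      (DK • VK).formalXMulSq.subst θ * (DK • VK).formalOmega.subst θ - 1 := by
    have h := congrArg (PowerSeries.subst θ) hP2
    simp only [← coe_substAlgHom hθs, map_mul, map_sub, map_pow, map_one, substAlgHom_X] at h
    simpa only [coe_substAlgHom hθs] using h
  -- assemble: compare derivatives after multiplying by `X²θ²`
  refine ⟨G₀ - PowerSeries.C (constantCoeff G₀), ?_⟩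
  rw [map_sub, map_C, ← hG]
  set A := (d⁄dX KNine (DK • VK).formalEtaIntegral).subst θ with hAdef
  set B := (DK • VK).formalXMulSq.subst θ with hBdef
  set Ω' := (DK • VK).formalOmega.subst θ with hΩ'def
  set Cui : KNine⟦X⟧ := PowerSeries.C ((DK.u⁻¹ : KNineˣ) : KNine) with hCui
  set Cu : KNine⟦X⟧ := PowerSeries.C (DK.u : KNine) with hCu
  set Cr : KNine⟦X⟧ := PowerSeries.C DK.r with hCr
  set Q₁ := VK.formalXMulSq with hQ₁
  set Ω₁ := VK.formalOmega with hΩ₁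
  set η₁' := d⁄dX KNine VK.formalEtaIntegral with hη₁'
  set dθ := d⁄dX KNine θ with hdθdef
  set dT := d⁄dX KNine T with hdTdef
  set dTi := d⁄dX KNine Ti with hdTidef
  set dG := d⁄dX KNine G with hdGdef
  have s1 : X ^ 2 * θ ^ 2 * (A * dθ) = Cui * θ ^ 2 * (Q₁ - Cr * X ^ 2) * Ω₁ - X ^ 2 * dθ := by
    linear_combination (X ^ 2 * dθ) * hA + (Ω' * dθ) * h1 + (Cui ^ 2 * θ ^ 2 * (Q₁ - Cr * X ^ 2)) * h2 +
      (Cui * θ ^ 2 * (Q₁ - Cr * X ^ 2) * Ω₁) * huu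
  have s3 : X ^ 2 * T ^ 2 * dG = -(X * dT) - T + Cui * T ^ 2 := by
    linear_combination (X * T) * hdTT + (-(X * dT) - T) * hTT - (X * T ^ 2) * hdTi + T ^ 2 * hTi
  apply PowerSeries.derivative.ext
  · -- equal derivatives: cancel `X²θ²`
    have hX : (X : KNine⟦X⟧) ^ 2 * θ ^ 2 ≠ 0 := by
      refine mul_ne_zero (pow_ne_zero _ X_ne_zero) (pow_ne_zero _ fun h => ?_)
      have := congrArg (coeff 1) h
      rw [VK.coeff_one_formalVariableChange DK, map_zero] at this
      exact DK.u.ne_zero this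
    apply mul_left_cancel₀ hX
    rw [PowerSeries.derivative_subst KNine hθs, map_add, map_sub, Derivation.leibniz, Derivation.leibniz,
      derivative_C, derivative_C, smul_zero, add_zero, smul_zero, add_zero, smul_eq_mul, smul_eq_mul,
      VK.derivative_formalLog, map_sub, derivative_C, sub_zero]
    have s2 : X ^ 2 * θ ^ 2 * (Cui * η₁' - PowerSeries.C ((((DK.u⁻¹ : KNineˣ) : KNine)) * DK.r) * Ω₁ + dG) =
        Cui * θ ^ 2 * (Q₁ * Ω₁ - 1) - Cui * Cr * X ^ 2 * θ ^ 2 * Ω₁ + X ^ 2 * θ ^ 2 * dG := by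
      rw [map_mul, ← hCui, ← hCr]
      linear_combination (Cui * θ ^ 2) * hP1
    rw [← hAdef, ← hdθdef, ← hη₁', ← hdGdef]
    linear_combination s1 - s2 + ((Cui - X ^ 2 * dG) * (θ + X * T)) * hθT - X ^ 2 * hdθ - X ^ 2 * s3
  · -- both vanish at `0`
    have hG0 : constantCoeff G = ι (constantCoeff G₀) := by
      rw [hG, ← coeff_zero_eq_constantCoeff_apply, coeff_map, coeff_zero_eq_constantCoeff_apply]
    rw [map_add, map_sub, map_sub, map_mul, map_mul, constantCoeff_C, constantCoeff_C, constantCoeff_C,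
      VK.constantCoeff_formalLog, WeierstrassCurve.constantCoeff_formalEtaIntegral, mul_zero, mul_zero, sub_zero,
      zero_add, hG0, sub_self]
    exact MvPowerSeries.constantCoeff_subst_eq_zero (PowerSeries.HasSubst.const hθs) (fun _ => hθ0)
      (DK • VK).constantCoeff_formalEtaIntegral

end EtaCore

/-- The integral avatar of `θ`: for `V/𝓞` and `D` over `𝓞`, `θ = θ₀ ⊗ K` with `θ₀ ∈ z𝓞⟦z⟧`
(`ManinConstantSemistableTwistProofs.exists_map_eq_formalVariableChange`). [cite: SilvermanAEC2009, IV.1] -/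
theorem exists_map_eq_formalVariableChange_baseChange (V : WeierstrassCurve ONine) (D : VariableChange ONine) :
    ∃ θ₀ : ONine⟦X⟧, θ₀.map (algebraMap ONine KNine) =
      (V.map (algebraMap ONine KNine)).formalVariableChange (D.baseChange KNine) ∧ constantCoeff θ₀ = 0 := by
  obtain ⟨θ₀, hθ₀, hθ₀0, -⟩ := exists_map_eq_formalVariableChange V (D.baseChange KNine) D.u D.r D.s D.t
    (by simp [VariableChange.baseChange]) (by simp [VariableChange.baseChange])
    (by simp [VariableChange.baseChange]) (by simp [VariableChange.baseChange])
  exact ⟨θ₀, hθ₀, hθ₀0⟩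

/-! ### §3 Two good models of one curve: the Néron classes correspond under `θ` -/

section Models

variable {W : WeierstrassCurve ℚ} {𝓜₁ 𝓜₂ : W.NineGoodModel} {D : VariableChange ONine}

/-- `D ⊗ K` carries the first model (read in `K`) to the second. [cite: SilvermanAEC2009, VII.1.3] -/
theorem smul_curve_eq (hD : D • 𝓜₁.E = 𝓜₂.E) : (D.baseChange KNine) • 𝓜₁.curve = 𝓜₂.curve := by
  rw [NineGoodModel.curve, NineGoodModel.curve, ← hD, VariableChange.baseChange, map_variableChange]

/-- The changes of variables compose: `C₂ = (D ⊗ K)·C₁`. [cite: SilvermanAEC2009, III.1] -/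
theorem C_eq (hDK : D.baseChange KNine = 𝓜₂.C * 𝓜₁.C⁻¹) : 𝓜₂.C = D.baseChange KNine * 𝓜₁.C := by
  rw [hDK, inv_mul_cancel_right]

/-- `u₂ = u_D·u₁`. [cite: SilvermanAEC2009, III.1] -/
theorem u_eq (hDK : D.baseChange KNine = 𝓜₂.C * 𝓜₁.C⁻¹) : 𝓜₂.C.u = (D.baseChange KNine).u * 𝓜₁.C.u := by
  rw [C_eq hDK]; rfl

/-- `r₂ = r_D·u₁² + r₁`. [cite: SilvermanAEC2009, III.1] -/
theorem r_eq (hDK : D.baseChange KNine = 𝓜₂.C * 𝓜₁.C⁻¹) :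
    𝓜₂.C.r = (D.baseChange KNine).r * (𝓜₁.C.u : KNine) ^ 2 + 𝓜₁.C.r := by
  rw [C_eq hDK]; rfl

/-- **`[ω_W]` is the SAME series on both models, read through `θ`: `classOmega 𝓜₂ ∘ θ = classOmega 𝓜₁`**
(`log₂ ∘ θ = u_D·log₁` and `u₂ = u_D u₁`). [cite: Katz1981CrystallineDieudonne, §5.1 (functoriality of D(G/R))]
[cite: SilvermanAEC2009, IV.5.5] -/
theorem classOmega_subst (hD : D • 𝓜₁.E = 𝓜₂.E) (hDK : D.baseChange KNine = 𝓜₂.C * 𝓜₁.C⁻¹) :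
    𝓜₂.classOmega.subst (𝓜₁.curve.formalVariableChange (D.baseChange KNine)) = 𝓜₁.classOmega := by
  have hθs := 𝓜₁.curve.hasSubst_formalVariableChange (D.baseChange KNine)
  rw [NineGoodModel.classOmega, NineGoodModel.classOmega, subst_smul hθs, ← smul_curve_eq hD,
    formalLog_variableChange_subst, smul_eq_C_mul, smul_eq_C_mul, ← mul_assoc, ← map_mul, u_eq hDK, mul_inv_rev,
    Units.val_mul, mul_assoc, Units.inv_mul, mul_one]

/-- **`[η_W]` corresponds under `θ` up to an INTEGRAL series**: `classEta 𝓜₂ ∘ θ = classEta 𝓜₁ + u₂·g`, `g ∈ 𝓞⟦z⟧`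
(§5 with `u₂ = u_D u₁`, `r₂ = r_D u₁² + r₁`). [cite: Katz1981CrystallineDieudonne, §5.1 (functoriality of D(G/R))]
[cite: SilvermanAEC2009, III.1 Table 3.1] -/
theorem exists_classEta_subst (hD : D • 𝓜₁.E = 𝓜₂.E) (hDK : D.baseChange KNine = 𝓜₂.C * 𝓜₁.C⁻¹) :
    ∃ g : ONine⟦X⟧, 𝓜₂.classEta.subst (𝓜₁.curve.formalVariableChange (D.baseChange KNine)) =
      𝓜₁.classEta + PowerSeries.C (𝓜₂.C.u : KNine) * g.map (algebraMap ONine KNine) := by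
  have hθs := 𝓜₁.curve.hasSubst_formalVariableChange (D.baseChange KNine)
  obtain ⟨g, hg⟩ := exists_formalEtaIntegral_smul_subst_formalVariableChange 𝓜₁.E D
  refine ⟨g, ?_⟩
  have hcurve : 𝓜₁.curve = 𝓜₁.E.map (algebraMap ONine KNine) := rfl
  rw [NineGoodModel.classEta, NineGoodModel.classEta, subst_add hθs, subst_smul hθs, subst_smul hθs,
    ← smul_curve_eq hD, formalLog_variableChange_subst, hcurve, hg, u_eq hDK, r_eq hDK]
  simp only [smul_eq_C_mul, map_mul, map_add, map_pow, mul_inv_rev, Units.val_mul]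
  have ha : PowerSeries.C (𝓜₁.C.u : KNine) * PowerSeries.C ((𝓜₁.C.u⁻¹ : KNineˣ) : KNine) = (1 : KNine⟦X⟧) := by
    rw [← map_mul, Units.mul_inv, map_one]
  have hb : PowerSeries.C ((D.baseChange KNine).u : KNine) *
      PowerSeries.C (((D.baseChange KNine).u⁻¹ : KNineˣ) : KNine) = (1 : KNine⟦X⟧) := by
    rw [← map_mul, Units.mul_inv, map_one]
  set a : KNine⟦X⟧ := PowerSeries.C (𝓜₁.C.u : KNine)
  set ai : KNine⟦X⟧ := PowerSeries.C ((𝓜₁.C.u⁻¹ : KNineˣ) : KNine)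
  set b : KNine⟦X⟧ := PowerSeries.C ((D.baseChange KNine).u : KNine)
  set bi : KNine⟦X⟧ := PowerSeries.C (((D.baseChange KNine).u⁻¹ : KNineˣ) : KNine)
  set r : KNine⟦X⟧ := PowerSeries.C (D.baseChange KNine).r
  set r₁ : KNine⟦X⟧ := PowerSeries.C 𝓜₁.C.r
  set L := (𝓜₁.E.map (algebraMap ONine KNine)).formalLog
  set I := (𝓜₁.E.map (algebraMap ONine KNine)).formalEtaIntegral
  linear_combination (a * I + r₁ * ai * L) * hb + (b * bi * r * a * L) * ha

end Models

end Literature.NumberTheory.EllipticCurves.DescendedFrobenius.NineGoodModelTransport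

end Part3

/-!
## Part 4 — port of `Summits/BirchSwinnertonDyer/BirchSwinnertonDyer/Theorems/CyclotomicUntwistNineHondaEstimate.lean` (10 declarations kept)

# The ramified substitution estimate over `𝓞 = 𝓞_{ℚ₃(ζ₉)}`: `u ≡ v (mod 1 − ζ₉) ⇒ 3·(ℓ(u) − ℓ(v)) ∈ 𝓞⟦X⟧` for every `ℓ ∈ ℚ₃(ζ₉)⟦X⟧` with `m·[Xᵐ]ℓ ∈ 𝓞` (Katz's key lemma after `⊗ ℚ`, without divided powers)

Declarations of this Part (verbatim port; each keeps its own docstring and citation): `pow_three_sub_pow_three`, `dvd_pow_three_sub`, `dvd_pow_three_pow_sub`, `natCast_dvd_three_mul_pow_sub_pow`, `C_varpi_sq_dvd_three`, `three_dvd_C_varpi_pow_six`, `isUnit_natCast_of_not_dvd`, `exists_eq_C_varpi_mul_of_map_eq_zero`, `coeff_map_mem`, `three_mul_coeff_subst_sub_subst_mem`.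

Reference keys (see `references.bib` and the declarations' citations): [Honda1970], [Hazewinkel1978], [Katz1981CrystallineDieudonne].
-/

section Part4

open scoped _root_.Classical
open _root_.PowerSeries _root_.IsCyclotomicExtension Literature.NumberTheory.EllipticCurves.DescendedFrobenius
  Literature.NumberTheory.EllipticCurves.DescendedFrobenius.NineIntegers

namespace Literature.NumberTheory.EllipticCurves.DescendedFrobenius.NineHondaEstimate

/-! ### §1 Pure algebra: `π ∣ u − v ⇒ m ∣ 3(uᵐ − vᵐ)` when `π² ∣ 3 ∣ π⁶` -/

section Algebra

variable {S : Type*} [CommRing S] {π : S}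

/-- `u³ − v³ = (u − v)³ + 3uv(u − v)`. [cite: Honda1970, §2 Lemma 2.3] -/
theorem pow_three_sub_pow_three (u v : S) : u ^ 3 - v ^ 3 = (u - v) ^ 3 + 3 * (u * v * (u - v)) := by
  ring

/-- `π ∣ u − v ⇒ π³ ∣ u³ − v³` when `π² ∣ 3` (the `e = 6` replacement of `p ∣ u − v ⇒ p² ∣ uᵖ − vᵖ`).
[cite: Honda1970, §2 Lemma 2.3] -/
theorem dvd_pow_three_sub (h2 : π ^ 2 ∣ (3 : S)) {u v : S} (huv : π ∣ u - v) : π ^ 3 ∣ u ^ 3 - v ^ 3 := by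
  obtain ⟨c, hc⟩ := huv
  obtain ⟨d, hd⟩ := h2
  rw [pow_three_sub_pow_three, hc, hd]
  exact ⟨c ^ 3 + d * (u * v * c), by ring⟩

/-- `π ∣ u − v ⇒ 3ᵏπ³ ∣ u^{3^{k+1}} − v^{3^{k+1}}` when `π² ∣ 3 ∣ π⁶` (valuations `3, 9, 15, …`).
[cite: Honda1970, §2 Lemma 2.3] -/
theorem dvd_pow_three_pow_sub (h2 : π ^ 2 ∣ (3 : S)) (h6 : (3 : S) ∣ π ^ 6) {u v : S} (huv : π ∣ u - v)
    (k : ℕ) : 3 ^ k * π ^ 3 ∣ u ^ 3 ^ (k + 1) - v ^ 3 ^ (k + 1) := by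
  induction k with
  | zero => rw [pow_zero, one_mul, zero_add, pow_one]; exact dvd_pow_three_sub h2 huv
  | succ k ih =>
    obtain ⟨c, hc⟩ := ih
    obtain ⟨e, he⟩ := h6
    have hu : u ^ 3 ^ (k + 1 + 1) = (u ^ 3 ^ (k + 1)) ^ 3 := by rw [← pow_mul, ← pow_succ]
    have hv : v ^ 3 ^ (k + 1 + 1) = (v ^ 3 ^ (k + 1)) ^ 3 := by rw [← pow_mul, ← pow_succ]
    rw [hu, hv, pow_three_sub_pow_three, hc]
    have e9 : (3 ^ k * π ^ 3 * c) ^ 3 = 3 ^ (k + 1) * π ^ 3 * (3 ^ (2 * k) * e * c ^ 3) := by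
      have : (π ^ 3) ^ 3 = π ^ 3 * (3 * e) := by rw [← he]; ring
      calc (3 ^ k * π ^ 3 * c) ^ 3 = (3 ^ k) ^ 3 * (π ^ 3) ^ 3 * c ^ 3 := by ring
        _ = (3 ^ k) ^ 3 * (π ^ 3 * (3 * e)) * c ^ 3 := by rw [this]
        _ = 3 ^ (k + 1) * π ^ 3 * (3 ^ (2 * k) * e * c ^ 3) := by ring
    rw [e9]
    exact ⟨3 ^ (2 * k) * e * c ^ 3 + u ^ 3 ^ (k + 1) * v ^ 3 ^ (k + 1) * c, by ring⟩

/-- **`π ∣ u − v ⇒ m ∣ 3·(uᵐ − vᵐ)` for every `m`**, in a ring with `π² ∣ 3 ∣ π⁶` in which the integers prime to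
`3` are units (the ramified, `e = 6`, form of Honda's/Hazewinkel's `mp ∣ uᵐ − vᵐ`; ONE factor `3` is lost).
[cite: Honda1970, §2 Lemma 2.3] [cite: Hazewinkel1978, Ch. I §2.3] -/
theorem natCast_dvd_three_mul_pow_sub_pow (h2 : π ^ 2 ∣ (3 : S)) (h6 : (3 : S) ∣ π ^ 6)
    (hunit : ∀ r : ℕ, ¬ 3 ∣ r → IsUnit (r : S)) {u v : S} (huv : π ∣ u - v) (m : ℕ) :
    (m : S) ∣ 3 * (u ^ m - v ^ m) := by
  rcases eq_or_ne m 0 with rfl | hm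
  · simp
  obtain ⟨k, r, hr, rfl⟩ := Nat.exists_eq_pow_mul_and_not_dvd hm 3 (by norm_num)
  have hru : IsUnit (r : S) := hunit r hr
  rcases k with _ | j
  · rw [pow_zero, one_mul]
    exact hru.dvd
  · have h1 : u ^ 3 ^ (j + 1) - v ^ 3 ^ (j + 1) ∣ u ^ (3 ^ (j + 1) * r) - v ^ (3 ^ (j + 1) * r) := by
      rw [pow_mul, pow_mul]; exact sub_dvd_pow_sub_pow _ _ r
    obtain ⟨w, hw⟩ := (dvd_pow_three_pow_sub h2 h6 huv j).trans h1
    have e : ((3 ^ (j + 1) * r : ℕ) : S) = (3 : S) ^ (j + 1) * r := by push_cast; ring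
    rw [e, IsUnit.mul_right_dvd hru, hw]
    exact ⟨π ^ 3 * w, by ring⟩

end Algebra

/-! ### §2 The ring `𝓞 = 𝓞_{ℚ₃(ζ₉)}`: `π = 1 − ζ₉`, `π² ∣ 3 ∣ π⁶`, units, lifting `(1 − ζ₉)`-divisible series -/

/-- `π² ∣ 3` in `𝓞⟦X⟧` (`3 = −π⁶θ⁻¹`, `θ⁻¹ ∈ ℤ[ζ₉]`). [cite: Honda1970, §2 Lemma 2.3] -/
theorem C_varpi_sq_dvd_three :
    (PowerSeries.C (⟨1 - zeta 9 ℚ_[3] KNine, one_sub_zeta_mem⟩ : ONine)) ^ 2 ∣ (3 : ONine⟦X⟧) := by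
  set ϖ : ONine := ⟨1 - zeta 9 ℚ_[3] KNine, one_sub_zeta_mem⟩ with hϖ
  have h3 : (3 : ONine) = ϖ ^ 2 * (-(ϖ ^ 4 * ⟨_, thetaInv_mem⟩)) := by
    apply Subtype.ext
    push_cast
    rw [three_eq_neg_pow_six_mul_thetaInv zeta_spec]
    ring
  refine ⟨PowerSeries.C (-(ϖ ^ 4 * ⟨_, thetaInv_mem⟩)), ?_⟩
  rw [← map_pow, ← map_mul, ← h3, map_ofNat]

/-- `3 ∣ π⁶` in `𝓞⟦X⟧` (`π⁶ = −3θ`, `θ ∈ ℤ[ζ₉]`). [cite: Honda1970, §2 Lemma 2.3] -/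
theorem three_dvd_C_varpi_pow_six :
    (3 : ONine⟦X⟧) ∣ (PowerSeries.C (⟨1 - zeta 9 ℚ_[3] KNine, one_sub_zeta_mem⟩ : ONine)) ^ 6 := by
  set ϖ : ONine := ⟨1 - zeta 9 ℚ_[3] KNine, one_sub_zeta_mem⟩ with hϖ
  have h6 : ϖ ^ 6 = 3 * (-⟨_, theta_mem⟩) := by
    apply Subtype.ext
    push_cast
    rw [Literature.NumberTheory.EllipticCurves.DescendedFrobenius.GNine.varpi_pow_six zeta_spec]
    ring
  refine ⟨PowerSeries.C (-⟨_, theta_mem⟩), ?_⟩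
  rw [← map_pow, h6, map_mul, map_ofNat]

/-- The integers prime to `3` are units of `𝓞⟦X⟧` (they are units of `ℤ₃ ⊂ 𝓞`). [cite: Honda1970, §2 Lemma 2.3] -/
theorem isUnit_natCast_of_not_dvd {r : ℕ} (hr : ¬ 3 ∣ r) : IsUnit (r : ONine⟦X⟧) := by
  have h : IsUnit (r : ℤ_[3]) := by
    rw [PadicInt.isUnit_iff, PadicInt.norm_natCast_eq_one_iff]
    exact (Nat.Prime.coprime_iff_not_dvd (by norm_num)).mpr hr
  have h' : IsUnit (r : ONine) := by simpa using h.map (algebraMap ℤ_[3] ONine)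
  simpa using h'.map (PowerSeries.C (R := ONine))

/-- **Lifting a series killed by the reduction map**: if every coefficient of `D ∈ 𝓞⟦X⟧` lies in `ker ρ`, then
`D = (1 − ζ₉)·G` with `G ∈ 𝓞⟦X⟧` (`ker ρ = (1 − ζ₉)𝓞`, `NineIntegers.residueMap_eq_zero_iff`). [cite: Honda1970, §2 Lemma 2.3] -/
theorem exists_eq_C_varpi_mul_of_map_eq_zero (ρ : ONine →+* ZMod 3) {D : ONine⟦X⟧}
    (hD : D.map ρ = 0) :
    ∃ G : ONine⟦X⟧, D = PowerSeries.C (⟨1 - zeta 9 ℚ_[3] KNine, one_sub_zeta_mem⟩ : ONine) * G := by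
  have hc : ∀ n, ∃ y : ONine, coeff n D = ⟨1 - zeta 9 ℚ_[3] KNine, one_sub_zeta_mem⟩ * y := fun n => by
    have h0 : ρ (coeff n D) = 0 := by
      have := congrArg (coeff n) hD
      rwa [coeff_map, map_zero] at this
    obtain ⟨y, hy, e⟩ := (residueMap_eq_zero_iff ρ (coeff n D)).mp h0
    exact ⟨⟨y, hy⟩, Subtype.ext (by push_cast; exact e)⟩
  choose g hg using hc
  refine ⟨PowerSeries.mk g, PowerSeries.ext fun n => ?_⟩
  rw [coeff_C_mul, coeff_mk]
  exact hg n

/-! ### §3 The substitution estimate: `3·(ℓ(u) − ℓ(v)) ∈ 𝓞⟦X⟧` for `u ≡ v (mod 1 − ζ₉)` -/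

/-- Coefficients of the image of an `𝓞`-series lie in `𝓞`. [cite: Honda1970, §2 Lemma 2.3] -/
theorem coeff_map_mem (G : ONine⟦X⟧) (n : ℕ) : coeff n (G.map (algebraMap ONine KNine)) ∈ ONine := by
  rw [coeff_map]
  exact (coeff n G).2

/-- **Katz's key estimate over the ramified ring, after `⊗ ℚ`.** Let `ℓ ∈ ℚ₃(ζ₉)⟦X⟧` have `m·[Xᵐ]ℓ ∈ 𝓞` for
all `m` (e.g. the logarithm of a formal group over `𝓞`), and let `U ≡ V (mod (1 − ζ₉)𝓞⟦X⟧)` be `𝓞`-series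
without constant term. Then `3·(ℓ(U) − ℓ(V))` has coefficients in `𝓞`: `ℓ(U) − ℓ(V) = Σₘ [Xᵐ]ℓ·(Uᵐ − Vᵐ)` and
`m ∣ 3(Uᵐ − Vᵐ)` absorbs the denominator `m` of `[Xᵐ]ℓ` (Katz 1981, Key Lemma 5.1.3, with the divided-power
hypothesis replaced by the valuation estimate `v(πᵐ/m) ≥ −v(3)`). [cite: Katz1981CrystallineDieudonne, Key Lemma 5.1.3]
[cite: Honda1970, §2 Lemma 2.3] -/
theorem three_mul_coeff_subst_sub_subst_mem {ℓ : KNine⟦X⟧} (hℓ : ∀ m : ℕ, (m : KNine) * coeff m ℓ ∈ ONine)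
    {U V : ONine⟦X⟧} (hU : constantCoeff U = 0) (hV : constantCoeff V = 0)
    (hUV : PowerSeries.C (⟨1 - zeta 9 ℚ_[3] KNine, one_sub_zeta_mem⟩ : ONine) ∣ U - V) (n : ℕ) :
    3 * coeff n (ℓ.subst (U.map (algebraMap ONine KNine)) - ℓ.subst (V.map (algebraMap ONine KNine))) ∈
      ONine := by
  set ι := algebraMap ONine KNine with hι
  have hu0 : constantCoeff (U.map ι) = 0 := by
    rw [← coeff_zero_eq_constantCoeff, coeff_map, coeff_zero_eq_constantCoeff, hU, map_zero]
  have hv0 : constantCoeff (V.map ι) = 0 := by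
    rw [← coeff_zero_eq_constantCoeff, coeff_map, coeff_zero_eq_constantCoeff, hV, map_zero]
  rw [map_sub, WeierstrassCurve.coeff_subst_eq_sum_range' ℓ hu0 n,
    WeierstrassCurve.coeff_subst_eq_sum_range' ℓ hv0 n, ← Finset.sum_sub_distrib, Finset.mul_sum]
  refine sum_mem fun m _ => ?_
  -- `3 (Uᵐ − Vᵐ) = m · G`
  obtain ⟨G, hG⟩ := natCast_dvd_three_mul_pow_sub_pow C_varpi_sq_dvd_three three_dvd_C_varpi_pow_six
    (fun r hr => isUnit_natCast_of_not_dvd hr) hUV m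
  have key : 3 * (coeff n ((U.map ι) ^ m) - coeff n ((V.map ι) ^ m)) = (m : KNine) * ι (coeff n G) := by
    have h : ι (coeff n (3 * (U ^ m - V ^ m))) = ι (coeff n ((m : ONine⟦X⟧) * G)) := by rw [hG]
    rw [show ((m : ℕ) : ONine⟦X⟧) = PowerSeries.C ((m : ℕ) : ONine) from (map_natCast _ m).symm,
      show (3 : ONine⟦X⟧) = PowerSeries.C (3 : ONine) from (map_ofNat _ 3).symm, coeff_C_mul, coeff_C_mul,
      map_mul, map_mul, map_natCast, map_ofNat, map_sub, map_sub] at h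
    rw [← map_pow, ← map_pow, coeff_map, coeff_map]
    exact h
  rw [← mul_sub, mul_left_comm, key, ← mul_assoc, mul_comm (coeff m ℓ)]
  exact mul_mem (hℓ m) (coeff n G).2

end Literature.NumberTheory.EllipticCurves.DescendedFrobenius.NineHondaEstimate

end Part4

/-!
## Part 5 — port of `Summits/BirchSwinnertonDyer/BirchSwinnertonDyer/Theorems/CyclotomicUntwistNineHondaCongruence.lean` (12 declarations kept)

# Honda's congruence for a good model over the ramified ring `𝓞 = 𝓞_{ℚ₃(ζ₉)}`: `3·(log_𝓔(z⁹) − a·log_𝓔(z³) + 3·log_𝓔(z))` has `𝓞`-integral coefficients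

Declarations of this Part (verbatim port; each keeps its own docstring and citation): `natCast_mul_coeff_formalLog_mem`, `formalLog_subst_frobLHS`, `formalLog_subst_frobRHSPos`, `formalLog_subst_frobRHSNeg`, `frobLHS_sub_frobRHS_eq_zero`, `frobLHS_sub_frobRHS_eq_C_mul`, `three_mul_coeff_honda_mem_of_model`, `tr_specialFibre_eq`, `isElliptic_specialFibre`, `three_mul_coeff_honda_mem`, `hbd_honda_formalLog`, `hbd_honda_classOmega`.

Reference keys (see `references.bib` and the declarations' citations): [Honda1970], [SilvermanAEC2009], [Katz1981CrystallineDieudonne], [BerthelotOgus1983].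
-/

section Part5

open scoped _root_.Classical
open _root_.PowerSeries _root_.IsCyclotomicExtension Literature.NumberTheory.EllipticCurves
  Literature.NumberTheory.EllipticCurves.DescendedFrobenius
  Literature.NumberTheory.EllipticCurves.DescendedFrobenius.NineIntegers
  Literature.NumberTheory.EllipticCurves.DescendedFrobenius.NineHondaEstimate
  Literature.NumberTheory.EllipticCurves.DescendedFrobenius.DescendedFrobeniusTransfer

namespace Literature.NumberTheory.EllipticCurves.DescendedFrobenius.NineHonda

section Logs

variable (E : WeierstrassCurve ONine)

/-- **`m·[Xᵐ] log_𝓔 ∈ 𝓞`** for the base change `𝓔 = E ⊗ ℚ₃(ζ₉)` of a Weierstrass equation over `𝓞`: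
`[Xᵐ]log = c_{m−1}/m` with `c_{m−1}` a coefficient of the integral invariant differential `formalInvDiff`.
[cite: SilvermanAEC2009, IV.4–IV.5] -/
theorem natCast_mul_coeff_formalLog_mem (m : ℕ) :
    (m : KNine) * coeff m (E.map (algebraMap ONine KNine)).formalLog ∈ ONine := by
  set 𝓔 := E.map (algebraMap ONine KNine) with h𝓔
  rcases m with _ | _ | n
  · simp
  · simp [WeierstrassCurve.coeff_one_formalLog]
  · have hc : coeff (n + 2) 𝓔.formalLog = algebraMap ℚ KNine (1 / (n + 2 : ℚ)) * coeff (n + 1) 𝓔.formalOmega := by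
      rw [WeierstrassCurve.formalLog, coeff_mk]
    have hω : coeff (n + 1) 𝓔.formalOmega ∈ ONine := by
      rw [← WeierstrassCurve.formalInvDiff_eq_formalOmega, h𝓔, ← WeierstrassCurve.map_formalInvDiff, coeff_map]
      exact (coeff (n + 1) E.formalInvDiff).2
    have hne : ((n + 2 : ℕ) : KNine) ≠ 0 := Nat.cast_ne_zero.mpr (Nat.succ_ne_zero _)
    have e : ((n + 2 : ℕ) : KNine) * (algebraMap ℚ KNine (1 / (n + 2 : ℚ)) * coeff (n + 1) 𝓔.formalOmega) =
        coeff (n + 1) 𝓔.formalOmega := by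
      rw [← mul_assoc, map_div₀, map_one, show ((n + 2 : ℚ)) = ((n + 2 : ℕ) : ℚ) by push_cast; ring,
        map_natCast, mul_one_div_cancel hne, one_mul]
    rw [hc, e]
    exact hω

/-- `log_𝓔(F_𝓔(X⁹, [3]X)) = log_𝓔(X⁹) + 3·log_𝓔` over `ℚ₃(ζ₉)`. [cite: Honda1970, §6.2] -/
theorem formalLog_subst_frobLHS :
    (E.map (algebraMap ONine KNine)).formalLog.subst (WeierstrassCurve.frobLHS 3 (E.map (algebraMap ONine KNine))) =
      expand (3 ^ 2) (Literature.RingTheory.FormalGroups.prime_sq_ne_zero 3)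
          (E.map (algebraMap ONine KNine)).formalLog +
        3 • (E.map (algebraMap ONine KNine)).formalLog := by
  set 𝓔 := E.map (algebraMap ONine KNine) with h𝓔
  rw [WeierstrassCurve.frobLHS, 𝓔.formalLog_subst_subst_pair_formalGroupLaw
    (WeierstrassCurve.constantCoeff_X_pow' (pow_ne_zero 2 (by norm_num : (3 : ℕ) ≠ 0)))
    (𝓔.constantCoeff_formalMul_subst_X 3), PowerSeries.expand_apply, powerSeries_subst_X_self,
    𝓔.formalLog_subst_formalMul_rat 3]

/-- `log_𝓔([m](X³)) = m·log_𝓔(X³)`. [cite: Honda1970, §6.2 Thm. 9] -/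
theorem formalLog_subst_frobRHSPos (m : ℕ) :
    (E.map (algebraMap ONine KNine)).formalLog.subst (WeierstrassCurve.frobRHSPos 3 (E.map (algebraMap ONine KNine)) m) =
      m • expand 3 (Literature.RingTheory.FormalGroups.prime_ne_zero 3) (E.map (algebraMap ONine KNine)).formalLog := by
  set 𝓔 := E.map (algebraMap ONine KNine) with h𝓔
  have hXp : PowerSeries.HasSubst ((PowerSeries.X : KNine⟦X⟧) ^ 3) := PowerSeries.HasSubst.X_pow (by norm_num)
  rw [WeierstrassCurve.frobRHSPos, ← subst_comp_subst_apply (𝓔.hasSubst_formalMul m) hXp,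
    𝓔.formalLog_subst_formalMul_rat m, PowerSeries.expand_apply, ← PowerSeries.coe_substAlgHom hXp, map_nsmul]

/-- `log_𝓔(i([m](X³))) = −m·log_𝓔(X³)`. [cite: Honda1970, §6.2 Thm. 9] -/
theorem formalLog_subst_frobRHSNeg (m : ℕ) :
    (E.map (algebraMap ONine KNine)).formalLog.subst (WeierstrassCurve.frobRHSNeg 3 (E.map (algebraMap ONine KNine)) m) =
      -(m • expand 3 (Literature.RingTheory.FormalGroups.prime_ne_zero 3) (E.map (algebraMap ONine KNine)).formalLog) := by
  set 𝓔 := E.map (algebraMap ONine KNine) with h𝓔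
  have hP : PowerSeries.HasSubst (WeierstrassCurve.frobRHSPos 3 𝓔 m) :=
    PowerSeries.HasSubst.of_constantCoeff_zero' (𝓔.constantCoeff_frobRHSPos 3 (by norm_num) m)
  rw [WeierstrassCurve.frobRHSNeg, ← WeierstrassCurve.frobRHSPos, ← subst_comp_subst_apply
    (PowerSeries.HasSubst.of_constantCoeff_zero' 𝓔.constantCoeff_formalNeg) hP, 𝓔.formalLog_subst_formalNeg,
    ← PowerSeries.coe_substAlgHom hP, map_neg, PowerSeries.coe_substAlgHom, formalLog_subst_frobRHSPos E m]

end Logs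

/-- **The Frobenius identity over `𝔽₃`, for ANY elliptic curve `Ē/𝔽₃`**: `F_Ē(X⁹, [3]X) = [a](X³)` (resp.
`= i([|a|](X³))`), `a = 4 − #Ē(𝔽₃)` — the tree's `map_toZMod_frobLHS_sub_eq_zero` applied to a `ℤ₃`-lift of `Ē`
(every curve over `𝔽₃` lifts coefficientwise; its generic fibre is elliptic since `Δ ≢ 0`). [cite: SilvermanAEC2009, Thm. V.2.3.1(b)] -/
theorem frobLHS_sub_frobRHS_eq_zero (Ē : WeierstrassCurve (ZMod 3)) [Ē.IsElliptic] :
    WeierstrassCurve.frobLHS 3 Ē -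
      (if 0 ≤ HasseManin.tr Ē then WeierstrassCurve.frobRHSPos 3 Ē (HasseManin.tr Ē).toNat
        else WeierstrassCurve.frobRHSNeg 3 Ē (HasseManin.tr Ē).natAbs) = 0 := by
  -- a `ℤ₃`-lift of `Ē`
  obtain ⟨V, hV⟩ : ∃ V : WeierstrassCurve ℤ_[3], V.map PadicInt.toZMod = Ē :=
    ⟨⟨(Ē.a₁.val : ℤ_[3]), (Ē.a₂.val : ℤ_[3]), (Ē.a₃.val : ℤ_[3]), (Ē.a₄.val : ℤ_[3]), (Ē.a₆.val : ℤ_[3])⟩, by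
      ext <;> simp [WeierstrassCurve.map]⟩
  haveI hEt : (V.map PadicInt.toZMod).IsElliptic := by rw [hV]; infer_instance
  haveI hE : (V.map PadicInt.Coe.ringHom).IsElliptic := by
    refine ⟨?_⟩
    rw [WeierstrassCurve.map_Δ, isUnit_iff_ne_zero]
    intro h0
    have h0' : ((V.Δ : ℤ_[3]) : ℚ_[3]) = 0 := h0
    have hΔ0 : V.Δ = 0 := PadicInt.coe_eq_zero.mp h0'
    have hu : IsUnit (V.map PadicInt.toZMod).Δ := hEt.isUnit
    rw [WeierstrassCurve.map_Δ, hΔ0, map_zero] at hu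
    exact not_isUnit_zero hu
  have h := V.map_toZMod_frobLHS_sub_eq_zero (by norm_num : (3 : ℕ) ≠ 2)
  rw [map_sub, WeierstrassCurve.map_frobLHS 3 V _ (by norm_num)] at h
  simp only [hV] at h
  rw [← h]
  congr 1
  split_ifs
  · rw [WeierstrassCurve.map_frobRHSPos 3 V _ (by norm_num), hV]
  · rw [WeierstrassCurve.map_frobRHSNeg 3 V _ (by norm_num), hV]

/-- **The Frobenius identity modulo `(1 − ζ₉)` for a model over `𝓞` with elliptic special fibre**:
`F_E(X⁹, [3]X) − [a]_E(X³) ∈ (1 − ζ₉)·𝓞⟦X⟧` where `a = tr(E ⊗_ρ 𝔽₃)`. [cite: SilvermanAEC2009, Thm. V.2.3.1(b)] -/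
theorem frobLHS_sub_frobRHS_eq_C_mul (E : WeierstrassCurve ONine) (ρ : ONine →+* ZMod 3) [(E.map ρ).IsElliptic] :
    ∃ G : ONine⟦X⟧, WeierstrassCurve.frobLHS 3 E -
      (if 0 ≤ HasseManin.tr (E.map ρ) then WeierstrassCurve.frobRHSPos 3 E (HasseManin.tr (E.map ρ)).toNat
        else WeierstrassCurve.frobRHSNeg 3 E (HasseManin.tr (E.map ρ)).natAbs) =
      PowerSeries.C (⟨1 - zeta 9 ℚ_[3] KNine, one_sub_zeta_mem⟩ : ONine) * G := by
  apply exists_eq_C_varpi_mul_of_map_eq_zero ρ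
  rw [map_sub, WeierstrassCurve.map_frobLHS 3 E _ (by norm_num), ← frobLHS_sub_frobRHS_eq_zero (E.map ρ)]
  congr 1
  split_ifs
  · rw [WeierstrassCurve.map_frobRHSPos 3 E _ (by norm_num)]
  · rw [WeierstrassCurve.map_frobRHSNeg 3 E _ (by norm_num)]

/-- **Honda's congruence for a model over `𝓞 = 𝓞_{ℚ₃(ζ₉)}` (coefficient form).** For a Weierstrass equation `E`
over `𝓞` with elliptic special fibre `E ⊗_ρ 𝔽₃` of trace `a = 4 − #(E ⊗_ρ 𝔽₃)(𝔽₃)`: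
`3·[Xⁿ](log_𝓔(X⁹) − a·log_𝓔(X³) + 3·log_𝓔(X)) ∈ 𝓞` for every `n` (`𝓔 = E ⊗ ℚ₃(ζ₉)`).
[cite: Honda1970, §6.2 Thm. 9] [cite: Katz1981CrystallineDieudonne, Key Lemma 5.1.3] -/
theorem three_mul_coeff_honda_mem_of_model (E : WeierstrassCurve ONine) (ρ : ONine →+* ZMod 3)
    [(E.map ρ).IsElliptic] (n : ℕ) :
    3 * coeff n (expand (3 ^ 2) (Literature.RingTheory.FormalGroups.prime_sq_ne_zero 3)
          (E.map (algebraMap ONine KNine)).formalLog -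
        PowerSeries.C ((HasseManin.tr (E.map ρ) : ℤ) : KNine) *
          expand 3 (Literature.RingTheory.FormalGroups.prime_ne_zero 3) (E.map (algebraMap ONine KNine)).formalLog +
        3 * (E.map (algebraMap ONine KNine)).formalLog) ∈ ONine := by
  set ι := algebraMap ONine KNine with hι
  set 𝓔 := E.map ι with h𝓔
  set a := HasseManin.tr (E.map ρ) with ha
  set RE : ONine⟦X⟧ := if 0 ≤ a then WeierstrassCurve.frobRHSPos 3 E a.toNat
    else WeierstrassCurve.frobRHSNeg 3 E a.natAbs with hRE
  obtain ⟨G, hG⟩ := frobLHS_sub_frobRHS_eq_C_mul E ρ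
  rw [← ha] at hG
  have hdvd : PowerSeries.C (⟨1 - zeta 9 ℚ_[3] KNine, one_sub_zeta_mem⟩ : ONine) ∣
      WeierstrassCurve.frobLHS 3 E - RE := ⟨G, hG⟩
  have hU0 : constantCoeff (WeierstrassCurve.frobLHS 3 E) = 0 := E.constantCoeff_frobLHS 3 (by norm_num)
  have hV0 : constantCoeff RE = 0 := by
    rw [hRE]; split_ifs
    · exact E.constantCoeff_frobRHSPos 3 (by norm_num) _
    · exact E.constantCoeff_frobRHSNeg 3 (by norm_num) _
  have key := three_mul_coeff_subst_sub_subst_mem (natCast_mul_coeff_formalLog_mem E) hU0 hV0 hdvd n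
  -- identify the two logarithms
  have hu : (WeierstrassCurve.frobLHS 3 E).map ι = WeierstrassCurve.frobLHS 3 𝓔 :=
    WeierstrassCurve.map_frobLHS 3 E _ (by norm_num)
  have hlog : 𝓔.formalLog.subst ((WeierstrassCurve.frobLHS 3 E).map ι) - 𝓔.formalLog.subst (RE.map ι) =
      expand (3 ^ 2) (Literature.RingTheory.FormalGroups.prime_sq_ne_zero 3) 𝓔.formalLog -
        PowerSeries.C ((a : ℤ) : KNine) * expand 3 (Literature.RingTheory.FormalGroups.prime_ne_zero 3) 𝓔.formalLog +
        3 * 𝓔.formalLog := by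
    rw [hu, formalLog_subst_frobLHS E, hRE]
    split_ifs with hpos
    · rw [WeierstrassCurve.map_frobRHSPos 3 E _ (by norm_num), ← h𝓔, formalLog_subst_frobRHSPos E,
        nsmul_eq_mul, nsmul_eq_mul, show ((a.toNat : ℕ) : KNine⟦X⟧) = PowerSeries.C ((a : ℤ) : KNine) by
          rw [← map_natCast (PowerSeries.C (R := KNine)), ← Int.cast_natCast, Int.toNat_of_nonneg hpos],
        show ((3 : ℕ) : KNine⟦X⟧) = 3 from rfl]
      ring
    · rw [WeierstrassCurve.map_frobRHSNeg 3 E _ (by norm_num), ← h𝓔, formalLog_subst_frobRHSNeg E,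
        nsmul_eq_mul, nsmul_eq_mul, show ((a.natAbs : ℕ) : KNine⟦X⟧) = -PowerSeries.C ((a : ℤ) : KNine) by
          rw [← map_natCast (PowerSeries.C (R := KNine)), ← map_neg, ← Int.cast_natCast, ← Int.cast_neg]
          congr 2
          omega,
        show ((3 : ℕ) : KNine⟦X⟧) = 3 from rfl]
      ring
  rw [← hlog]
  exact key

/-- `HasseManin.tr` of the special fibre is the model's `specialFibreTrace` (`#𝔽₃ + 1 = 4`). [cite: Honda1970, §6.2 Thm. 9] -/
theorem tr_specialFibre_eq {W : WeierstrassCurve ℚ} (𝓜 : W.NineGoodModel) (ρ : ONine →+* ZMod 3) :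
    HasseManin.tr (𝓜.E.map ρ) = 𝓜.specialFibreTrace ρ := by
  rw [HasseManin.tr, WeierstrassCurve.NineGoodModel.specialFibreTrace, WeierstrassCurve.NineGoodModel.specialFibre,
    ZMod.card]
  norm_num

/-- The special fibre of a good model is an elliptic curve over `𝔽₃` (unit discriminant). [cite: SilvermanAEC2009, VII.1] -/
theorem isElliptic_specialFibre {W : WeierstrassCurve ℚ} (𝓜 : W.NineGoodModel) (ρ : ONine →+* ZMod 3) :
    (𝓜.E.map ρ).IsElliptic :=
  ⟨by rw [WeierstrassCurve.map_Δ]; exact 𝓜.isUnit_Δ.map ρ⟩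

/-- **HONDA'S CONGRUENCE OVER `𝓞_{ℚ₃(ζ₉)}` for a good model of `W/ℚ`.** For every `𝓜 : W.NineGoodModel` and every
reduction map `ρ`, with `a = 𝓜.specialFibreTrace ρ` and `𝓔 = 𝓜.curve`:
`3·[Xⁿ](log_𝓔(X⁹) − a·log_𝓔(X³) + 3·log_𝓔(X)) ∈ 𝓞` for every `n`. [cite: Honda1970, §6.2 Thm. 9]
[cite: Katz1981CrystallineDieudonne, Key Lemma 5.1.3 and Thm. 5.1.4] -/
theorem three_mul_coeff_honda_mem {W : WeierstrassCurve ℚ} (𝓜 : W.NineGoodModel) (ρ : ONine →+* ZMod 3) (n : ℕ) :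
    3 * coeff n (expand (3 ^ 2) (Literature.RingTheory.FormalGroups.prime_sq_ne_zero 3) 𝓜.curve.formalLog -
        PowerSeries.C ((𝓜.specialFibreTrace ρ : ℤ) : KNine) *
          expand 3 (Literature.RingTheory.FormalGroups.prime_ne_zero 3) 𝓜.curve.formalLog +
        3 * 𝓜.curve.formalLog) ∈ ONine := by
  haveI := isElliptic_specialFibre 𝓜 ρ
  rw [← tr_specialFibre_eq 𝓜 ρ]
  exact three_mul_coeff_honda_mem_of_model 𝓜.E ρ n

/-- **Honda's relation has bounded denominators** (denominator `3¹`): `log_𝓔(X⁹) − a·log_𝓔(X³) + 3·log_𝓔 ∈ 𝓞⟦X⟧ ⊗ ℚ`.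
[cite: Honda1970, §6.2 Thm. 9] [cite: Katz1981CrystallineDieudonne, Thm. 5.1.4] -/
theorem hbd_honda_formalLog {W : WeierstrassCurve ℚ} (𝓜 : W.NineGoodModel) (ρ : ONine →+* ZMod 3) :
    HasBoundedDenominators (expand (3 ^ 2) (Literature.RingTheory.FormalGroups.prime_sq_ne_zero 3) 𝓜.curve.formalLog -
        PowerSeries.C ((𝓜.specialFibreTrace ρ : ℤ) : KNine) *
          expand 3 (Literature.RingTheory.FormalGroups.prime_ne_zero 3) 𝓜.curve.formalLog +
        3 * 𝓜.curve.formalLog) := by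
  refine ⟨1, fun n => ?_⟩
  rw [pow_one]
  exact three_mul_coeff_honda_mem 𝓜 ρ n

/-- **Honda's relation on the Néron class `[ω_W] = u⁻¹·log_𝓔`**: for every good model 𝓜 of `W` and every `ρ`,
`classOmega(X⁹) − a·classOmega(X³) + 3·classOmega` has bounded denominators (`a = 𝓜.specialFibreTrace ρ`) — i.e.
with `φ = (z ↦ z³)^*` on `ℚ₃(ζ₉)⟦z⟧/(bounded denominators)`: `(φ² − aφ + 3)[ω_W] = 0`.
[cite: Katz1981CrystallineDieudonne, Thm. 5.1.4 and (6.1.1)] [cite: BerthelotOgus1983, Prop. (3.14)] -/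
theorem hbd_honda_classOmega {W : WeierstrassCurve ℚ} (𝓜 : W.NineGoodModel) (ρ : ONine →+* ZMod 3) :
    HasBoundedDenominators (expand (3 ^ 2) (Literature.RingTheory.FormalGroups.prime_sq_ne_zero 3) 𝓜.classOmega -
        PowerSeries.C ((𝓜.specialFibreTrace ρ : ℤ) : KNine) *
          expand 3 (Literature.RingTheory.FormalGroups.prime_ne_zero 3) 𝓜.classOmega +
        3 * 𝓜.classOmega) := by
  have h := hbd_C_mul ((𝓜.C.u⁻¹ : KNineˣ) : KNine) (hbd_honda_formalLog 𝓜 ρ)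
  have e : PowerSeries.C ((𝓜.C.u⁻¹ : KNineˣ) : KNine) *
      (expand (3 ^ 2) (Literature.RingTheory.FormalGroups.prime_sq_ne_zero 3) 𝓜.curve.formalLog -
        PowerSeries.C ((𝓜.specialFibreTrace ρ : ℤ) : KNine) *
          expand 3 (Literature.RingTheory.FormalGroups.prime_ne_zero 3) 𝓜.curve.formalLog +
        3 * 𝓜.curve.formalLog) =
      expand (3 ^ 2) (Literature.RingTheory.FormalGroups.prime_sq_ne_zero 3) 𝓜.classOmega -
        PowerSeries.C ((𝓜.specialFibreTrace ρ : ℤ) : KNine) *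
          expand 3 (Literature.RingTheory.FormalGroups.prime_ne_zero 3) 𝓜.classOmega +
        3 * 𝓜.classOmega := by
    rw [WeierstrassCurve.NineGoodModel.classOmega, smul_eq_C_mul, map_mul, map_mul, expand_C, expand_C]
    ring
  rwa [e] at h

end Literature.NumberTheory.EllipticCurves.DescendedFrobenius.NineHonda

end Part5

/-!
## Part 6 — port of `Summits/BirchSwinnertonDyer/BirchSwinnertonDyer/Theorems/CyclotomicUntwistNineGoodModelTransportCalculus.lean` (9 declarations kept)

# Bounded-denominator calculus under an integral substitution `Γ ∈ z𝓞⟦z⟧` (`𝓞 = 𝓞_{ℚ₃(ζ₉)}`): substitution preserves bounded denominators, `Γ^{3ᵏ} ≡ Γ(z^{3ᵏ}) (mod ϖ)`, power maps commute with `∘Γ` modulo bounded denominators for log-type ser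

Declarations of this Part (verbatim port; each keeps its own docstring and citation): `hbd_subst`, `expand_three_pow_succ`, `C_dvd_pow_three_pow_sub_expand`, `isIntegral_three_pow_mul_coeff_subst_sub_subst`, `expand_subst_eq_subst_expand`, `hbd_expand_subst_sub_expand_subst`, `logType_formalLog`, `logType_C_mul`, `logType_classOmega`.

Reference keys (see `references.bib` and the declarations' citations): [Katz1981CrystallineDieudonne], [BerthelotOgus1983], [SilvermanAEC2009].
-/

section Part6

open scoped _root_.Classical
open _root_.PowerSeries _root_.WeierstrassCurve Literature.NumberTheory.EllipticCurves.DescendedFrobenius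
  Literature.NumberTheory.EllipticCurves.DescendedFrobenius
  Literature.NumberTheory.EllipticCurves.DescendedFrobenius.DescendedFrobeniusTransfer
  Literature.NumberTheory.EllipticCurves.DescendedFrobenius.NineGoodModelTransport

namespace Literature.NumberTheory.EllipticCurves.DescendedFrobenius.NineGoodModelTransportCalculus

/-- **Substitution of an integral series preserves bounded denominators**: if `3ᵈ·f ∈ 𝓞⟦z⟧` and
`Γ ∈ z𝓞⟦z⟧`, then `3ᵈ·f(Γ) ∈ 𝓞⟦z⟧` (`[zⁿ]f(Γ) = Σ_{m ≤ n} f_m [zⁿ]Γᵐ`).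
[cite: Katz1981CrystallineDieudonne, §5.1 (p. 193)] -/
theorem hbd_subst {f : KNine⟦X⟧} (hf : HasBoundedDenominators f) {G : ONine⟦X⟧}
    (hG : constantCoeff G = 0) :
    HasBoundedDenominators (f.subst (G.map (algebraMap ONine KNine))) := by
  obtain ⟨d, hd⟩ := hf
  have hG' : constantCoeff (G.map (algebraMap ONine KNine)) = 0 := by
    rw [← coeff_zero_eq_constantCoeff, coeff_map, coeff_zero_eq_constantCoeff, hG, map_zero]
  refine ⟨d, fun n => ?_⟩
  rw [coeff_subst_eq_sum_range' f hG' n, Finset.mul_sum]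
  refine IsIntegral.sum _ fun m _ => ?_
  rw [← mul_assoc, ← map_pow]
  exact (hd m).mul (isIntegral_coeff_map _ _)

/-- `G(z^{3^{k+1}}) = (G(z^{3ᵏ}))(z³)` (iterated power maps). [cite: Katz1981CrystallineDieudonne, §5.1 (p. 193)] -/
theorem expand_three_pow_succ {R : Type*} [CommRing R] (G : R⟦X⟧) (k : ℕ) :
    expand (3 ^ (k + 1)) (pow_ne_zero _ (by norm_num)) G =
      expand 3 (by norm_num) (expand (3 ^ k) (pow_ne_zero _ (by norm_num)) G) := by
  rw [expand_apply, expand_apply, expand_apply,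
    subst_comp_subst_apply (HasSubst.X_pow (pow_ne_zero _ (by norm_num))) (HasSubst.X_pow (by norm_num)),
    subst_pow (HasSubst.X_pow (by norm_num)), subst_X (HasSubst.X_pow (by norm_num)), ← pow_mul,
    ← pow_succ']

/-- `Γ^{3ᵏ} ≡ Γ(z^{3ᵏ}) (mod ϖ𝓞⟦z⟧)` for every `Γ ∈ 𝓞⟦z⟧`: the `3ᵏ`-th power map of `𝓞/ϖ = 𝔽₃`-series is
`z ↦ z^{3ᵏ}` on exponents. [cite: BerthelotOgus1983, Thm. 2.4 (proof)] -/
theorem C_dvd_pow_three_pow_sub_expand {ϖ : ONine} (ρ : ONine →+* ZMod 3)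
    (hker : ∀ x : ONine, ρ x = 0 → ϖ ∣ x) (G : ONine⟦X⟧) (k : ℕ) :
    PowerSeries.C ϖ ∣ G ^ 3 ^ k - expand (3 ^ k) (pow_ne_zero k (by norm_num)) G := by
  induction k with
  | zero => simp
  | succ k ih =>
    set A := expand (3 ^ k) (pow_ne_zero k (by norm_num)) G with hA
    have h3 : PowerSeries.C ϖ ∣ A ^ 3 - expand 3 (by norm_num) A := by
      choose c hc using KatzFrobenius.dvd_mvCoeff_pow_three_sub_expand (σ := Unit) ρ hker A
      refine ⟨PowerSeries.mk fun n => c (Finsupp.single () n), PowerSeries.ext fun n => ?_⟩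
      rw [coeff_C_mul, coeff_mk]
      exact hc (Finsupp.single () n)
    have e1 : G ^ 3 ^ (k + 1) - expand (3 ^ (k + 1)) (pow_ne_zero (k + 1) (by norm_num)) G =
        ((G ^ 3 ^ k) ^ 3 - A ^ 3) + (A ^ 3 - expand 3 (by norm_num) A) := by
      rw [expand_three_pow_succ, ← hA, pow_succ, pow_mul]; ring
    rw [e1]
    exact dvd_add (ih.trans (sub_dvd_pow_sub_pow _ _ 3)) h3

/-- Katz's Key Lemma modulo `ϖ` (g8, `KatzFrobenius.isIntegral_three_pow_mul_mvCoeff_subst_sub_subst`)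
read for ONE-variable series. [cite: Katz1981CrystallineDieudonne, §5 Key Lemma 5.1.3] -/
theorem isIntegral_three_pow_mul_coeff_subst_sub_subst {ϖ θ θ' : ONine}
    (h3 : (3 : ONine) = ϖ ^ 6 * θ) (hθ : θ * θ' = 1) {f : KNine⟦X⟧} {d : ℕ}
    (hf : ∀ n : ℕ, IsIntegral ℤ_[3] ((3 : KNine) ^ d * ((n : KNine) * coeff n f)))
    {U V : ONine⟦X⟧} (hU0 : constantCoeff U = 0) (hV0 : constantCoeff V = 0)
    (hUV : PowerSeries.C ϖ ∣ U - V) (n : ℕ) :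
    IsIntegral ℤ_[3] ((3 : KNine) ^ (d + 1) * coeff n
      (f.subst (U.map (algebraMap ONine KNine)) - f.subst (V.map (algebraMap ONine KNine)))) :=
  KatzFrobenius.isIntegral_three_pow_mul_mvCoeff_subst_sub_subst (σ := Unit) h3 hθ hf hU0 hV0 hUV
    (Finsupp.single () n)

/-- `(f ∘ Γ)(z^q) = f(Γ(z^q))`. [cite: Katz1981CrystallineDieudonne, §5.1 (p. 193)] -/
theorem expand_subst_eq_subst_expand {R : Type*} [CommRing R] {Γ : R⟦X⟧} (hΓ : constantCoeff Γ = 0)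
    (q : ℕ) (hq : q ≠ 0) (f : R⟦X⟧) :
    expand q hq (f.subst Γ) = f.subst (expand q hq Γ) := by
  rw [expand_apply, expand_apply,
    subst_comp_subst_apply (HasSubst.of_constantCoeff_zero' hΓ) (HasSubst.X_pow hq)]

/-- **Power maps commute with an integral substitution modulo bounded denominators.** For `f ∈ ℚ₃(ζ₉)⟦z⟧`
with `3ᵈ·n·[zⁿ]f ∈ 𝓞` (log-type denominators) and `Γ ∈ z𝓞⟦z⟧`:
`(f(z^{3ᵏ}))∘Γ − (f∘Γ)(z^{3ᵏ}) = f(Γ^{3ᵏ}) − f(Γ(z^{3ᵏ}))` has bounded denominators (`Γ^{3ᵏ} ≡ Γ(z^{3ᵏ}) (mod ϖ)`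
and Katz's Key Lemma modulo `ϖ`). [cite: Katz1981CrystallineDieudonne, §5 Key Lemma 5.1.3 and Thm 5.1.4] -/
theorem hbd_expand_subst_sub_expand_subst {f : KNine⟦X⟧} {d : ℕ}
    (hf : ∀ n : ℕ, IsIntegral ℤ_[3] ((3 : KNine) ^ d * ((n : KNine) * coeff n f)))
    {G : ONine⟦X⟧} (hG : constantCoeff G = 0) (k : ℕ) :
    HasBoundedDenominators
      ((expand (3 ^ k) (pow_ne_zero k (by norm_num)) f).subst (G.map (algebraMap ONine KNine)) -
        expand (3 ^ k) (pow_ne_zero k (by norm_num)) (f.subst (G.map (algebraMap ONine KNine)))) := by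
  set ι := algebraMap ONine KNine with hι
  obtain ⟨ϖ, θ, θ', h3, hθ, hker, -⟩ := KatzFrobenius.exists_uniformizer
  obtain ⟨ρ⟩ := NineIntegers.nonempty_residueMap
  have hUV := C_dvd_pow_three_pow_sub_expand ρ (hker ρ) G k
  have hG' : constantCoeff (G.map ι) = 0 := by
    rw [← coeff_zero_eq_constantCoeff, coeff_map, coeff_zero_eq_constantCoeff, hG, map_zero]
  have hU0 : constantCoeff (G ^ 3 ^ k) = 0 := by
    rw [map_pow, hG, zero_pow (pow_ne_zero k (by norm_num))]
  have hV0 : constantCoeff (expand (3 ^ k) (pow_ne_zero k (by norm_num)) G) = 0 := by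
    rw [constantCoeff_expand, hG]
  have e : (expand (3 ^ k) (pow_ne_zero k (by norm_num)) f).subst (G.map ι) -
        expand (3 ^ k) (pow_ne_zero k (by norm_num)) (f.subst (G.map ι)) =
      f.subst ((G ^ 3 ^ k).map ι) - f.subst ((expand (3 ^ k) (pow_ne_zero k (by norm_num)) G).map ι) := by
    rw [KatzFrobenius.expand_subst_eq hG', expand_subst_eq_subst_expand hG', map_pow, map_expand]
  rw [e]
  exact ⟨d + 1, isIntegral_three_pow_mul_coeff_subst_sub_subst h3 hθ hf hU0 hV0 hUV⟩

section LogType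

variable {W : WeierstrassCurve ℚ} (𝓜 : W.NineGoodModel)

/-- `n·[zⁿ] log_𝓔 ∈ 𝓞` for the good model (`NineHonda.natCast_mul_coeff_formalLog_mem`), in the `3ᵈ`-form with
`d = 0`. [cite: SilvermanAEC2009, IV.4–IV.5] -/
theorem logType_formalLog (n : ℕ) :
    _root_.IsIntegral ℤ_[3] ((3 : KNine) ^ 0 * ((n : KNine) * coeff n 𝓜.curve.formalLog)) := by
  rw [pow_zero, one_mul]
  exact NineHonda.natCast_mul_coeff_formalLog_mem 𝓜.E n

end LogType

section Classes

variable {W : WeierstrassCurve ℚ} (𝓜 : W.NineGoodModel)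

/-- Scaling a log-type series by a constant of `K` keeps it log-type (with a larger `3`-power). [cite: Katz1981CrystallineDieudonne, §5.1 (p. 193)] -/
theorem logType_C_mul (c : KNine) {f : KNine⟦X⟧} {d : ℕ}
    (hf : ∀ n : ℕ, _root_.IsIntegral ℤ_[3] ((3 : KNine) ^ d * ((n : KNine) * coeff n f))) :
    ∃ d' : ℕ, ∀ n : ℕ, _root_.IsIntegral ℤ_[3] ((3 : KNine) ^ d' * ((n : KNine) * coeff n (PowerSeries.C c * f))) := by
  obtain ⟨k, hk⟩ := exists_three_pow_mul_isIntegral c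
  refine ⟨k + d, fun n => ?_⟩
  rw [coeff_C_mul, show (3 : KNine) ^ (k + d) * ((n : KNine) * (c * coeff n f)) =
    ((3 : KNine) ^ k * c) * ((3 : KNine) ^ d * ((n : KNine) * coeff n f)) by ring]
  exact (hk).mul (hf n)

/-- **`classOmega` has log-type denominators**: `3ᵈ·n·[zⁿ]classOmega ∈ 𝓞` for some `d` (`= u⁻¹·log_𝓔`).
[cite: Katz1981CrystallineDieudonne, §5 Lemma 5.1.2] -/
theorem logType_classOmega :
    ∃ d : ℕ, ∀ n : ℕ, _root_.IsIntegral ℤ_[3] ((3 : KNine) ^ d * ((n : KNine) * coeff n 𝓜.classOmega)) := by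
  rw [NineGoodModel.classOmega, smul_eq_C_mul]
  exact logType_C_mul _ (logType_formalLog 𝓜)

end Classes

end Literature.NumberTheory.EllipticCurves.DescendedFrobenius.NineGoodModelTransportCalculus

end Part6

/-!
## Part 7 — port of `Summits/BirchSwinnertonDyer/BirchSwinnertonDyer/Theorems/CyclotomicUntwistPadicDigitLimit.lean` (10 declarations kept)

# The bridge : from Honda's `pᵏg = log(h)` and the digit expansion `h̄ = [a_J] ⊕ [b_J]π ⊕ [pᴶ]g_J` of the endomorphism `h̄` (numbers `a_J → A`, `b_J → B`) to `pᵏg − A·log − B·log(Xᵖ) ∈ ℤ_p⟦X⟧` — the `H3ss` binder of the `CyclotomicUntwist` Ka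

Declarations of this Part (verbatim port; each keeps its own docstring and citation): `norm_coeff_le_pow`, `norm_coeff_subst_le_pow`, `norm_coeff_expand_le_pow`, `isPadicInt_sub_of_digits`, `constantCoeff_inner`, `constantCoeff_formalMul_subst`, `map_level`, `formalLog_subst_level`, `exists_lift_eq`, `padicRankTwo_of_honda_of_digits`.

Reference keys (see `references.bib` and the declarations' citations): [Katz1981CrystallineDieudonne], [SilvermanAEC2009], [Honda1970].
-/

section Part7

open scoped _root_.Classical
open _root_.PowerSeries _root_.WeierstrassCurve Literature.NumberTheory.EllipticCurves
  Literature.NumberTheory.EllipticCurves.DescendedFrobenius.PadicRankTwoAssembly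

namespace Literature.NumberTheory.EllipticCurves.DescendedFrobenius.PadicDigitLimit

variable {p : ℕ} [hp : Fact p.Prime]

/-! ### §1 Pure analysis: the limit of the digit approximations -/

/-- `‖ℓₙ‖ ≤ pⁿ` for a log-type series without constant term (`‖n·ℓₙ‖ ≤ 1`, `v_p(n) < n`). [cite: Katz1981CrystallineDieudonne, Thm. 5.3.3] -/
theorem norm_coeff_le_pow {ℓ : ℚ_[p]⟦X⟧} (hℓ : ∀ n : ℕ, ‖(n : ℚ_[p]) * coeff n ℓ‖ ≤ 1)
    (hℓ0 : constantCoeff ℓ = 0) (n : ℕ) : ‖coeff n ℓ‖ ≤ (p : ℝ) ^ n := by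
  have hp1 : (1 : ℝ) < p := by exact_mod_cast hp.out.one_lt
  rcases Nat.eq_zero_or_pos n with rfl | hn
  · rw [coeff_zero_eq_constantCoeff, hℓ0, norm_zero, pow_zero]; exact zero_le_one
  · have hn0 : ((n : ℕ) : ℚ_[p]) ≠ 0 := by exact_mod_cast hn.ne'
    have hv : padicValNat p n < n := by
      have h1 := Nat.le_of_dvd hn (pow_padicValNat_dvd (p := p) (n := n))
      have h2 := Nat.lt_pow_self hp.out.one_lt (n := padicValNat p n)
      omega
    have hnorm : ‖(n : ℚ_[p])‖ = (p : ℝ) ^ (-(padicValNat p n : ℤ)) := by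
      rw [Padic.norm_eq_zpow_neg_valuation hn0, Padic.valuation_natCast]
    have hpos : 0 < ‖(n : ℚ_[p])‖ := norm_pos_iff.mpr hn0
    have key := hℓ n
    rw [norm_mul, mul_comm] at key
    rw [← le_div_iff₀ hpos] at key
    refine key.trans ?_
    rw [hnorm, one_div, ← zpow_neg, neg_neg, zpow_natCast]
    exact pow_le_pow_right₀ hp1.le hv.le

/-- `‖[Xⁿ] ℓ(G)‖ ≤ pⁿ` for log-type `ℓ` without constant term and integral `G` without constant term. [cite: Katz1981CrystallineDieudonne, Thm. 5.3.3] -/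
theorem norm_coeff_subst_le_pow {ℓ : ℚ_[p]⟦X⟧} (hℓ : ∀ n : ℕ, ‖(n : ℚ_[p]) * coeff n ℓ‖ ≤ 1)
    (hℓ0 : constantCoeff ℓ = 0) {G : ℚ_[p]⟦X⟧} (hG : IsPadicInt G) (hG0 : constantCoeff G = 0) (n : ℕ) :
    ‖coeff n (ℓ.subst G)‖ ≤ (p : ℝ) ^ n := by
  have hp1 : (1 : ℝ) < p := by exact_mod_cast hp.out.one_lt
  rw [coeff_subst_eq_sum_range' ℓ hG0 n]
  refine IsUltrametricDist.norm_sum_le_of_forall_le_of_nonneg (by positivity) fun m hm ↦ ?_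
  rw [Finset.mem_range] at hm
  rw [norm_mul]
  calc ‖coeff m ℓ‖ * ‖coeff n (G ^ m)‖ ≤ (p : ℝ) ^ m * 1 :=
        mul_le_mul (norm_coeff_le_pow hℓ hℓ0 m) (isPadicInt_iff_coeff.mp (hG.pow m) n) (norm_nonneg _) (by positivity)
    _ ≤ (p : ℝ) ^ n := by rw [mul_one]; exact pow_le_pow_right₀ hp1.le (by omega)

/-- `‖[Xⁿ] ℓ(Xᵖ)‖ ≤ pⁿ` for log-type `ℓ` without constant term. [cite: Katz1981CrystallineDieudonne, Thm. 5.3.3] -/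
theorem norm_coeff_expand_le_pow {ℓ : ℚ_[p]⟦X⟧} (hℓ : ∀ n : ℕ, ‖(n : ℚ_[p]) * coeff n ℓ‖ ≤ 1)
    (hℓ0 : constantCoeff ℓ = 0) (n : ℕ) : ‖coeff n (expand p hp.out.ne_zero ℓ)‖ ≤ (p : ℝ) ^ n := by
  have hp1 : (1 : ℝ) < p := by exact_mod_cast hp.out.one_lt
  rw [coeff_expand]
  split_ifs with h
  · exact (norm_coeff_le_pow hℓ hℓ0 _).trans (pow_le_pow_right₀ hp1.le (Nat.div_le_self n p))
  · rw [norm_zero]; positivity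

/-- **THE LIMIT OF THE DIGIT APPROXIMATIONS (pure `p`-adic analysis).** Let `ℓ ∈ Xℚ_p⟦X⟧` be log-type
(`‖n·ℓₙ‖ ≤ 1`), `Φ ∈ ℚ_p⟦X⟧`, and `a_J → A`, `b_J → B` in `ℚ_p` with `‖a_J − A‖, ‖b_J − B‖ ≤ p^{−J}`. If at every
level `J` there is an integral `G_J ∈ Xℚ_p⟦X⟧` with `Φ − a_J·ℓ − b_J·ℓ(Xᵖ) − pᴶ·ℓ(G_J) ∈ ℤ_p⟦X⟧`, then
`Φ − A·ℓ − B·ℓ(Xᵖ) ∈ ℤ_p⟦X⟧`: at the coefficient of `Xⁿ` use level `J = n`, where `‖pᴶ[Xⁿ]ℓ(G_J)‖ ≤ p^{n−J}` and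
`‖(a_J − A)ℓₙ‖ ≤ p^{n−J}`. [cite: Katz1981CrystallineDieudonne, Thm. 5.3.3] -/
theorem isPadicInt_sub_of_digits {ℓ : ℚ_[p]⟦X⟧} (hℓ : ∀ n : ℕ, ‖(n : ℚ_[p]) * coeff n ℓ‖ ≤ 1)
    (hℓ0 : constantCoeff ℓ = 0) {Φ : ℚ_[p]⟦X⟧} {a b : ℕ → ℚ_[p]} {A B : ℚ_[p]}
    (hA : ∀ J : ℕ, ‖a J - A‖ ≤ (p : ℝ) ^ (-(J : ℤ))) (hB : ∀ J : ℕ, ‖b J - B‖ ≤ (p : ℝ) ^ (-(J : ℤ)))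
    (hJ : ∀ J : ℕ, ∃ G : ℚ_[p]⟦X⟧, IsPadicInt G ∧ constantCoeff G = 0 ∧
      IsPadicInt (Φ - C (a J) * ℓ - C (b J) * expand p hp.out.ne_zero ℓ - C ((p : ℚ_[p]) ^ J) * ℓ.subst G)) :
    IsPadicInt (Φ - C A * ℓ - C B * expand p hp.out.ne_zero ℓ) := by
  have hp1 : (1 : ℝ) < p := by exact_mod_cast hp.out.one_lt
  have hp0 : (0 : ℝ) < p := by positivity
  rw [isPadicInt_iff_coeff]
  intro n
  obtain ⟨G, hG, hG0, hR⟩ := hJ n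
  have hRn := isPadicInt_iff_coeff.mp hR n
  -- decomposition of the coefficient
  have e : coeff n (Φ - C A * ℓ - C B * expand p hp.out.ne_zero ℓ) =
      coeff n (Φ - C (a n) * ℓ - C (b n) * expand p hp.out.ne_zero ℓ - C ((p : ℚ_[p]) ^ n) * ℓ.subst G) +
        ((p : ℚ_[p]) ^ n * coeff n (ℓ.subst G) +
          ((a n - A) * coeff n ℓ + (b n - B) * coeff n (expand p hp.out.ne_zero ℓ))) := by
    simp only [map_sub, coeff_C_mul]; ring
  rw [e]
  have hpn : ‖(p : ℚ_[p]) ^ n‖ = (p : ℝ) ^ (-(n : ℤ)) := Padic.norm_p_pow n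
  have hcancel : (p : ℝ) ^ (-(n : ℤ)) * (p : ℝ) ^ n = 1 := by
    rw [zpow_neg, zpow_natCast, inv_mul_cancel₀ (by positivity)]
  have h2 : ‖(p : ℚ_[p]) ^ n * coeff n (ℓ.subst G)‖ ≤ 1 := by
    rw [norm_mul, hpn]
    calc (p : ℝ) ^ (-(n : ℤ)) * ‖coeff n (ℓ.subst G)‖ ≤ (p : ℝ) ^ (-(n : ℤ)) * (p : ℝ) ^ n := by
          gcongr; exact norm_coeff_subst_le_pow hℓ hℓ0 hG hG0 n
      _ = 1 := hcancel
  have h3 : ‖(a n - A) * coeff n ℓ‖ ≤ 1 := by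
    rw [norm_mul]
    calc ‖a n - A‖ * ‖coeff n ℓ‖ ≤ (p : ℝ) ^ (-(n : ℤ)) * (p : ℝ) ^ n :=
          mul_le_mul (hA n) (norm_coeff_le_pow hℓ hℓ0 n) (norm_nonneg _) (by positivity)
      _ = 1 := hcancel
  have h4 : ‖(b n - B) * coeff n (expand p hp.out.ne_zero ℓ)‖ ≤ 1 := by
    rw [norm_mul]
    calc ‖b n - B‖ * ‖coeff n (expand p hp.out.ne_zero ℓ)‖ ≤ (p : ℝ) ^ (-(n : ℤ)) * (p : ℝ) ^ n :=
          mul_le_mul (hB n) (norm_coeff_expand_le_pow hℓ hℓ0 n) (norm_nonneg _) (by positivity)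
      _ = 1 := hcancel
  refine (IsUltrametricDist.norm_add_le_max _ _).trans (max_le hRn ?_)
  refine (IsUltrametricDist.norm_add_le_max _ _).trans (max_le h2 ?_)
  exact (IsUltrametricDist.norm_add_le_max _ _).trans (max_le h3 h4)

/-! ### §2 The level-`J` composite `F(F([a]X, [b](Xᵖ)), [N](G))`: its logarithm and its base change -/

section Level

variable {R : Type*} [CommRing R] (U : WeierstrassCurve R)

/-- The inner pair `F([a]X, [b](Xᵖ))` has no constant term. [cite: Katz1981CrystallineDieudonne, Thm. 5.3.3] -/
theorem constantCoeff_inner (a b : ℕ) :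
    constantCoeff (MvPowerSeries.subst ![U.formalMul a, expand p hp.out.ne_zero (U.formalMul b)] U.formalGroupLaw :
      R⟦X⟧) = 0 := by
  have ha : constantCoeff (U.formalMul a) = 0 := U.constantCoeff_formalMul a
  have hb : constantCoeff (expand p hp.out.ne_zero (U.formalMul b)) = 0 := by
    rw [constantCoeff_expand]; exact U.constantCoeff_formalMul b
  exact MvPowerSeries.constantCoeff_subst_eq_zero (hasSubst_pair ha hb) (constantCoeff_pair ha hb)
    U.constantCoeff_formalGroupLaw

/-- `[N](G)` has no constant term when `G` has none. [cite: Katz1981CrystallineDieudonne, Thm. 5.3.3] -/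
theorem constantCoeff_formalMul_subst (N : ℕ) {G : R⟦X⟧} (hG0 : constantCoeff G = 0) :
    constantCoeff ((U.formalMul N).subst G) = 0 :=
  constantCoeff_powerSeries_subst_eq_zero hG0 (U.constantCoeff_formalMul N)

/-- **The level composite commutes with ring maps.** [cite: Katz1981CrystallineDieudonne, Thm. 5.3.3] -/
theorem map_level {S : Type*} [CommRing S] (φ : R →+* S) (a b N : ℕ) {G : R⟦X⟧} (hG0 : constantCoeff G = 0) :
    PowerSeries.map φ (MvPowerSeries.subst ![MvPowerSeries.subst ![U.formalMul a, expand p hp.out.ne_zero (U.formalMul b)]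
        U.formalGroupLaw, (U.formalMul N).subst G] U.formalGroupLaw : R⟦X⟧) =
      MvPowerSeries.subst ![MvPowerSeries.subst ![(U.map φ).formalMul a,
          expand p hp.out.ne_zero ((U.map φ).formalMul b)] (U.map φ).formalGroupLaw,
        ((U.map φ).formalMul N).subst (G.map φ)] (U.map φ).formalGroupLaw := by
  have ha : constantCoeff (U.formalMul a) = 0 := U.constantCoeff_formalMul a
  have hb : constantCoeff (expand p hp.out.ne_zero (U.formalMul b)) = 0 := by
    rw [constantCoeff_expand]; exact U.constantCoeff_formalMul b
  have hm : PowerSeries.map φ ((U.formalMul N).subst G) = ((U.formalMul N).map φ).subst (G.map φ) := by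
    change MvPowerSeries.map φ ((U.formalMul N).subst G) = _
    rw [PowerSeries.map_subst (HasSubst.of_constantCoeff_zero' hG0)]
    rfl
  rw [U.map_subst_pair_formalGroupLaw_powerSeries φ (constantCoeff_inner U a b) (constantCoeff_formalMul_subst U N hG0),
    U.map_subst_pair_formalGroupLaw_powerSeries φ ha hb, PowerSeries.map_expand, U.map_formalMul, U.map_formalMul, hm,
    U.map_formalMul]

end Level

section LevelLog

variable (W : WeierstrassCurve ℚ_[p]) [hW : W.IsIntegral ℤ_[p]]

/-- **`log_W F(F([a]X, [b](Xᵖ)), [N](G)) = a·log_W + b·log_W(Xᵖ) + N·log_W(G)`** (`log_W` is a homomorphism to `𝔾_a`,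
`log_W ∘ [n] = n·log_W`). [cite: SilvermanAEC2009, IV.5.2 and IV.2.3] -/
theorem formalLog_subst_level (a b N : ℕ) {G : ℚ_[p]⟦X⟧} (hG0 : constantCoeff G = 0) :
    W.formalLog.subst (MvPowerSeries.subst ![MvPowerSeries.subst ![W.formalMul a, expand p hp.out.ne_zero (W.formalMul b)]
        W.formalGroupLaw, (W.formalMul N).subst G] W.formalGroupLaw : ℚ_[p]⟦X⟧) =
      C (a : ℚ_[p]) * W.formalLog + C (b : ℚ_[p]) * expand p hp.out.ne_zero W.formalLog + C (N : ℚ_[p]) * W.formalLog.subst G := by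
  have ha : constantCoeff (W.formalMul a) = 0 := W.constantCoeff_formalMul a
  have hb0 : constantCoeff (W.formalMul b) = 0 := W.constantCoeff_formalMul b
  have hb : constantCoeff (expand p hp.out.ne_zero (W.formalMul b)) = 0 := by rw [constantCoeff_expand]; exact hb0
  have hN : constantCoeff (W.formalMul N) = 0 := W.constantCoeff_formalMul N
  have hGs : HasSubst G := HasSubst.of_constantCoeff_zero' hG0
  rw [formalLog_subst_pair W (constantCoeff_inner W a b) (constantCoeff_formalMul_subst W N hG0)]
  change W.formalLog.subst (MvPowerSeries.subst ![W.formalMul a, expand p hp.out.ne_zero (W.formalMul b)] W.formalGroupLaw) +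
    W.formalLog.subst ((W.formalMul N).subst G) = _
  rw [formalLog_subst_pair W ha hb]
  rw [← NineGoodModelTransportCalculus.expand_subst_eq_subst_expand hb0, W.formalLog_subst_formalMul,
    W.formalLog_subst_formalMul, ← subst_comp_subst_apply (HasSubst.of_constantCoeff_zero' hN) hGs,
    W.formalLog_subst_formalMul, nsmul_eq_mul, nsmul_eq_mul, nsmul_eq_mul, subst_mul hGs,
    ← map_natCast (C (R := ℚ_[p])) a, ← map_natCast (C (R := ℚ_[p])) b, ← map_natCast (C (R := ℚ_[p])) N, map_mul,
    expand_C, subst_C]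
  rfl

end LevelLog

/-! ### §3 The bridge: Honda step + digit theorem ⟹ rank `≤ 2` over `ℤ_p` -/

section Bridge

variable (V : WeierstrassCurve ℤ_[p]) [hE : (V.map PadicInt.Coe.ringHom).IsElliptic]
  [hEt : (V.map PadicInt.toZMod).IsElliptic]

/-- A series over `𝔽_p` without constant term lifts to an integral series over `ℤ_p` without constant term. [cite: Katz1981CrystallineDieudonne, Thm. 5.3.3] -/
theorem exists_lift_eq (g : (ZMod p)⟦X⟧) (hg : constantCoeff g = 0) :
    ∃ G : ℤ_[p]⟦X⟧, constantCoeff G = 0 ∧ G.map PadicInt.toZMod = g := by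
  have hs := ZMod.ringHom_surjective (PadicInt.toZMod (p := p))
  choose f hf using hs
  refine ⟨PowerSeries.mk fun n => if n = 0 then 0 else f (coeff n g), ?_, ?_⟩
  · rw [← coeff_zero_eq_constantCoeff, coeff_mk, if_pos rfl]
  · ext n
    rw [coeff_map, coeff_mk]
    split_ifs with h
    · rw [h, map_zero, coeff_zero_eq_constantCoeff, hg]
    · exact hf _

/-- **RANK `≤ 2` OVER `ℤ_p` FROM HONDA'S STEP AND THE DIGIT THEOREM** (the body of the binder `H3ss`, per curve). For
`V/ℤ_p` (`p` odd) with elliptic generic and special fibres, GRANTED (W1) *Honda*: every second-kind `g` has `pᵏg = log_W h`,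
`h ∈ Xℤ_p⟦X⟧`, and (★) *digits*: every `H ∈ Xℤ_p⟦X⟧` whose reduction is an endomorphism of the reduced formal group admits,
at every level `J`, natural numbers `a_J, b_J` and `g_J ∈ X𝔽_p⟦X⟧` with `H̄ = F̄(F̄([a_J]X, [b_J](Xᵖ)), [pᴶ](g_J))`,
the digits converging to `A, B ∈ ℤ_p` (`‖a_J − A‖, ‖b_J − B‖ ≤ p^{−J}`) — THEN every second-kind `g` satisfies
`g ≡ a·log_W + b·log_W(Xᵖ)` modulo `p`-power-bounded denominators. Proof: `h̄ ∈ End(F̄)` (lead's B1 over Lemma Λ); lift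
`g_J`, so `h ≡ F(F([a_J]X,[b_J](Xᵖ)),[pᴶ](G_J)) (mod p)`, hence `pᵏg = log h ≡ a_J log + b_J log(Xᵖ) + pᴶ log(G_J)
(mod pℤ_p⟦X⟧)` (Key Lemma over `ℤ_p`, `formalLog_subst_level`); pass to the limit (`isPadicInt_sub_of_digits`); divide by
`pᵏ`. [cite: Katz1981CrystallineDieudonne, Thm. 5.3.3] [cite: Honda1970, Thm. 2] -/
theorem padicRankTwo_of_honda_of_digits (hp2 : p ≠ 2)
    (hW1 : ∀ g : ℚ_[p]⟦X⟧, constantCoeff g = 0 →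
      (∃ d : ℕ, ∀ n : ℕ, ‖(p : ℚ_[p]) ^ d * ((n : ℚ_[p]) * coeff n g)‖ ≤ 1) →
      (∃ d' : ℕ, ∀ e : Fin 2 →₀ ℕ, ‖(p : ℚ_[p]) ^ d' * MvPowerSeries.coeff e
        (g.subst (V.map PadicInt.Coe.ringHom).formalGroupLaw - g.subst (MvPowerSeries.X 0) -
          g.subst (MvPowerSeries.X 1))‖ ≤ 1) →
      ∃ (k : ℕ) (h : ℚ_[p]⟦X⟧), constantCoeff h = 0 ∧ IsPadicInt h ∧
        (V.map PadicInt.Coe.ringHom).formalLog.subst h = C ((p : ℚ_[p]) ^ k) * g)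
    (hDig : ∀ H : ℤ_[p]⟦X⟧, constantCoeff H = 0 →
      (H.map PadicInt.toZMod).subst (V.map PadicInt.toZMod).formalGroupLaw =
        MvPowerSeries.subst ![(H.map PadicInt.toZMod).subst (MvPowerSeries.X 0 : MvPowerSeries (Fin 2) (ZMod p)),
          (H.map PadicInt.toZMod).subst (MvPowerSeries.X 1 : MvPowerSeries (Fin 2) (ZMod p))]
          (V.map PadicInt.toZMod).formalGroupLaw →
      ∃ (A B : ℤ_[p]) (a b : ℕ → ℕ) (g : ℕ → (ZMod p)⟦X⟧),
        (∀ J, constantCoeff (g J) = 0) ∧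
        (∀ J, ‖((a J : ℤ_[p]) - A : ℤ_[p])‖ ≤ (p : ℝ) ^ (-(J : ℤ)) ∧ ‖((b J : ℤ_[p]) - B : ℤ_[p])‖ ≤ (p : ℝ) ^ (-(J : ℤ))) ∧
        ∀ J, H.map PadicInt.toZMod =
          MvPowerSeries.subst ![MvPowerSeries.subst ![(V.map PadicInt.toZMod).formalMul (a J),
              expand p hp.out.ne_zero ((V.map PadicInt.toZMod).formalMul (b J))] (V.map PadicInt.toZMod).formalGroupLaw,
            ((V.map PadicInt.toZMod).formalMul (p ^ J)).subst (g J)] (V.map PadicInt.toZMod).formalGroupLaw) :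
    ∀ g : ℚ_[p]⟦X⟧, constantCoeff g = 0 →
      (∃ d : ℕ, ∀ n : ℕ, ‖(p : ℚ_[p]) ^ d * ((n : ℚ_[p]) * coeff n g)‖ ≤ 1) →
      (∃ d' : ℕ, ∀ e : Fin 2 →₀ ℕ, ‖(p : ℚ_[p]) ^ d' * MvPowerSeries.coeff e
        (g.subst (V.map PadicInt.Coe.ringHom).formalGroupLaw - g.subst (MvPowerSeries.X 0) -
          g.subst (MvPowerSeries.X 1))‖ ≤ 1) →
      ∃ a b : ℚ_[p], ∃ d'' : ℕ, ∀ n : ℕ, ‖(p : ℚ_[p]) ^ d'' * coeff n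
        (g - C a * (V.map PadicInt.Coe.ringHom).formalLog -
          C b * expand p hp.out.ne_zero (V.map PadicInt.Coe.ringHom).formalLog)‖ ≤ 1 := by
  set W := V.map (PadicInt.Coe.ringHom (p := p)) with hWdef
  haveI : W.IsIntegral ℤ_[p] := ⟨⟨V, rfl⟩⟩
  have hp0 : (p : ℚ_[p]) ≠ 0 := by exact_mod_cast hp.out.ne_zero
  intro g hg0 hd hd'
  obtain ⟨k, h, h0, hint, hℓh⟩ := hW1 g hg0 hd hd'
  obtain ⟨d', hcob⟩ := hd'
  -- integral model `H` of `h`; `H̄ ∈ End(F̄)`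
  obtain ⟨H, hH⟩ := isPadicInt_iff_exists_powerSeries_map.mp hint
  have hH0 : constantCoeff H = 0 := by
    apply (PadicInt.coe_eq_zero).mp
    have e := congrArg constantCoeff hH
    rw [← coeff_zero_eq_constantCoeff_apply, coeff_map, coeff_zero_eq_constantCoeff_apply] at e
    rw [← h0]; exact e
  have hEnd := map_toZMod_subst_formalGroupLaw V hp2 hH0 (hH.symm ▸ hℓh) hcob
  obtain ⟨A, B, a, b, gJ, hg0J, hlim, hlev⟩ := hDig H hH0 hEnd
  -- the limit lemma applied to `Φ = pᵏ g = log h`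
  have hℓ := W.norm_natCast_mul_coeff_formalLog_le
  have hℓ0 : constantCoeff W.formalLog = 0 := W.constantCoeff_formalLog
  have hmain : IsPadicInt (C ((p : ℚ_[p]) ^ k) * g - C (A : ℚ_[p]) * W.formalLog -
      C (B : ℚ_[p]) * expand p hp.out.ne_zero W.formalLog) := by
    refine isPadicInt_sub_of_digits hℓ hℓ0 (a := fun J => ((a J : ℕ) : ℚ_[p])) (b := fun J => ((b J : ℕ) : ℚ_[p]))
      (fun J => ?_) (fun J => ?_) (fun J => ?_)
    · have := (hlim J).1; rwa [PadicInt.norm_def, PadicInt.coe_sub, PadicInt.coe_natCast] at this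
    · have := (hlim J).2; rwa [PadicInt.norm_def, PadicInt.coe_sub, PadicInt.coe_natCast] at this
    · -- lift the level `J` to `ℤ_p` and compare logarithms modulo `p`
      obtain ⟨G₀, hG₀0, hG₀⟩ := exists_lift_eq (gJ J) (hg0J J)
      set G := G₀.map (PadicInt.Coe.ringHom (p := p)) with hGdef
      have hG0 : constantCoeff G = 0 := by
        rw [hGdef, ← coeff_zero_eq_constantCoeff_apply, coeff_map, coeff_zero_eq_constantCoeff_apply, hG₀0, map_zero]
      have hGint : IsPadicInt G := isPadicInt_map G₀
      refine ⟨G, hGint, hG0, ?_⟩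
      set K₀ : ℤ_[p]⟦X⟧ := MvPowerSeries.subst ![MvPowerSeries.subst ![V.formalMul (a J),
          expand p hp.out.ne_zero (V.formalMul (b J))] V.formalGroupLaw, (V.formalMul (p ^ J)).subst G₀] V.formalGroupLaw
        with hK₀
      have hK₀bar : K₀.map PadicInt.toZMod = H.map PadicInt.toZMod := by
        rw [hK₀, map_level V PadicInt.toZMod (a J) (b J) (p ^ J) hG₀0, hG₀, ← hlev J]
      set h₁ := K₀.map (PadicInt.Coe.ringHom (p := p)) with hh₁
      have hK₀0 : constantCoeff K₀ = 0 := by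
        rw [hK₀]
        exact MvPowerSeries.constantCoeff_subst_eq_zero
          (hasSubst_pair (constantCoeff_inner V (a J) (b J)) (constantCoeff_formalMul_subst V (p ^ J) hG₀0))
          (constantCoeff_pair (constantCoeff_inner V (a J) (b J)) (constantCoeff_formalMul_subst V (p ^ J) hG₀0))
          V.constantCoeff_formalGroupLaw
      have h₁0 : constantCoeff h₁ = 0 := by
        rw [hh₁, ← coeff_zero_eq_constantCoeff_apply, coeff_map, coeff_zero_eq_constantCoeff_apply, hK₀0, map_zero]
      have hint₁ : IsPadicInt h₁ := isPadicInt_map K₀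
      have hc : IsPadicInt (C (p : ℚ_[p])⁻¹ * (h - h₁)) := by
        have hbar : (H - K₀).map (PadicInt.toZMod (p := p)) = 0 := by rw [map_sub, hK₀bar, sub_self]
        have := FormalLogDivisibility.isPadicInt_inv_mul_of_map_toZMod_eq_zero (σ := Unit) (H - K₀) hbar
        rw [map_sub] at this
        rw [← hH]
        exact this
      have hlog := isPadicInt_inv_mul_formalLog_subst_sub W h0 hint h₁0 hint₁ hc
      have hh₁W : h₁ = MvPowerSeries.subst ![MvPowerSeries.subst ![W.formalMul (a J),
          expand p hp.out.ne_zero (W.formalMul (b J))] W.formalGroupLaw, (W.formalMul (p ^ J)).subst G] W.formalGroupLaw := by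
        rw [hh₁, hK₀, map_level V PadicInt.Coe.ringHom (a J) (b J) (p ^ J) hG₀0]
      rw [hℓh, hh₁W, formalLog_subst_level W (a J) (b J) (p ^ J) hG0, Nat.cast_pow] at hlog
      -- drop the factor `p⁻¹`
      rw [isPadicInt_iff_coeff] at hlog ⊢
      intro n
      have hn := hlog n
      rw [coeff_C_mul, norm_inv_mul_le_one_iff] at hn
      have e : coeff n (C ((p : ℚ_[p]) ^ k) * g - C ((a J : ℕ) : ℚ_[p]) * W.formalLog -
          C ((b J : ℕ) : ℚ_[p]) * expand p hp.out.ne_zero W.formalLog - C ((p : ℚ_[p]) ^ J) * W.formalLog.subst G) =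
          coeff n (C ((p : ℚ_[p]) ^ k) * g - (C ((a J : ℕ) : ℚ_[p]) * W.formalLog +
            C ((b J : ℕ) : ℚ_[p]) * expand p hp.out.ne_zero W.formalLog + C ((p : ℚ_[p]) ^ J) * W.formalLog.subst G)) := by
        simp only [map_sub, map_add]; ring
      rw [e]
      exact hn.trans (inv_le_one_of_one_le₀ (by exact_mod_cast hp.out.one_le))
  -- divide by `pᵏ`
  refine ⟨(A : ℚ_[p]) * ((p : ℚ_[p]) ^ k)⁻¹, (B : ℚ_[p]) * ((p : ℚ_[p]) ^ k)⁻¹, k, fun n => ?_⟩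
  have hpk0 : (p : ℚ_[p]) ^ k ≠ 0 := pow_ne_zero _ hp0
  have e : (p : ℚ_[p]) ^ k * coeff n (g - C ((A : ℚ_[p]) * ((p : ℚ_[p]) ^ k)⁻¹) * W.formalLog -
      C ((B : ℚ_[p]) * ((p : ℚ_[p]) ^ k)⁻¹) * expand p hp.out.ne_zero W.formalLog) =
      coeff n (C ((p : ℚ_[p]) ^ k) * g - C (A : ℚ_[p]) * W.formalLog -
        C (B : ℚ_[p]) * expand p hp.out.ne_zero W.formalLog) := by
    simp only [map_sub, coeff_C_mul]
    field_simp
  rw [e]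
  exact (isPadicInt_iff_coeff.mp hmain) n

end Bridge

end Literature.NumberTheory.EllipticCurves.DescendedFrobenius.PadicDigitLimit

end Part7

/-!
## Part 8 — port of `Summits/BirchSwinnertonDyer/BirchSwinnertonDyer/Theorems/CyclotomicUntwistFormalEndomorphismPadicDigits.lean` (4 declarations kept)

# Endomorphisms of the formal group, III — the digit datum of a `ℤ_p`-lift: `H̄ = F̄(F̄([a_J](X), [b_J](Xᵖ)), [p^J](g_J))` with `a_J → A`, `b_J → B` in `ℤ_p`

Declarations of this Part (verbatim port; each keeps its own docstring and citation): `exists_partialSum_eq_add`, `exists_padicInt_partialSum_sub_norm_le`, `exists_digits_of_map_toZMod_hom_of_datum`, `exists_digits_of_map_toZMod_hom`.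

Reference keys (see `references.bib` and the declarations' citations): [Katz1981CrystallineDieudonne], [SilvermanAEC2009].
-/

section Part8

open _root_.PowerSeries Literature.NumberTheory.EllipticCurves
  Literature.NumberTheory.EllipticCurves.DescendedFrobenius.FormalEndomorphismAlgebra
  Literature.NumberTheory.EllipticCurves.DescendedFrobenius.FormalEndomorphismDigits

namespace Literature.NumberTheory.EllipticCurves.DescendedFrobenius.FormalEndomorphismPadicDigits

section Padic

variable {p : ℕ} [hp : Fact p.Prime]

omit hp in
/-- Partial sums of `∑ pʲ·d j` differ by multiples of `p^J`. [cite: Katz1981CrystallineDieudonne, §5.3] -/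
theorem exists_partialSum_eq_add (d : ℕ → ℕ) {J m : ℕ} (hJm : J ≤ m) :
    ∃ N : ℕ, ∑ j ∈ Finset.range m, p ^ j * d j = ∑ j ∈ Finset.range J, p ^ j * d j + p ^ J * N := by
  induction m, hJm using Nat.le_induction with
  | base => exact ⟨0, by simp⟩
  | succ m hJm ih =>
    obtain ⟨N, hN⟩ := ih
    refine ⟨N + p ^ (m - J) * d m, ?_⟩
    rw [Finset.sum_range_succ, hN, mul_add, ← mul_assoc, ← pow_add, Nat.add_sub_cancel' hJm]
    ring

/-- **The partial sums `∑_{j<J} pʲ·d j` converge in `ℤ_p`**, with the sharp rate: there is `A ∈ ℤ_p` with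
`‖∑_{j<J} pʲ d j − A‖ ≤ p^{−J}` for every `J`. [cite: Katz1981CrystallineDieudonne, §5.3] -/
theorem exists_padicInt_partialSum_sub_norm_le (d : ℕ → ℕ) :
    ∃ A : ℤ_[p], ∀ J : ℕ, ‖((∑ j ∈ Finset.range J, p ^ j * d j : ℕ) : ℤ_[p]) - A‖ ≤ (p : ℝ) ^ (-(J : ℤ)) := by
  set u : ℕ → ℤ_[p] := fun J => ((∑ j ∈ Finset.range J, p ^ j * d j : ℕ) : ℤ_[p]) with hu
  have hp1 : 1 < (p : ℝ) := by exact_mod_cast hp.out.one_lt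
  have hp0 : 0 < (p : ℝ) := by positivity
  -- `‖u m − u J‖ ≤ p^{-J}` for `J ≤ m`
  have hkey : ∀ J m : ℕ, J ≤ m → ‖u m - u J‖ ≤ (p : ℝ) ^ (-(J : ℤ)) := by
    intro J m hJm
    obtain ⟨N, hN⟩ := exists_partialSum_eq_add (p := p) d hJm
    have e : u m - u J = ((p : ℤ_[p]) ^ J) * (N : ℤ_[p]) := by
      simp only [hu, hN]; push_cast; ring
    rw [e, norm_mul, PadicInt.norm_p_pow]
    exact mul_le_of_le_one_right (by positivity) (PadicInt.norm_le_one _)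
  have hcau : CauchySeq u := by
    refine cauchySeq_of_le_geometric ((p : ℝ)⁻¹) 1 (inv_lt_one_of_one_lt₀ hp1) fun n => ?_
    rw [dist_comm, dist_eq_norm, one_mul, inv_pow, ← zpow_natCast, ← zpow_neg]
    exact hkey n (n + 1) (Nat.le_succ n)
  obtain ⟨A, hA⟩ := cauchySeq_tendsto_of_complete hcau
  refine ⟨A, fun J => ?_⟩
  have hlim : Filter.Tendsto (fun m => ‖u J - u m‖) Filter.atTop (nhds ‖u J - A‖) :=
    (tendsto_const_nhds.sub hA).norm
  refine le_of_tendsto hlim (Filter.eventually_atTop.2 ⟨J, fun m hm => ?_⟩)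
  rw [norm_sub_rev]
  exact hkey J m hm

variable (V : WeierstrassCurve ℤ_[p]) [hE : (V.map PadicInt.Coe.ringHom).IsElliptic] [hEt : (V.map PadicInt.toZMod).IsElliptic]

omit hE hEt in
/-- **The digit datum, PARAMETRIC in the datum `π² = [p] ∘ e`** (`e ∈ End(F̄)`, `[p](e(X)) = X^{p²}`; supplied on
fibres with `p ∣ t` by `exists_hom_formalMul_subst_eq_X_pow_sq`, and by other means elsewhere): for every
`H ∈ Xℤ_p⟦X⟧` with `H̄ ∈ End(F̄)`, `p`-adic integers `A, B`, naturals `a_J → A`, `b_J → B` at rate `p^{−J}`, and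
series `g_J` with `H̄ = F̄(F̄([a_J](X), [b_J](Xᵖ)), [p^J](g_J))` for every `J`. [cite: Katz1981CrystallineDieudonne, §5.3] -/
theorem exists_digits_of_map_toZMod_hom_of_datum {e : (ZMod p)⟦X⟧} (he0 : constantCoeff e = 0)
    (he : e.subst (V.map PadicInt.toZMod).formalGroupLaw =
      MvPowerSeries.subst ![e.subst (MvPowerSeries.X 0 : MvPowerSeries (Fin 2) (ZMod p)),
        e.subst (MvPowerSeries.X 1 : MvPowerSeries (Fin 2) (ZMod p))] (V.map PadicInt.toZMod).formalGroupLaw)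
    (hπ : ((V.map PadicInt.toZMod).formalMul p).subst e = (PowerSeries.X : (ZMod p)⟦X⟧) ^ p ^ 2)
    (H : ℤ_[p]⟦X⟧) (hH0 : constantCoeff H = 0)
    (hH : (H.map PadicInt.toZMod).subst (V.map PadicInt.toZMod).formalGroupLaw =
      MvPowerSeries.subst ![(H.map PadicInt.toZMod).subst (MvPowerSeries.X 0 : MvPowerSeries (Fin 2) (ZMod p)),
        (H.map PadicInt.toZMod).subst (MvPowerSeries.X 1 : MvPowerSeries (Fin 2) (ZMod p))]
        (V.map PadicInt.toZMod).formalGroupLaw) :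
    ∃ (A B : ℤ_[p]) (a b : ℕ → ℕ) (g : ℕ → (ZMod p)⟦X⟧),
      (∀ J, constantCoeff (g J) = 0 ∧ (g J).subst (V.map PadicInt.toZMod).formalGroupLaw =
        MvPowerSeries.subst ![(g J).subst (MvPowerSeries.X 0 : MvPowerSeries (Fin 2) (ZMod p)),
          (g J).subst (MvPowerSeries.X 1 : MvPowerSeries (Fin 2) (ZMod p))] (V.map PadicInt.toZMod).formalGroupLaw) ∧
      (∀ J, ‖((a J : ℤ_[p]) - A)‖ ≤ (p : ℝ) ^ (-(J : ℤ)) ∧ ‖((b J : ℤ_[p]) - B)‖ ≤ (p : ℝ) ^ (-(J : ℤ))) ∧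
      ∀ J, H.map PadicInt.toZMod = MvPowerSeries.subst ![MvPowerSeries.subst ![(V.map PadicInt.toZMod).formalMul (a J),
          expand p hp.out.ne_zero ((V.map PadicInt.toZMod).formalMul (b J))] (V.map PadicInt.toZMod).formalGroupLaw,
        ((V.map PadicInt.toZMod).formalMul (p ^ J)).subst (g J)] (V.map PadicInt.toZMod).formalGroupLaw := by
  have hh0 : constantCoeff (H.map PadicInt.toZMod) = 0 := by
    rw [← PowerSeries.coeff_zero_eq_constantCoeff_apply, PowerSeries.coeff_map, PowerSeries.coeff_zero_eq_constantCoeff_apply,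
      hH0, map_zero]
  obtain ⟨da, db, g, hg, hJ⟩ := exists_digitExpansion (V.map PadicInt.toZMod) he0 he hπ hh0 hH
  obtain ⟨A, hA⟩ := exists_padicInt_partialSum_sub_norm_le (p := p) da
  obtain ⟨B, hB⟩ := exists_padicInt_partialSum_sub_norm_le (p := p) db
  exact ⟨A, B, fun J => ∑ j ∈ Finset.range J, p ^ j * da j, fun J => ∑ j ∈ Finset.range J, p ^ j * db j, g,
    hg, fun J => ⟨hA J, hB J⟩, hJ⟩

/-- **THE DIGIT DATUM of an endomorphism of the reduced formal group** (binder `hDig` of the `H3_ss` assembly,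
`CyclotomicUntwistPadicDigitLimit.padicRankTwo_of_honda_of_digits`, g8). For `V/ℤ_p` with elliptic
generic and special fibres and `p ∣ t = p + 1 − #Ṽ(𝔽_p)`, every `H ∈ Xℤ_p⟦X⟧` whose reduction `H̄` is an
endomorphism of `F̄` admits `A, B ∈ ℤ_p`, natural numbers `a_J → A`, `b_J → B` (`‖a_J − A‖, ‖b_J − B‖ ≤ p^{−J}`)
and series `g_J ∈ X𝔽_p⟦X⟧` (endomorphisms, not recorded) with `H̄ = F̄(F̄([a_J](X), [b_J](Xᵖ)), [p^J](g_J))` for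
every `J` — «`H̄ = [A] ⊕ [B]π` in `End(F̄) = ℤ_p[π]`», Katz's rank `2` for the height-`2` formal group, in digits.
[cite: Katz1981CrystallineDieudonne, Thm. 5.3.3 and §5.3] [cite: SilvermanAEC2009, IV.7.4 and V.2.3.1] -/
theorem exists_digits_of_map_toZMod_hom
    (hdvd : (p : ℤ) ∣ Literature.NumberTheory.EllipticCurves.HasseManin.tr (V.map PadicInt.toZMod))
    (H : ℤ_[p]⟦X⟧) (hH0 : constantCoeff H = 0)
    (hH : (H.map PadicInt.toZMod).subst (V.map PadicInt.toZMod).formalGroupLaw =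
      MvPowerSeries.subst ![(H.map PadicInt.toZMod).subst (MvPowerSeries.X 0 : MvPowerSeries (Fin 2) (ZMod p)),
        (H.map PadicInt.toZMod).subst (MvPowerSeries.X 1 : MvPowerSeries (Fin 2) (ZMod p))]
        (V.map PadicInt.toZMod).formalGroupLaw) :
    ∃ (A B : ℤ_[p]) (a b : ℕ → ℕ) (g : ℕ → (ZMod p)⟦X⟧), (∀ J, constantCoeff (g J) = 0) ∧
      (∀ J, ‖((a J : ℤ_[p]) - A)‖ ≤ (p : ℝ) ^ (-(J : ℤ)) ∧ ‖((b J : ℤ_[p]) - B)‖ ≤ (p : ℝ) ^ (-(J : ℤ))) ∧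
      ∀ J, H.map PadicInt.toZMod = MvPowerSeries.subst ![MvPowerSeries.subst ![(V.map PadicInt.toZMod).formalMul (a J),
          expand p hp.out.ne_zero ((V.map PadicInt.toZMod).formalMul (b J))] (V.map PadicInt.toZMod).formalGroupLaw,
        ((V.map PadicInt.toZMod).formalMul (p ^ J)).subst (g J)] (V.map PadicInt.toZMod).formalGroupLaw := by
  obtain ⟨e, he0, he, hπ⟩ := exists_hom_formalMul_subst_eq_X_pow_sq V hdvd
  obtain ⟨A, B, a, b, g, hg, hAB, hJ⟩ := exists_digits_of_map_toZMod_hom_of_datum V he0 he hπ H hH0 hH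
  exact ⟨A, B, a, b, g, fun J => (hg J).1, hAB, hJ⟩

end Padic

end Literature.NumberTheory.EllipticCurves.DescendedFrobenius.FormalEndomorphismPadicDigits

end Part8

/-!
## Part 9 — port of `Summits/BirchSwinnertonDyer/BirchSwinnertonDyer/Theorems/CyclotomicUntwistSecondKindLogForm.lean` (16 declarations kept)

# Second-kind series over `ℤ_p` are `p⁻ᵏ·log_W ∘ ψ` with `ψ ∈ Xℤ_p⟦X⟧` (growth of a second-kind series, its Honda type, and Hazewinkel's functional equation lemma (ii))

Declarations of this Part (verbatim port; each keeps its own docstring and citation): `norm_sub_le_one`, `norm_p_pow_mul_le_one`, `exists_norm_pow_mul_le_one`, `isPadicInt_pderiv`, `norm_mul_coeff_subst_le`, `norm_mul_coeff_expand_le`, `subst_pair_cob`, `norm_mul_coeff_subst_pair_le`, `exists_norm_natCast_mul_coeff_le`, `norm_mul_coeff_subst_formalMul_sub_le`, `norm_mul_coeff_subst_formalNeg_add_le`, `exists_subst_frobLHS_eq`, `exists_subst_frobRHSPos_eq`, `exists_subst_frobRHSNeg_eq`, `exists_norm_coeff_hondaShift_le_one`, `exists_isPadicInt_formalLog_sub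st_eq`.

Reference keys (see `references.bib` and the declarations' citations): [Katz1981CrystallineDieudonne], [SilvermanAEC2009], [Honda1970], [Hazewinkel1978].
-/

section Part9

open _root_.PowerSeries Literature.NumberTheory.EllipticCurves
open Literature.AlgebraicGeometry.Resolution (MvPowerSeries.pderiv MvPowerSeries.coeff_pderiv
  MvPowerSeries.pderiv_X MvPowerSeries.pderiv_C MvPowerSeries.pderiv_powerSeries_subst
  MvPowerSeries.pderiv_powerSeries_subst_X MvPowerSeries.pderiv_subst_pair)
open Literature.RingTheory.FormalGroups (hondaShift hondaShift_C_mul prime_ne_zero prime_sq_ne_zero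
  norm_coeff_le_one_of_subst_eq norm_coeff_subst_sub_subst_le_of_natCast_mul_coeff_le)

namespace Literature.NumberTheory.EllipticCurves.DescendedFrobenius.SecondKindLog

variable {p : ℕ} [hp : Fact p.Prime]

/-! ## §0 Small `p`-adic helpers -/

/-- Ultrametric: `‖a‖ ≤ 1`, `‖b‖ ≤ 1` ⟹ `‖a − b‖ ≤ 1` (the `+` form is `IsUltrametricDist.norm_add_le_max`). [cite: Katz1981CrystallineDieudonne, §5.1 (p. 193)] -/
theorem norm_sub_le_one {a b : ℚ_[p]} (ha : ‖a‖ ≤ 1) (hb : ‖b‖ ≤ 1) : ‖a - b‖ ≤ 1 := by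
  rw [sub_eq_add_neg]; exact (IsUltrametricDist.norm_add_le_max _ _).trans (max_le ha (by rwa [norm_neg]))

/-- `‖pʲ·x‖ ≤ 1` when `‖x‖ ≤ 1`. [cite: Katz1981CrystallineDieudonne, §5.1 (p. 193)] -/
theorem norm_p_pow_mul_le_one (j : ℕ) {x : ℚ_[p]} (hx : ‖x‖ ≤ 1) : ‖(p : ℚ_[p]) ^ j * x‖ ≤ 1 := by
  rw [norm_mul, norm_pow]
  exact mul_le_one₀ (pow_le_one₀ (norm_nonneg _) (Padic.norm_p_lt_one (p := p)).le) (norm_nonneg _) hx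

/-- Every `p`-adic number becomes integral after multiplication by a power of `p`. [cite: Katz1981CrystallineDieudonne, §5.1 (p. 193)] -/
theorem exists_norm_pow_mul_le_one (a : ℚ_[p]) : ∃ j : ℕ, ‖(p : ℚ_[p]) ^ j * a‖ ≤ 1 := by
  obtain ⟨j, hj⟩ := pow_unbounded_of_one_lt ‖a‖ (show (1 : ℝ) < p by exact_mod_cast hp.out.one_lt)
  refine ⟨j, ?_⟩
  rw [norm_mul, norm_pow, Padic.norm_p, inv_pow, inv_mul_le_iff₀ (pow_pos (by exact_mod_cast hp.out.pos) j), mul_one]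
  exact hj.le

/-- `∂/∂Xᵢ` preserves `p`-integrality. [cite: Katz1981CrystallineDieudonne, §5.1 (p. 193)] -/
theorem isPadicInt_pderiv {σ : Type*} {Φ : MvPowerSeries σ ℚ_[p]} (hΦ : IsPadicInt Φ) (i : σ) :
    IsPadicInt (MvPowerSeries.pderiv i Φ) := fun e ↦ by
  rw [MvPowerSeries.coeff_pderiv, norm_mul]
  have h1 : ‖((e i : ℚ_[p]) + 1)‖ ≤ 1 := by
    rw [show ((e i : ℚ_[p]) + 1) = (((e i + 1 : ℕ) : ℤ_[p]) : ℚ_[p]) by push_cast; ring]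
    exact PadicInt.norm_le_one _
  exact mul_le_one₀ h1 (norm_nonneg _) (hΦ _)

/-- Substituting a `p`-integral series without constant term keeps `c`-bounded denominators. [cite: Katz1981CrystallineDieudonne, §5.1 (p. 193)] -/
theorem norm_mul_coeff_subst_le {c : ℚ_[p]} {γ T : ℚ_[p]⟦X⟧} (hγ : ∀ n, ‖c * coeff n γ‖ ≤ 1)
    (hT : IsPadicInt T) (hT0 : constantCoeff T = 0) (n : ℕ) : ‖c * coeff n (γ.subst T)‖ ≤ 1 := by
  have hs : PowerSeries.HasSubst T := PowerSeries.HasSubst.of_constantCoeff_zero' hT0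
  have h1 : IsPadicInt (c • γ) := isPadicInt_iff_coeff.mpr fun m ↦ by rw [PowerSeries.coeff_smul, smul_eq_mul]; exact hγ m
  have h2 : IsPadicInt (c • γ.subst T) := by rw [← PowerSeries.subst_smul hs]; exact h1.powerSeries_subst hT hs
  have := isPadicInt_iff_coeff.mp h2 n
  rwa [PowerSeries.coeff_smul, smul_eq_mul] at this

/-- `expand` keeps `c`-bounded denominators. [cite: Katz1981CrystallineDieudonne, §5.1 (p. 193)] -/
theorem norm_mul_coeff_expand_le {c : ℚ_[p]} {γ : ℚ_[p]⟦X⟧} (hγ : ∀ n, ‖c * coeff n γ‖ ≤ 1)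
    (q : ℕ) (hq : q ≠ 0) (n : ℕ) : ‖c * coeff n (expand q hq γ)‖ ≤ 1 := by
  rw [coeff_expand]; split_ifs; exacts [hγ _, by rw [mul_zero, norm_zero]; exact zero_le_one]

/-! ## §1–§2 The cocycle calculus of a second-kind series over `ℚ_p` -/

section SK

variable (W : WeierstrassCurve ℚ_[p]) (f : ℚ_[p]⟦X⟧)

/-- **`(∂f)(u₁,u₂) = f(F(u₁,u₂)) − f(u₁) − f(u₂)`** — the coboundary, substituted. [cite: Katz1981CrystallineDieudonne, §5.1 (p. 193)] -/
theorem subst_pair_cob {u₁ u₂ : ℚ_[p]⟦X⟧} (h₁ : constantCoeff u₁ = 0) (h₂ : constantCoeff u₂ = 0) :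
    MvPowerSeries.subst ![u₁, u₂]
        (f.subst W.formalGroupLaw - f.subst (MvPowerSeries.X 0 : MvPowerSeries (Fin 2) ℚ_[p]) -
          f.subst (MvPowerSeries.X 1 : MvPowerSeries (Fin 2) ℚ_[p])) =
      f.subst (MvPowerSeries.subst ![u₁, u₂] W.formalGroupLaw) - f.subst u₁ - f.subst u₂ := by
  have hb : MvPowerSeries.HasSubst ![u₁, u₂] := WeierstrassCurve.hasSubst_pair h₁ h₂
  rw [MvPowerSeries.subst_sub hb, MvPowerSeries.subst_sub hb, mvSubst_powerSeries_subst W.hasSubst_formalGroupLaw hb,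
    mvSubst_powerSeries_subst (PowerSeries.HasSubst.X 0) hb, mvSubst_powerSeries_subst (PowerSeries.HasSubst.X 1) hb,
    MvPowerSeries.subst_X hb 0, MvPowerSeries.subst_X hb 1]
  rfl

variable {W f} {c : ℚ_[p]}
  (hSK : ∀ e, ‖c * MvPowerSeries.coeff e
    (f.subst W.formalGroupLaw - f.subst (MvPowerSeries.X 0 : MvPowerSeries (Fin 2) ℚ_[p]) -
      f.subst (MvPowerSeries.X 1 : MvPowerSeries (Fin 2) ℚ_[p]))‖ ≤ 1)
include hSK

/-- **`c·(f(F(u₁,u₂)) − f(u₁) − f(u₂)) ∈ ℤ_p⟦X⟧`** for `u₁, u₂ ∈ Xℤ_p⟦X⟧`. [cite: Katz1981CrystallineDieudonne, §5.1 (p. 193)] -/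
theorem norm_mul_coeff_subst_pair_le {u₁ u₂ : ℚ_[p]⟦X⟧} (h₁ : constantCoeff u₁ = 0) (h₂ : constantCoeff u₂ = 0)
    (hu₁ : IsPadicInt u₁) (hu₂ : IsPadicInt u₂) (n : ℕ) :
    ‖c * coeff n (f.subst (MvPowerSeries.subst ![u₁, u₂] W.formalGroupLaw) - f.subst u₁ - f.subst u₂)‖ ≤ 1 := by
  have hb : MvPowerSeries.HasSubst ![u₁, u₂] := WeierstrassCurve.hasSubst_pair h₁ h₂
  have hG : IsPadicInt (c • (f.subst W.formalGroupLaw - f.subst (MvPowerSeries.X 0 : MvPowerSeries (Fin 2) ℚ_[p]) -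
      f.subst (MvPowerSeries.X 1 : MvPowerSeries (Fin 2) ℚ_[p]))) := fun e ↦ by
    rw [MvPowerSeries.coeff_smul]; exact hSK e
  have h := hG.subst (a := ![u₁, u₂]) (fun s ↦ by fin_cases s <;> assumption) hb
  rw [MvPowerSeries.subst_smul hb, subst_pair_cob W f h₁ h₂] at h
  have := isPadicInt_iff_coeff.mp h n
  rwa [PowerSeries.coeff_smul, smul_eq_mul] at this

/-- **Growth of a second-kind series: `pʲ·c·n·[Xⁿ]f ∈ ℤ_p`.** `∂/∂X₀` of the coboundary at `X₀ = 0` is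
`f′(X)·η(X) − f′(0)` with `η = F_X(0, X)`, and `η·ω = 1` with `ω ∈ ℤ_p⟦X⟧` (Katz: `∂f` integral ⟹ `df` integral).
[cite: Katz1981CrystallineDieudonne, §5.1 (p. 193)] [cite: SilvermanAEC2009, IV.4.3] -/
theorem exists_norm_natCast_mul_coeff_le [hW : W.IsIntegral ℤ_[p]] :
    ∃ j : ℕ, ∀ n : ℕ, ‖(p : ℚ_[p]) ^ j * c * ((n : ℚ_[p]) * coeff n f)‖ ≤ 1 := by
  classical
  set F := W.formalGroupLaw with hF
  set G := f.subst F - f.subst (MvPowerSeries.X 0 : MvPowerSeries (Fin 2) ℚ_[p]) -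
    f.subst (MvPowerSeries.X 1 : MvPowerSeries (Fin 2) ℚ_[p]) with hGdef
  have hG : IsPadicInt (c • G) := fun e ↦ by rw [MvPowerSeries.coeff_smul]; exact hSK e
  have hF0 : MvPowerSeries.constantCoeff F = 0 := W.constantCoeff_formalGroupLaw
  set f' := d⁄dX ℚ_[p] f with hf'
  -- `∂/∂X₀`
  have hd : MvPowerSeries.pderiv 0 G =
      f'.subst F * MvPowerSeries.pderiv 0 F - f'.subst (MvPowerSeries.X 0 : MvPowerSeries (Fin 2) ℚ_[p]) := by
    rw [hGdef, map_sub, map_sub, MvPowerSeries.pderiv_powerSeries_subst hF0, MvPowerSeries.pderiv_powerSeries_subst_X,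
      MvPowerSeries.pderiv_powerSeries_subst_X, if_pos rfl, if_neg (by decide), sub_zero]
  -- `X₀ = 0`, `X₁ = X`
  have hs := WeierstrassCurve.hasSubst_zero_X (R := ℚ_[p])
  have hc1 : constantCoeff f' = coeff 1 f := by
    rw [hf', ← coeff_zero_eq_constantCoeff_apply, coeff_derivative, zero_add, Nat.cast_zero, zero_add, mul_one]
  have hT : MvPowerSeries.subst ![(0 : ℚ_[p]⟦X⟧), PowerSeries.X] (MvPowerSeries.pderiv 0 G) =
      f' * W.formalEta - PowerSeries.C (coeff 1 f) := by
    rw [hd, MvPowerSeries.subst_sub hs, MvPowerSeries.subst_mul hs, mvSubst_powerSeries_subst W.hasSubst_formalGroupLaw hs,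
      W.formalGroupLaw_subst_zero_X, W.subst_zero_X_pderiv_formalGroupLaw, powerSeries_subst_X_self,
      mvSubst_powerSeries_subst (PowerSeries.HasSubst.X 0) hs, WeierstrassCurve.subst_zero_X_X_zero,
      PowerSeries.subst_zero_eq_C_constantCoeff, hc1, MvPowerSeries.map_C]
    rfl
  have h1 : IsPadicInt (c • MvPowerSeries.pderiv 0 G) := by
    rw [← Derivation.map_smul]; exact isPadicInt_pderiv hG 0
  have h2 : IsPadicInt (c • (f' * W.formalEta - PowerSeries.C (coeff 1 f))) := by
    rw [← hT, ← MvPowerSeries.subst_smul hs]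
    exact h1.subst (fun s ↦ by fin_cases s; exacts [IsPadicInt.zero, IsPadicInt.powerSeries_X]) hs
  obtain ⟨j, hj⟩ := exists_norm_pow_mul_le_one (c * coeff 1 f)
  -- `pʲ·c·(f′·η) ∈ ℤ_p⟦X⟧`
  have h3 : IsPadicInt (((p : ℚ_[p]) ^ j * c) • (f' * W.formalEta)) := by
    refine isPadicInt_iff_coeff.mpr fun n ↦ ?_
    have e1 : coeff n ((((p : ℚ_[p]) ^ j * c) • (f' * W.formalEta))) =
        (p : ℚ_[p]) ^ j * (c * coeff n (f' * W.formalEta - PowerSeries.C (coeff 1 f))) +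
          (p : ℚ_[p]) ^ j * c * coeff n (PowerSeries.C (coeff 1 f)) := by
      rw [PowerSeries.coeff_smul, smul_eq_mul, map_sub]; ring
    rw [e1]
    refine (IsUltrametricDist.norm_add_le_max _ _).trans (max_le (norm_p_pow_mul_le_one j ?_) ?_)
    · have := isPadicInt_iff_coeff.mp h2 n
      rwa [PowerSeries.coeff_smul, smul_eq_mul] at this
    · rw [coeff_C]; split_ifs; exacts [by rw [mul_assoc]; exact hj, by rw [mul_zero, norm_zero]; exact zero_le_one]
  -- `η·ω = 1`, `ω ∈ ℤ_p⟦X⟧`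
  have h4 : IsPadicInt (((p : ℚ_[p]) ^ j * c) • f') := by
    have := h3.mul W.isPadicInt_formalOmega
    rwa [smul_mul_assoc, mul_assoc, W.formalEta_mul_formalOmega, mul_one] at this
  refine ⟨j, fun n ↦ ?_⟩
  rcases n with _ | k; · rw [Nat.cast_zero, zero_mul, mul_zero, norm_zero]; exact zero_le_one
  · have := isPadicInt_iff_coeff.mp h4 k
    rw [PowerSeries.coeff_smul, smul_eq_mul, hf', coeff_derivative] at this
    rw [show (p : ℚ_[p]) ^ j * c * (((k + 1 : ℕ) : ℚ_[p]) * coeff (k + 1) f) =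
      (p : ℚ_[p]) ^ j * c * (coeff (k + 1) f * ((k : ℚ_[p]) + 1)) by push_cast; ring]
    exact this

/-- **`c·(f([m]u?) …)`, here `f([m]) − m·f`: `c·(f([m]X) − m f) ∈ ℤ_p⟦X⟧`** (`[m+1] = F([m], X)`, induction).
[cite: Katz1981CrystallineDieudonne, §5.1 (p. 193)] -/
theorem norm_mul_coeff_subst_formalMul_sub_le [hW : W.IsIntegral ℤ_[p]] (hf0 : constantCoeff f = 0) (m n : ℕ) :
    ‖c * coeff n (f.subst (W.formalMul m) - m • f)‖ ≤ 1 := by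
  induction m generalizing n with
  | zero =>
    rw [WeierstrassCurve.formalMul_zero, zero_nsmul, sub_zero, PowerSeries.subst_zero_of_constantCoeff_zero hf0,
      map_zero, mul_zero, norm_zero]; exact zero_le_one
  | succ m ih =>
    have key := norm_mul_coeff_subst_pair_le hSK (W.constantCoeff_formalMul m) constantCoeff_X
      (W.isPadicInt_formalMul m) IsPadicInt.powerSeries_X n
    rw [← WeierstrassCurve.formalMul_succ, powerSeries_subst_X_self] at key
    have e : f.subst (W.formalMul (m + 1)) - (m + 1) • f =
        (f.subst (W.formalMul (m + 1)) - f.subst (W.formalMul m) - f) + (f.subst (W.formalMul m) - m • f) := by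
      rw [succ_nsmul]; ring
    rw [e, map_add, mul_add]
    exact (IsUltrametricDist.norm_add_le_max _ _).trans (max_le key (ih n))

/-- **`c·(f(i(X)) + f) ∈ ℤ_p⟦X⟧`** (`F(X, i(X)) = 0`, `f(0) = 0`). [cite: Katz1981CrystallineDieudonne, §5.1 (p. 193)] -/
theorem norm_mul_coeff_subst_formalNeg_add_le [hW : W.IsIntegral ℤ_[p]] (hf0 : constantCoeff f = 0) (n : ℕ) :
    ‖c * coeff n (f.subst W.formalNeg + f)‖ ≤ 1 := by
  have key := norm_mul_coeff_subst_pair_le hSK constantCoeff_X W.constantCoeff_formalNeg IsPadicInt.powerSeries_X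
    W.isPadicInt_formalNeg n
  rw [W.formalGroupLaw_subst_X_formalNeg', PowerSeries.subst_zero_of_constantCoeff_zero hf0, powerSeries_subst_X_self,
    zero_sub] at key
  rw [show f.subst W.formalNeg + f = -(-f - f.subst W.formalNeg) by ring, map_neg, mul_neg, norm_neg]
  exact key

/-- **`f(G_W) = f(X^{p²}) + p·f + (c⁻¹-integral)`** for `G_W = F(X^{p²}, [p]X)` (`frobLHS`).
[cite: Katz1981CrystallineDieudonne, §5 Thm 5.1.4] -/
theorem exists_subst_frobLHS_eq [hW : W.IsIntegral ℤ_[p]] (hf0 : constantCoeff f = 0) :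
    ∃ β : ℚ_[p]⟦X⟧, (∀ n, ‖c * coeff n β‖ ≤ 1) ∧
      f.subst (WeierstrassCurve.frobLHS p W) = expand (p ^ 2) (prime_sq_ne_zero p) f + p • f + β := by
  have hp0 : p ≠ 0 := hp.out.ne_zero
  have hP : constantCoeff ((X : ℚ_[p]⟦X⟧) ^ p ^ 2) = 0 := by
    rw [map_pow, constantCoeff_X, zero_pow (pow_ne_zero _ hp0)]
  have hPi : IsPadicInt ((X : ℚ_[p]⟦X⟧) ^ p ^ 2) := IsPadicInt.powerSeries_X.pow _
  have hfr : WeierstrassCurve.frobLHS p W = MvPowerSeries.subst ![(X : ℚ_[p]⟦X⟧) ^ p ^ 2, W.formalMul p]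
      W.formalGroupLaw := by rw [WeierstrassCurve.frobLHS, powerSeries_subst_X_self]
  have h1 := norm_mul_coeff_subst_pair_le hSK hP (W.constantCoeff_formalMul p) hPi (W.isPadicInt_formalMul p)
  refine ⟨(f.subst (MvPowerSeries.subst ![(X : ℚ_[p]⟦X⟧) ^ p ^ 2, W.formalMul p] W.formalGroupLaw) -
      f.subst ((X : ℚ_[p]⟦X⟧) ^ p ^ 2) - f.subst (W.formalMul p)) + (f.subst (W.formalMul p) - p • f),
    fun n ↦ ?_, ?_⟩
  · rw [map_add, mul_add]
    exact (IsUltrametricDist.norm_add_le_max _ _).trans (max_le (h1 n) (norm_mul_coeff_subst_formalMul_sub_le hSK hf0 p n))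
  · rw [hfr, PowerSeries.expand_apply]; ring

/-- **`f([m](Xᵖ)) = m·f(Xᵖ) + (c⁻¹-integral)`** (`frobRHSPos`). [cite: Katz1981CrystallineDieudonne, §5 Thm 5.1.4] -/
theorem exists_subst_frobRHSPos_eq [hW : W.IsIntegral ℤ_[p]] (hf0 : constantCoeff f = 0) (m : ℕ) :
    ∃ β : ℚ_[p]⟦X⟧, (∀ n, ‖c * coeff n β‖ ≤ 1) ∧
      f.subst (WeierstrassCurve.frobRHSPos p W m) = m • expand p (prime_ne_zero p) f + β := by
  have hp0 : p ≠ 0 := hp.out.ne_zero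
  have hXp : PowerSeries.HasSubst ((X : ℚ_[p]⟦X⟧) ^ p) := PowerSeries.HasSubst.X_pow hp0
  set γ : ℚ_[p]⟦X⟧ := f.subst (W.formalMul m) - m • f with hγ
  have hγb : ∀ n, ‖c * coeff n γ‖ ≤ 1 := norm_mul_coeff_subst_formalMul_sub_le hSK hf0 m
  refine ⟨expand p (prime_ne_zero p) γ, norm_mul_coeff_expand_le hγb p (prime_ne_zero p), ?_⟩
  rw [WeierstrassCurve.frobRHSPos, ← PowerSeries.subst_comp_subst_apply (W.hasSubst_formalMul m) hXp,
    show f.subst (W.formalMul m) = m • f + γ by rw [hγ]; ring, ← PowerSeries.expand_apply, map_add, map_nsmul]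

/-- **`f(i([m](Xᵖ))) = −m·f(Xᵖ) + (c⁻¹-integral)`** (`frobRHSNeg`). [cite: Katz1981CrystallineDieudonne, §5 Thm 5.1.4] -/
theorem exists_subst_frobRHSNeg_eq [hW : W.IsIntegral ℤ_[p]] (hf0 : constantCoeff f = 0) (m : ℕ) :
    ∃ β : ℚ_[p]⟦X⟧, (∀ n, ‖c * coeff n β‖ ≤ 1) ∧
      f.subst (WeierstrassCurve.frobRHSNeg p W m) = -(m • expand p (prime_ne_zero p) f) + β := by
  have hp0 : p ≠ 0 := hp.out.ne_zero
  obtain ⟨β₁, hβ₁, h₁⟩ := exists_subst_frobRHSPos_eq hSK hf0 m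
  set T := WeierstrassCurve.frobRHSPos p W m with hT
  have hT0 : constantCoeff T = 0 := W.constantCoeff_frobRHSPos p hp0 m
  have hTi : IsPadicInt T := by
    rw [hT, WeierstrassCurve.frobRHSPos]
    exact (W.isPadicInt_formalMul m).powerSeries_subst (IsPadicInt.powerSeries_X.pow _) (PowerSeries.HasSubst.X_pow hp0)
  have hTs : PowerSeries.HasSubst T := PowerSeries.HasSubst.of_constantCoeff_zero' hT0
  set γ : ℚ_[p]⟦X⟧ := f.subst W.formalNeg + f with hγ
  have hγb : ∀ n, ‖c * coeff n γ‖ ≤ 1 := norm_mul_coeff_subst_formalNeg_add_le hSK hf0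
  refine ⟨γ.subst T - β₁, fun n ↦ ?_, ?_⟩
  · rw [map_sub, mul_sub]
    exact norm_sub_le_one (norm_mul_coeff_subst_le hγb hTi hT0 n) (hβ₁ n)
  · rw [WeierstrassCurve.frobRHSNeg, ← WeierstrassCurve.frobRHSPos, ← hT,
      ← PowerSeries.subst_comp_subst_apply (PowerSeries.HasSubst.of_constantCoeff_zero' W.constantCoeff_formalNeg) hTs,
      show f.subst W.formalNeg = γ - f by rw [hγ]; ring, PowerSeries.subst_sub hTs, h₁]; ring

end SK

/-! ## §3 The Frobenius relation: a second-kind series has the Honda type `p − aT + T²` of `log_W` -/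

section Honda

variable (V : WeierstrassCurve ℤ_[p]) [hE : (V.map PadicInt.Coe.ringHom).IsElliptic]
  [hEt : (V.map PadicInt.toZMod).IsElliptic] {f : ℚ_[p]⟦X⟧} (hf0 : constantCoeff f = 0) {d : ℕ}
  (hSK : ∀ e, ‖(p : ℚ_[p]) ^ d * MvPowerSeries.coeff e
    (f.subst (V.map PadicInt.Coe.ringHom).formalGroupLaw - f.subst (MvPowerSeries.X 0 : MvPowerSeries (Fin 2) ℚ_[p]) -
      f.subst (MvPowerSeries.X 1 : MvPowerSeries (Fin 2) ℚ_[p]))‖ ≤ 1)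

include hf0 hSK in
/-- **THE FROBENIUS RELATION / HONDA TYPE OF A SECOND-KIND SERIES.** For `V/ℤ_p` (`p` odd) with elliptic generic and
special fibres, `a = HasseManin.tr (V ⊗ 𝔽_p)`, and `f ∈ Xℚ_p⟦X⟧` whose `F_W`-coboundary has `pᵈ`-bounded denominators:
for some `k`, **`hondaShift p a (pᵏ·f) = pᵏ⁻¹·(f(X^{p²}) + p·f − a·f(Xᵖ)) ∈ ℤ_p⟦X⟧`**, i.e. `pᵏ f` is of Honda type
`p − aT + T²` — Katz's `(φ² − aφ + p)[f] = 0` on `D(Ĝ/ℤ_p) ⊗ ℚ`. Proof: `G_V ≡ R_V (mod p)` (`map_toZMod_frobLHS_sub_eq_zero`,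
from `π² − aπ + p = 0` on `V ⊗ 𝔽_p`), the Key lemma for `pʲ⁺ᵈ f` (growth, §1) and the cocycle calculus (§2).
[cite: Katz1981CrystallineDieudonne, §5 Thm 5.1.4 and (6.1.1)] [cite: SilvermanAEC2009, Thm. V.2.3.1(b)]
[cite: Honda1970, Thm. 9 (proof)] -/
theorem exists_norm_coeff_hondaShift_le_one (hp2 : p ≠ 2) : ∃ k : ℕ, ∀ n : ℕ,
    ‖coeff n (hondaShift p ((Literature.NumberTheory.EllipticCurves.HasseManin.tr (V.map PadicInt.toZMod) : ℤ) : ℚ_[p])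
      (PowerSeries.C ((p : ℚ_[p]) ^ k) * f))‖ ≤ 1 := by
  haveI := V.isIntegral_map_coe
  set W := V.map PadicInt.Coe.ringHom with hWdef
  set a := Literature.NumberTheory.EllipticCurves.HasseManin.tr (V.map PadicInt.toZMod) with hadef
  have hp0 : p ≠ 0 := hp.out.ne_zero
  have hp0' : (p : ℚ_[p]) ≠ 0 := by exact_mod_cast hp0
  -- growth: `g = pʲ⁺ᵈ f` has `n·[Xⁿ]g ∈ ℤ_p`
  obtain ⟨j, hj⟩ := exists_norm_natCast_mul_coeff_le hSK
  set g : ℚ_[p]⟦X⟧ := ((p : ℚ_[p]) ^ j * (p : ℚ_[p]) ^ d) • f with hgdef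
  have hg : ∀ n : ℕ, ‖(n : ℚ_[p]) * coeff n g‖ ≤ 1 := fun n ↦ by
    rw [hgdef, PowerSeries.coeff_smul, smul_eq_mul,
      show (n : ℚ_[p]) * ((p : ℚ_[p]) ^ j * (p : ℚ_[p]) ^ d * coeff n f) =
        (p : ℚ_[p]) ^ j * (p : ℚ_[p]) ^ d * ((n : ℚ_[p]) * coeff n f) by ring]
    exact hj n
  -- the two sides of the Frobenius identity, over `ℤ_p` and over `ℚ_p`
  set Rz : ℤ_[p]⟦X⟧ := if 0 ≤ a then WeierstrassCurve.frobRHSPos p V a.toNat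
    else WeierstrassCurve.frobRHSNeg p V a.natAbs with hRz
  have hmod : (WeierstrassCurve.frobLHS p V - Rz).map PadicInt.toZMod = 0 := V.map_toZMod_frobLHS_sub_eq_zero hp2
  set u : ℚ_[p]⟦X⟧ := (WeierstrassCurve.frobLHS p V).map PadicInt.Coe.ringHom with hu
  set v : ℚ_[p]⟦X⟧ := Rz.map PadicInt.Coe.ringHom with hv
  have huv : ∀ n, ‖coeff n (u - v)‖ ≤ (p : ℝ)⁻¹ := fun n ↦ by
    rw [hu, hv, ← map_sub]
    exact WeierstrassCurve.norm_coeff_map_le_inv_of_map_toZMod hmod n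
  have hint : ∀ (Φ : ℤ_[p]⟦X⟧) (n : ℕ), ‖coeff n (Φ.map (PadicInt.Coe.ringHom (p := p)))‖ ≤ 1 := fun Φ n ↦ by
    rw [coeff_map]; exact PadicInt.norm_le_one _
  have hu0 : constantCoeff u = 0 := by
    rw [hu, ← coeff_zero_eq_constantCoeff, coeff_map, coeff_zero_eq_constantCoeff,
      V.constantCoeff_frobLHS p hp0, map_zero]
  have hv0 : constantCoeff v = 0 := by
    rw [hv, ← coeff_zero_eq_constantCoeff, coeff_map, coeff_zero_eq_constantCoeff, hRz]
    split_ifs; exacts [by rw [V.constantCoeff_frobRHSPos p hp0, map_zero], by rw [V.constantCoeff_frobRHSNeg p hp0, map_zero]]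
  have key := norm_coeff_subst_sub_subst_le_of_natCast_mul_coeff_le hg hu0 (hint _) hv0 (hint _) huv
  -- evaluate `f` on both sides
  have hu' : u = WeierstrassCurve.frobLHS p W := by rw [hu, WeierstrassCurve.map_frobLHS p V _ hp0]
  obtain ⟨β₁, hβ₁, h₁⟩ := exists_subst_frobLHS_eq hSK hf0
  have h₂ : ∃ β₂ : ℚ_[p]⟦X⟧, (∀ n, ‖(p : ℚ_[p]) ^ d * coeff n β₂‖ ≤ 1) ∧
      f.subst v = (a : ℚ_[p]) • expand p (prime_ne_zero p) f + β₂ := by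
    rw [hv, hRz]
    split_ifs with ha
    · obtain ⟨β₂, hβ₂, h⟩ := exists_subst_frobRHSPos_eq hSK hf0 a.toNat
      refine ⟨β₂, hβ₂, ?_⟩
      have hta : ((a.toNat : ℕ) : ℚ_[p]) = (a : ℚ_[p]) := by rw [← Int.cast_natCast, Int.toNat_of_nonneg ha]
      rw [WeierstrassCurve.map_frobRHSPos p V _ hp0, h, ← Nat.cast_smul_eq_nsmul ℚ_[p] a.toNat, hta]
    · obtain ⟨β₂, hβ₂, h⟩ := exists_subst_frobRHSNeg_eq hSK hf0 a.natAbs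
      refine ⟨β₂, hβ₂, ?_⟩
      have hna : ((a.natAbs : ℕ) : ℤ) = -a := by omega
      have hna' : ((a.natAbs : ℕ) : ℚ_[p]) = -(a : ℚ_[p]) := by rw [← Int.cast_natCast, hna, Int.cast_neg]
      rw [WeierstrassCurve.map_frobRHSNeg p V _ hp0, h, ← Nat.cast_smul_eq_nsmul ℚ_[p] a.natAbs, hna', neg_smul, neg_neg]
  obtain ⟨β₂, hβ₂, h₂⟩ := h₂
  set D : ℚ_[p]⟦X⟧ := expand (p ^ 2) (prime_sq_ne_zero p) f + p • f - (a : ℚ_[p]) • expand p (prime_ne_zero p) f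
    with hD
  clear_value D
  have hus : PowerSeries.HasSubst u := PowerSeries.HasSubst.of_constantCoeff_zero' hu0
  have hvs : PowerSeries.HasSubst v := PowerSeries.HasSubst.of_constantCoeff_zero' hv0
  have hfuv : f.subst u - f.subst v = D + β₁ - β₂ := by rw [hu', h₁, h₂, hD]; ring
  have hguv : g.subst u - g.subst v = ((p : ℚ_[p]) ^ j * (p : ℚ_[p]) ^ d) • (f.subst u - f.subst v) := by
    rw [hgdef, PowerSeries.subst_smul hus, PowerSeries.subst_smul hvs, smul_sub]
  refine ⟨j + d + 1, fun n ↦ ?_⟩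
  have e : (p : ℚ_[p]) ^ (j + d) * coeff n D = coeff n (g.subst u - g.subst v) -
      (p : ℚ_[p]) ^ j * ((p : ℚ_[p]) ^ d * coeff n β₁) + (p : ℚ_[p]) ^ j * ((p : ℚ_[p]) ^ d * coeff n β₂) := by
    rw [hguv, PowerSeries.coeff_smul, smul_eq_mul, hfuv, map_sub, map_add, pow_add]; ring
  rw [hondaShift_C_mul, WeierstrassCurve.hondaShift_eq_C_mul, ← hD, coeff_C_mul, coeff_C_mul, pow_succ, mul_assoc,
    mul_inv_cancel_left₀ hp0', e]
  have key' : ‖coeff n (g.subst u - g.subst v)‖ ≤ 1 :=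
    (key n).trans (inv_le_one_of_one_le₀ (by exact_mod_cast hp.out.one_le))
  exact (IsUltrametricDist.norm_add_le_max _ _).trans
    (max_le (norm_sub_le_one key' (norm_p_pow_mul_le_one j (hβ₁ n))) (norm_p_pow_mul_le_one j (hβ₂ n)))

/-! ## §4 STEP A: `pᵏ f = log_W ∘ ψ` with `ψ = exp_W(pᵏ f) ∈ Xℤ_p⟦X⟧` -/

include hf0 hSK in
/-- **STEP A (second kind ⟹ `log_W ∘ (integral)`).** For `V/ℤ_p` (`p` odd) with elliptic generic and special fibres and
`f ∈ Xℚ_p⟦X⟧` whose `F_W`-coboundary has `pᵈ`-bounded denominators, there are `k` and `ψ ∈ Xℤ_p⟦X⟧` with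
**`log_W(ψ) = pᵏ·f`** (namely `ψ = exp_W(pᵏ f)`): `pᵏ f` and `log_W` have the same Honda type `p − aT + T²`
(§3 and the tree's `norm_coeff_hondaShift_formalLog_le_one`), so Hazewinkel's functional equation lemma (ii)
(`norm_coeff_le_one_of_subst_eq`, Honda's strong isomorphism theorem) makes `log_W⁻¹ ∘ (pᵏ f)` integral.
[cite: Honda1970, Thm. 2 (p. 223)] [cite: Hazewinkel1978, Ch. I §2.2 (ii), §2.3] [cite: Katz1981CrystallineDieudonne, §5 Thm 5.1.4] -/
theorem exists_isPadicInt_formalLog_subst_eq (hp2 : p ≠ 2) :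
    ∃ (k : ℕ) (ψ : ℚ_[p]⟦X⟧), IsPadicInt ψ ∧ constantCoeff ψ = 0 ∧
      (V.map PadicInt.Coe.ringHom).formalLog.subst ψ = PowerSeries.C ((p : ℚ_[p]) ^ k) * f := by
  haveI := V.isIntegral_map_coe
  set W := V.map PadicInt.Coe.ringHom with hWdef
  obtain ⟨k, hk⟩ := exists_norm_coeff_hondaShift_le_one V hf0 hSK hp2
  set β : ℚ_[p]⟦X⟧ := PowerSeries.C ((p : ℚ_[p]) ^ k) * f with hβ
  have hβ0 : constantCoeff β = 0 := by rw [hβ, map_mul, hf0, mul_zero]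
  have hβs : PowerSeries.HasSubst β := PowerSeries.HasSubst.of_constantCoeff_zero' hβ0
  have hexp : PowerSeries.HasSubst W.formalExp := PowerSeries.HasSubst.of_constantCoeff_zero' W.constantCoeff_formalExp
  set ψ : ℚ_[p]⟦X⟧ := W.formalExp.subst β with hψ
  have hψ0 : constantCoeff ψ = 0 := constantCoeff_powerSeries_subst_eq_zero hβ0 W.constantCoeff_formalExp
  have hlog : W.formalLog.subst ψ = β := by
    rw [hψ, ← PowerSeries.subst_comp_subst_apply hexp hβs, W.formalLog_subst_formalExp, PowerSeries.subst_X hβs]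
  have ha : ‖((Literature.NumberTheory.EllipticCurves.HasseManin.tr (V.map PadicInt.toZMod) : ℤ) : ℚ_[p])‖ ≤ 1 := by
    rw [show ((Literature.NumberTheory.EllipticCurves.HasseManin.tr (V.map PadicInt.toZMod) : ℤ) : ℚ_[p]) =
      ((Literature.NumberTheory.EllipticCurves.HasseManin.tr (V.map PadicInt.toZMod) : ℤ_[p]) : ℚ_[p]) by simp]
    exact PadicInt.norm_le_one _
  have h1 : ‖coeff 1 W.formalLog‖ = 1 := by rw [W.coeff_one_formalLog, norm_one]
  exact ⟨k, ψ, isPadicInt_iff_coeff.mpr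
    (norm_coeff_le_one_of_subst_eq ha (V.norm_coeff_hondaShift_formalLog_le_one hp2) hk h1 hψ0 hlog), hψ0, hlog⟩

end Honda

end Literature.NumberTheory.EllipticCurves.DescendedFrobenius.SecondKindLog

end Part9

/-!
## Part 10 — port of `Summits/BirchSwinnertonDyer/BirchSwinnertonDyer/Theorems/CyclotomicUntwistNineIntegralCoordinates.lean` (12 declarations kept)

# Integral coordinates in the power basis `1, ζ₉, …, ζ₉⁵` of `L = ℚ₃(ζ₉)` over `ℚ₃`, and the coefficientwise decomposition of `L`-series along it: bounded denominators over `L` ⟺ bounded denominators of the `ℚ₃`-coordinates (base change `V_{E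

Declarations of this Part (verbatim port; each keeps its own docstring and citation): `powerBasis_dim`, `norm_repr_le_one_of_mem`, `norm_pow_mul_repr_le_one`, `basis_mem`, `isIntegral_pow_mul_of_coords`, `exists_coords`, `eq_sum_of_coords`, `coords_of_eq_sum`, `hbd_coords_iff`, `coords_constantCoeff`, `coords_subst`, `coords_logType`.

Reference keys (see `references.bib` and the declarations' citations): [Washington1997], [Katz1981CrystallineDieudonne].
-/

section Part10

open scoped _root_.Classical
open _root_.PowerSeries _root_.Polynomial _root_.IsCyclotomicExtension Literature.NumberTheory.EllipticCurves
  Literature.NumberTheory.EllipticCurves.DescendedFrobenius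
  Literature.NumberTheory.EllipticCurves.DescendedFrobenius.NineIntegers
  Literature.NumberTheory.EllipticCurves.DescendedFrobenius.DescendedFrobeniusTransfer

namespace Literature.NumberTheory.EllipticCurves.DescendedFrobenius.NineCoordinates

/-- The power basis of `ζ₉` has `6 = φ(9)` elements. [cite: Washington1997, Prop. 1.2] -/
theorem powerBasis_dim : (zeta_spec.powerBasis ℚ_[3]).dim = 6 := by
  rw [IsPrimitiveRoot.powerBasis_dim, minpoly_zeta_eq_cyclotomic, natDegree_cyclotomic]
  rfl

/-- **Integral elements of `ℚ₃(ζ₉)` have `ℤ₃`-integral coordinates in the power basis `(ζ₉ⁱ)_{i<6}`** (`𝓞 = ℤ₃[ζ₉]`: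
write `x = q(ζ₉)`, `q ∈ ℤ₃[X]`, and reduce `q` modulo the monic `Φ₉ ∈ ℤ₃[X]`). [cite: Washington1997, Prop. 1.2] -/
theorem norm_repr_le_one_of_mem {x : KNine} (hx : x ∈ ONine) (i : Fin (zeta_spec.powerBasis ℚ_[3]).dim) :
    ‖(zeta_spec.powerBasis ℚ_[3]).basis.repr x i‖ ≤ 1 := by
  set ζ := zeta 9 ℚ_[3] KNine with hζ
  obtain ⟨q, rfl⟩ := exists_aeval_eq_of_mem hx
  set P : ℤ_[3][X] := cyclotomic 9 ℤ_[3] with hP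
  have hPm : P.Monic := cyclotomic.monic 9 ℤ_[3]
  have hP1 : P ≠ 1 := by
    intro h
    have := congrArg natDegree h
    rw [hP, natDegree_cyclotomic, natDegree_one] at this
    exact absurd this (by decide)
  have hPζ : aeval ζ P = 0 := by
    rw [hP, ← aeval_map_algebraMap ℚ_[3], map_cyclotomic, aeval_def, ← eval_map, map_cyclotomic, ← IsRoot.def,
      isRoot_cyclotomic_iff]
    exact zeta_spec
  set r := q %ₘ P with hr
  have hPdeg : P.natDegree = 6 := by rw [hP, natDegree_cyclotomic]; rfl
  have hdeg : r.natDegree < (zeta_spec.powerBasis ℚ_[3]).dim := by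
    rw [powerBasis_dim, ← hPdeg]
    exact natDegree_modByMonic_lt q hPm hP1
  have hx' : aeval ζ q = aeval ζ r := by
    conv_lhs => rw [← modByMonic_add_div q P]
    rw [map_add, map_mul, hPζ, zero_mul, add_zero]
  -- `x = Σ (r.coeff i) ζ^i` on the power basis
  have hsum : aeval ζ r = ∑ i : Fin (zeta_spec.powerBasis ℚ_[3]).dim,
      (algebraMap ℤ_[3] ℚ_[3] (r.coeff i)) • (zeta_spec.powerBasis ℚ_[3]).basis i := by
    rw [aeval_eq_sum_range' hdeg, ← Fin.sum_univ_eq_sum_range]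
    refine Finset.sum_congr rfl fun i _ => ?_
    rw [PowerBasis.coe_basis, IsPrimitiveRoot.powerBasis_gen, IsScalarTower.algebraMap_smul]
  rw [hx', hsum, (zeta_spec.powerBasis ℚ_[3]).basis.repr_sum_self]
  exact PadicInt.norm_le_one _

/-- Scaled form: `3ᵈ·x ∈ 𝓞 ⇒ ‖3ᵈ·xᵢ‖ ≤ 1` for every coordinate `xᵢ` of `x` in the power basis. [cite: Washington1997, Prop. 1.2] -/
theorem norm_pow_mul_repr_le_one {x : KNine} {d : ℕ} (hx : IsIntegral ℤ_[3] ((3 : KNine) ^ d * x))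
    (i : Fin (zeta_spec.powerBasis ℚ_[3]).dim) :
    ‖(3 : ℚ_[3]) ^ d * (zeta_spec.powerBasis ℚ_[3]).basis.repr x i‖ ≤ 1 := by
  have h := norm_repr_le_one_of_mem (show (3 : KNine) ^ d * x ∈ ONine from hx) i
  have e : (3 : KNine) ^ d * x = ((3 : ℚ_[3]) ^ d) • x := by
    rw [Algebra.smul_def, map_pow, map_ofNat]
  rwa [e, map_smul, Finsupp.smul_apply, smul_eq_mul] at h

/-- The power-basis elements `ζ₉ⁱ` are integral. [cite: Washington1997, Prop. 1.2] -/
theorem basis_mem (i : Fin (zeta_spec.powerBasis ℚ_[3]).dim) : (zeta_spec.powerBasis ℚ_[3]).basis i ∈ ONine := by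
  rw [PowerBasis.coe_basis, IsPrimitiveRoot.powerBasis_gen]
  exact pow_mem zeta_mem _

/-- Converse: if every coordinate satisfies `‖3ᵈ·xᵢ‖ ≤ 1` then `3ᵈ·x ∈ 𝓞`. [cite: Washington1997, Prop. 1.2] -/
theorem isIntegral_pow_mul_of_coords {x : KNine} {d : ℕ}
    (h : ∀ i : Fin (zeta_spec.powerBasis ℚ_[3]).dim, ‖(3 : ℚ_[3]) ^ d * (zeta_spec.powerBasis ℚ_[3]).basis.repr x i‖ ≤ 1) :
    IsIntegral ℤ_[3] ((3 : KNine) ^ d * x) := by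
  change (3 : KNine) ^ d * x ∈ ONine
  have e : (3 : KNine) ^ d * x = ∑ i, ((3 : ℚ_[3]) ^ d * (zeta_spec.powerBasis ℚ_[3]).basis.repr x i) •
      (zeta_spec.powerBasis ℚ_[3]).basis i := by
    conv_lhs => rw [← (zeta_spec.powerBasis ℚ_[3]).basis.sum_repr x]
    rw [Finset.mul_sum]
    refine Finset.sum_congr rfl fun i _ => ?_
    rw [mul_smul, Algebra.smul_def ((3 : ℚ_[3]) ^ d), map_pow, map_ofNat]
  rw [e]
  refine Subalgebra.sum_mem _ fun i _ => ?_
  set z : ℤ_[3] := ⟨(3 : ℚ_[3]) ^ d * (zeta_spec.powerBasis ℚ_[3]).basis.repr x i, h i⟩ with hz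
  have hc : algebraMap ℚ_[3] KNine ((3 : ℚ_[3]) ^ d * (zeta_spec.powerBasis ℚ_[3]).basis.repr x i) ∈ ONine := by
    have e1 : algebraMap ℚ_[3] KNine ((3 : ℚ_[3]) ^ d * (zeta_spec.powerBasis ℚ_[3]).basis.repr x i) =
        algebraMap ℤ_[3] KNine z := by
      rw [IsScalarTower.algebraMap_apply ℤ_[3] ℚ_[3] KNine]; rfl
    rw [e1]
    exact Subalgebra.algebraMap_mem _ _
  rw [Algebra.smul_def]
  exact mul_mem hc (basis_mem i)

section Series

variable {σ : Type*}

/-- **Coordinate series exist**: every `F ∈ L⟦σ⟧` has a family `G : Fin 6 → ℚ₃⟦σ⟧` of coordinate series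
(`[e]Gᵢ = i`-th coordinate of `[e]F`). [cite: Washington1997, Prop. 1.2] -/
theorem exists_coords (F : MvPowerSeries σ KNine) :
    ∃ G : Fin (zeta_spec.powerBasis ℚ_[3]).dim → MvPowerSeries σ ℚ_[3],
      ∀ e i, (zeta_spec.powerBasis ℚ_[3]).basis.repr (MvPowerSeries.coeff e F) i = MvPowerSeries.coeff e (G i) :=
  ⟨fun i e => (zeta_spec.powerBasis ℚ_[3]).basis.repr (F e) i, fun _ _ => rfl⟩

/-- **`F = Σᵢ bᵢ·Gᵢ`** for the coordinate series `Gᵢ` of `F`. [cite: Washington1997, Prop. 1.2] -/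
theorem eq_sum_of_coords {F : MvPowerSeries σ KNine} {G : Fin (zeta_spec.powerBasis ℚ_[3]).dim → MvPowerSeries σ ℚ_[3]}
    (hG : ∀ e i, (zeta_spec.powerBasis ℚ_[3]).basis.repr (MvPowerSeries.coeff e F) i = MvPowerSeries.coeff e (G i)) :
    F = ∑ i, MvPowerSeries.C ((zeta_spec.powerBasis ℚ_[3]).basis i) * (G i).map (algebraMap ℚ_[3] KNine) := by
  ext e
  rw [map_sum, ← (zeta_spec.powerBasis ℚ_[3]).basis.sum_repr (MvPowerSeries.coeff e F)]
  refine Finset.sum_congr rfl fun i _ => ?_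
  rw [MvPowerSeries.coeff_C_mul, MvPowerSeries.coeff_map, hG e i, Algebra.smul_def, mul_comm]

/-- **Uniqueness of coordinates**: if `F = Σᵢ bᵢ·Gᵢ` with `ℚ₃`-series `Gᵢ`, the `Gᵢ` are the coordinate series of `F`.
[cite: Washington1997, Prop. 1.2] -/
theorem coords_of_eq_sum {F : MvPowerSeries σ KNine} {G : Fin (zeta_spec.powerBasis ℚ_[3]).dim → MvPowerSeries σ ℚ_[3]}
    (hF : F = ∑ i, MvPowerSeries.C ((zeta_spec.powerBasis ℚ_[3]).basis i) * (G i).map (algebraMap ℚ_[3] KNine))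
    (e : σ →₀ ℕ) (i : Fin (zeta_spec.powerBasis ℚ_[3]).dim) :
    (zeta_spec.powerBasis ℚ_[3]).basis.repr (MvPowerSeries.coeff e F) i = MvPowerSeries.coeff e (G i) := by
  have hc : MvPowerSeries.coeff e F = ∑ j, (MvPowerSeries.coeff e (G j)) • (zeta_spec.powerBasis ℚ_[3]).basis j := by
    rw [hF, map_sum]
    refine Finset.sum_congr rfl fun j _ => ?_
    rw [MvPowerSeries.coeff_C_mul, MvPowerSeries.coeff_map, Algebra.smul_def, mul_comm]
  rw [hc, (zeta_spec.powerBasis ℚ_[3]).basis.repr_sum_self]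

/-- **Bounded denominators pass to and from coordinates, uniformly**: `3ᵈ·F ∈ 𝓞⟦σ⟧` iff every coordinate series has
`3ᵈ·Gᵢ ∈ ℤ₃⟦σ⟧` (§1). [cite: Katz1981CrystallineDieudonne, Thm. 5.3.3 (base change)] -/
theorem hbd_coords_iff {F : MvPowerSeries σ KNine} {G : Fin (zeta_spec.powerBasis ℚ_[3]).dim → MvPowerSeries σ ℚ_[3]}
    (hG : ∀ e i, (zeta_spec.powerBasis ℚ_[3]).basis.repr (MvPowerSeries.coeff e F) i = MvPowerSeries.coeff e (G i))
    (d : ℕ) :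
    (∀ e, IsIntegral ℤ_[3] ((3 : KNine) ^ d * MvPowerSeries.coeff e F)) ↔
      ∀ i, IsPadicInt (MvPowerSeries.C ((3 : ℚ_[3]) ^ d) * G i) := by
  constructor
  · intro h i e
    rw [MvPowerSeries.coeff_C_mul, ← hG e i]
    exact norm_pow_mul_repr_le_one (h e) i
  · intro h e
    refine isIntegral_pow_mul_of_coords fun i => ?_
    rw [hG e i, ← MvPowerSeries.coeff_C_mul]
    exact h i e

/-- Coordinates of the constant coefficient. [cite: Washington1997, Prop. 1.2] -/
theorem coords_constantCoeff {F : MvPowerSeries σ KNine} {G : Fin (zeta_spec.powerBasis ℚ_[3]).dim → MvPowerSeries σ ℚ_[3]}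
    (hG : ∀ e i, (zeta_spec.powerBasis ℚ_[3]).basis.repr (MvPowerSeries.coeff e F) i = MvPowerSeries.coeff e (G i))
    (hF : MvPowerSeries.constantCoeff F = 0) (i : Fin (zeta_spec.powerBasis ℚ_[3]).dim) :
    MvPowerSeries.constantCoeff (G i) = 0 := by
  rw [← MvPowerSeries.coeff_zero_eq_constantCoeff_apply, ← hG 0 i, MvPowerSeries.coeff_zero_eq_constantCoeff_apply, hF,
    map_zero, Finsupp.zero_apply]

/-- **Substitution commutes with coordinates**: if `gᵢ` are the coordinate series of `f ∈ L⟦X⟧` and `A ∈ ℚ₃⟦τ⟧` has no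
constant term, the coordinate series of `f(A)` are the `gᵢ(A)`. [cite: Washington1997, Prop. 1.2] -/
theorem coords_subst {f : KNine⟦X⟧} {g : Fin (zeta_spec.powerBasis ℚ_[3]).dim → ℚ_[3]⟦X⟧}
    (hg : ∀ e i, (zeta_spec.powerBasis ℚ_[3]).basis.repr (MvPowerSeries.coeff e f) i = MvPowerSeries.coeff e (g i))
    {τ : Type*} {A : MvPowerSeries τ ℚ_[3]} (hA : MvPowerSeries.constantCoeff A = 0) (e : τ →₀ ℕ)
    (i : Fin (zeta_spec.powerBasis ℚ_[3]).dim) :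
    (zeta_spec.powerBasis ℚ_[3]).basis.repr
        (MvPowerSeries.coeff e (f.subst (A.map (algebraMap ℚ_[3] KNine)))) i =
      MvPowerSeries.coeff e ((g i).subst A) := by
  have hAs : HasSubst A := HasSubst.of_constantCoeff_zero hA
  have hA' : MvPowerSeries.constantCoeff (A.map (algebraMap ℚ_[3] KNine)) = 0 := by
    rw [MvPowerSeries.constantCoeff_map, hA, map_zero]
  have hAs' : HasSubst (A.map (algebraMap ℚ_[3] KNine)) := HasSubst.of_constantCoeff_zero hA'
  refine coords_of_eq_sum (G := fun j => (g j).subst A) ?_ e i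
  have hf := eq_sum_of_coords hg
  rw [hf, ← coe_substAlgHom hAs', map_sum]
  have hC : ∀ r : KNine, PowerSeries.subst (A.map (algebraMap ℚ_[3] KNine)) (MvPowerSeries.C r : KNine⟦X⟧) =
      MvPowerSeries.C r := fun r => PowerSeries.subst_C r
  refine Finset.sum_congr rfl fun j _ => ?_
  rw [map_mul, coe_substAlgHom hAs', hC]
  congr 1
  exact (PowerSeries.map_subst hAs (g j)).symm

/-- `n·[zⁿ]` bounds pass to coordinates: `3ᵈ·n·[zⁿ]f ∈ 𝓞 ⇒ ‖3ᵈ·n·[zⁿ]gᵢ‖ ≤ 1`. [cite: Washington1997, Prop. 1.2] -/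
theorem coords_logType {f : KNine⟦X⟧} {g : Fin (zeta_spec.powerBasis ℚ_[3]).dim → ℚ_[3]⟦X⟧}
    (hg : ∀ e i, (zeta_spec.powerBasis ℚ_[3]).basis.repr (MvPowerSeries.coeff e f) i = MvPowerSeries.coeff e (g i))
    {d : ℕ} (h : ∀ n : ℕ, IsIntegral ℤ_[3] ((3 : KNine) ^ d * ((n : KNine) * coeff n f))) (n : ℕ)
    (i : Fin (zeta_spec.powerBasis ℚ_[3]).dim) :
    ‖(3 : ℚ_[3]) ^ d * ((n : ℚ_[3]) * coeff n (g i))‖ ≤ 1 := by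
  have hn : (n : KNine) * coeff n f = (n : ℚ_[3]) • coeff n f := by
    rw [Algebra.smul_def, map_natCast]
  have key := norm_pow_mul_repr_le_one (h n) i
  rw [hn, map_smul, Finsupp.smul_apply, smul_eq_mul, show coeff n f = MvPowerSeries.coeff (Finsupp.single () n) f from rfl,
    hg, show MvPowerSeries.coeff (Finsupp.single () n) (g i) = coeff n (g i) from rfl] at key
  exact key

end Series

end Literature.NumberTheory.EllipticCurves.DescendedFrobenius.NineCoordinates

end Part10

/-!
## Part 11 — port of `Summits/BirchSwinnertonDyer/BirchSwinnertonDyer/Theorems/CyclotomicUntwistKatzFrobeniusRelation.lean` (2 declarations kept)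

# The Frobenius relation `φ² − a·φ + 3 = 0` on every second-kind class of a Weierstrass equation over `𝓞 = 𝓞_{ℚ₃(ζ₉)}` with elliptic special fibre (`φ = (z ↦ z³)^*`, `a = 4 − #Ē(𝔽₃)`)

Declarations of this Part (verbatim port; each keeps its own docstring and citation): `exists_padicInt_lift`, `isElliptic_map_coe_of_isElliptic_map_toZMod`.

Reference keys (see `references.bib` and the declarations' citations): [SilvermanAEC2009].
-/

section Part11

open _root_.PowerSeries Literature.NumberTheory.EllipticCurves Literature.NumberTheory.EllipticCurves.DescendedFrobenius
  Literature.NumberTheory.EllipticCurves.DescendedFrobenius.DescendedFrobeniusTransfer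

namespace Literature.NumberTheory.EllipticCurves.DescendedFrobenius.KatzFrobenius

/-- **Coefficientwise `ℤ₃`-lift of a curve over `𝔽₃`** (lift every `aᵢ` by its digit). [cite: SilvermanAEC2009, VII.5] -/
theorem exists_padicInt_lift (Ebar : WeierstrassCurve (ZMod 3)) :
    ∃ V : WeierstrassCurve ℤ_[3], V.map PadicInt.toZMod = Ebar := by
  refine ⟨⟨(Ebar.a₁.val : ℤ_[3]), (Ebar.a₂.val : ℤ_[3]), (Ebar.a₃.val : ℤ_[3]), (Ebar.a₄.val : ℤ_[3]),
    (Ebar.a₆.val : ℤ_[3])⟩, ?_⟩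
  ext <;> simp [WeierstrassCurve.map]

/-- A `ℤ₃`-equation whose special fibre is an elliptic curve has elliptic generic fibre (`Δ` is a `3`-adic unit).
[cite: SilvermanAEC2009, VII.5] -/
theorem isElliptic_map_coe_of_isElliptic_map_toZMod (V : WeierstrassCurve ℤ_[3])
    [hV : (V.map PadicInt.toZMod).IsElliptic] : (V.map PadicInt.Coe.ringHom).IsElliptic := by
  refine ⟨?_⟩
  rw [WeierstrassCurve.map_Δ, isUnit_iff_ne_zero]
  intro h0
  have hΔ : V.Δ = 0 := (PadicInt.coe_eq_zero (p := 3)).mp h0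
  have h := hV.isUnit
  rw [WeierstrassCurve.map_Δ, hΔ, map_zero] at h
  exact not_isUnit_zero h

end Literature.NumberTheory.EllipticCurves.DescendedFrobenius.KatzFrobenius

end Part11

/-!
## Part 12 — port of `Summits/BirchSwinnertonDyer/BirchSwinnertonDyer/Theorems/CyclotomicUntwistDescendedFrobeniusTransferGoodModel.lean` (1 declarations kept)

# The transfer semantics for every good model over `𝓞_{ℚ₃(ζ₉)}` — the hypotheses of `transfer_coboundary_integral` discharged with `ϖ = 1 − ζ₉` and the uniqueness of the residue map (`NineIntegers.ker_residueMap_eq`)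

Declarations of this Part (verbatim port; each keeps its own docstring and citation): `ringHom_padicInt_eq_toZMod`.

Reference keys (see `references.bib` and the declarations' citations): [Katz1981CrystallineDieudonne].
-/

section Part12

open _root_.PowerSeries Literature.RingTheory.FormalGroups Literature.NumberTheory.EllipticCurves
  Literature.NumberTheory.EllipticCurves.DescendedFrobenius _root_.IsCyclotomicExtension
  Literature.NumberTheory.EllipticCurves.DescendedFrobenius.NineIntegers

namespace Literature.NumberTheory.EllipticCurves.DescendedFrobenius.DescendedFrobeniusTransfer

/-- **A ring hom `ℤ₃ → 𝔽₃` is the reduction map** (`x = n + 3y` with `n = (x mod 3).val`). [cite: Katz1981CrystallineDieudonne, §5 (supporting lemma)] -/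
theorem ringHom_padicInt_eq_toZMod (φ : ℤ_[3] →+* ZMod 3) : φ = PadicInt.toZMod := by
  ext x
  have hx : x - ((PadicInt.toZMod x).val : ℤ_[3]) ∈ RingHom.ker (PadicInt.toZMod (p := 3)) := by
    rw [RingHom.mem_ker, map_sub, map_natCast, ZMod.natCast_zmod_val, sub_self]
  rw [PadicInt.ker_toZMod, PadicInt.maximalIdeal_eq_span_p, Ideal.mem_span_singleton] at hx
  obtain ⟨y, hy⟩ := hx
  have e : x = ((PadicInt.toZMod x).val : ℤ_[3]) + ((3 : ℕ) : ℤ_[3]) * y := by rw [← hy]; ring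
  have h3 : φ ((3 : ℕ) : ℤ_[3]) = 0 := by rw [map_natCast]; decide
  conv_lhs => rw [e]
  rw [map_add, map_mul, h3, zero_mul, add_zero, map_natCast, ZMod.natCast_zmod_val]

end Literature.NumberTheory.EllipticCurves.DescendedFrobenius.DescendedFrobeniusTransfer

end Part12

/-!
## Part 13 — port of `Summits/BirchSwinnertonDyer/BirchSwinnertonDyer/Theorems/CyclotomicUntwistKatzRankOfPadicRank.lean` (6 declarations kept)

# Katz's rank statement over `𝓞 = 𝓞_{ℚ₃(ζ₉)}` from the rank statement over `ℤ₃` (base change + congruence of group laws modulo `ϖ`): `katz_dieudonne_rank_le_two ⟸ ` — work package W4 of the elementary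

Declarations of this Part (verbatim port; each keeps its own docstring and citation): `hbd_map_of_isPadicInt`, `hbd_sum`, `C_dvd_formalGroupLaw_sub_of_lift`, `cob_lift_bound`, `rankLeTwo_of_padicRankTwo_of`, `stub_KATZ_rankLeTwo_supersingular_of_padicRankTwo`.

Reference keys (see `references.bib` and the declarations' citations): [Katz1981CrystallineDieudonne], [SilvermanAEC2009].
-/

section Part13

open scoped _root_.Classical
open _root_.PowerSeries _root_.IsCyclotomicExtension Literature.NumberTheory.EllipticCurves
  Literature.NumberTheory.EllipticCurves.DescendedFrobenius
  Literature.NumberTheory.EllipticCurves.DescendedFrobenius.NineIntegers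
  Literature.NumberTheory.EllipticCurves.DescendedFrobenius.DescendedFrobeniusTransfer
  Literature.NumberTheory.EllipticCurves.DescendedFrobenius.NineCoordinates

namespace Literature.NumberTheory.EllipticCurves.DescendedFrobenius.KatzRankBaseChange

/-- A `ℚ₃`-series with `3ᵈ·g ∈ ℤ₃⟦X⟧` has bounded denominators over `L`. [cite: Katz1981CrystallineDieudonne, Thm. 5.3.3] -/
theorem hbd_map_of_isPadicInt {g : ℚ_[3]⟦X⟧} {d : ℕ} (h : IsPadicInt (PowerSeries.C ((3 : ℚ_[3]) ^ d) * g)) :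
    HasBoundedDenominators (g.map (algebraMap ℚ_[3] KNine)) := by
  refine ⟨d, fun n ↦ ?_⟩
  have h3 : ‖(3 : ℚ_[3]) ^ d * coeff n g‖ ≤ 1 := by
    have := isPadicInt_iff_coeff.mp h n
    rwa [PowerSeries.coeff_C_mul] at this
  set x : ℤ_[3] := ⟨(3 : ℚ_[3]) ^ d * coeff n g, h3⟩ with hx
  have e : (3 : KNine) ^ d * coeff n (g.map (algebraMap ℚ_[3] KNine)) = algebraMap ℤ_[3] KNine x := by
    rw [PowerSeries.coeff_map, IsScalarTower.algebraMap_apply ℤ_[3] ℚ_[3] KNine, hx]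
    change (3 : KNine) ^ d * algebraMap ℚ_[3] KNine (coeff n g) = algebraMap ℚ_[3] KNine ((3 : ℚ_[3]) ^ d * coeff n g)
    rw [map_mul, map_pow, map_ofNat]
  rw [e]; exact isIntegral_algebraMap

/-- Finite sums of series with bounded denominators have bounded denominators. [cite: Katz1981CrystallineDieudonne, Thm. 5.3.3] -/
theorem hbd_sum {ι : Type*} (s : Finset ι) (F : ι → KNine⟦X⟧) (h : ∀ i ∈ s, HasBoundedDenominators (F i)) :
    HasBoundedDenominators (∑ i ∈ s, F i) :=
  Finset.sum_induction F HasBoundedDenominators (fun _ _ ha hb => ha.add hb) HasBoundedDenominators.zero h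

/-- **`F_E ≡ F_{V₀} (mod ϖ)`**: the group law of `E/𝓞` and of a `ℤ₃`-lift `V₀` of its special fibre agree coefficientwise
modulo any `ϖ` with `ker ρ ⊆ (ϖ)` (the group law commutes with base change). [cite: SilvermanAEC2009, IV.2] -/
theorem C_dvd_formalGroupLaw_sub_of_lift (E : WeierstrassCurve ONine) (ρ : ONine →+* ZMod 3) {ϖ : ONine}
    (hker : ∀ x : ONine, ρ x = 0 → ϖ ∣ x) {V₀ : WeierstrassCurve ℤ_[3]} (hV : V₀.map PadicInt.toZMod = E.map ρ) :
    MvPowerSeries.C ϖ ∣ E.formalGroupLaw - (V₀.map (algebraMap ℤ_[3] ONine)).formalGroupLaw := by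
  have hρ : ρ.comp (algebraMap ℤ_[3] ONine) = PadicInt.toZMod := ringHom_padicInt_eq_toZMod _
  have hmap : E.formalGroupLaw.map ρ = (V₀.map (algebraMap ℤ_[3] ONine)).formalGroupLaw.map ρ := by
    rw [WeierstrassCurve.map_formalGroupLaw, WeierstrassCurve.map_formalGroupLaw, WeierstrassCurve.map_map, hρ, hV]
  have hc : ∀ e, ϖ ∣ MvPowerSeries.coeff e (E.formalGroupLaw - (V₀.map (algebraMap ℤ_[3] ONine)).formalGroupLaw) := by
    intro e
    apply hker
    have := congrArg (MvPowerSeries.coeff e) hmap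
    rw [MvPowerSeries.coeff_map, MvPowerSeries.coeff_map] at this
    rw [map_sub, map_sub, this, sub_self]
  choose c hc' using hc
  refine ⟨fun e => c e, MvPowerSeries.ext fun e => ?_⟩
  rw [MvPowerSeries.coeff_C_mul]
  exact hc' e

/-- **The `F_{V₀}`-coboundary of an `F_E`-second-kind series is bounded.** If `3ᵈ·n·[zⁿ]f ∈ 𝓞` and the `F_E`-coboundary of
`f` is `3^{d′}`-bounded, then for any `ℤ₃`-lift `V₀` of the special fibre the `F_{V₀}`-coboundary of `f` is
`3^{d+1+d′}`-bounded: `f(F_E) − f(F_{V₀})` is `3^{d+1}`-bounded by Katz's Key Lemma modulo `ϖ`.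
[cite: Katz1981CrystallineDieudonne, §5 Key Lemma 5.1.3] -/
theorem cob_lift_bound (E : WeierstrassCurve ONine) (ρ : ONine →+* ZMod 3) {V₀ : WeierstrassCurve ℤ_[3]}
    (hV : V₀.map PadicInt.toZMod = E.map ρ) {f : KNine⟦X⟧} {d : ℕ}
    (hf : ∀ n : ℕ, IsIntegral ℤ_[3] ((3 : KNine) ^ d * ((n : KNine) * coeff n f))) {d' : ℕ}
    (hcob : ∀ e : Fin 2 →₀ ℕ, IsIntegral ℤ_[3] ((3 : KNine) ^ d' * MvPowerSeries.coeff e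
      (f.subst (E.map (algebraMap ONine KNine)).formalGroupLaw - f.subst (MvPowerSeries.X 0) -
        f.subst (MvPowerSeries.X 1)))) (e : Fin 2 →₀ ℕ) :
    IsIntegral ℤ_[3] ((3 : KNine) ^ (d + 1 + d') * MvPowerSeries.coeff e
      (f.subst ((V₀.map (algebraMap ℤ_[3] KNine)).formalGroupLaw) - f.subst (MvPowerSeries.X 0) -
        f.subst (MvPowerSeries.X 1))) := by
  set ι := algebraMap ONine KNine with hι
  obtain ⟨ϖ, θ, θ', h3, hθ, hker, -⟩ := KatzFrobenius.exists_uniformizer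
  have hUV := C_dvd_formalGroupLaw_sub_of_lift E ρ (hker ρ) hV
  have hU0 : MvPowerSeries.constantCoeff E.formalGroupLaw = 0 := E.constantCoeff_formalGroupLaw
  have hV0 : MvPowerSeries.constantCoeff (V₀.map (algebraMap ℤ_[3] ONine)).formalGroupLaw = 0 :=
    (V₀.map (algebraMap ℤ_[3] ONine)).constantCoeff_formalGroupLaw
  have hkey := KatzFrobenius.isIntegral_three_pow_mul_mvCoeff_subst_sub_subst h3 hθ hf hU0 hV0 hUV e
  have hE : (E.map ι).formalGroupLaw = E.formalGroupLaw.map ι := (WeierstrassCurve.map_formalGroupLaw E ι).symm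
  have hV' : (V₀.map (algebraMap ℤ_[3] KNine)).formalGroupLaw = (V₀.map (algebraMap ℤ_[3] ONine)).formalGroupLaw.map ι := by
    rw [WeierstrassCurve.map_formalGroupLaw, WeierstrassCurve.map_map, hι, ← IsScalarTower.algebraMap_eq ℤ_[3] ONine KNine]
  have edec : f.subst ((V₀.map (algebraMap ℤ_[3] KNine)).formalGroupLaw) - f.subst (MvPowerSeries.X 0) -
        f.subst (MvPowerSeries.X 1) =
      (f.subst (E.map ι).formalGroupLaw - f.subst (MvPowerSeries.X 0) - f.subst (MvPowerSeries.X 1)) -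
        (f.subst (E.formalGroupLaw.map ι) - f.subst ((V₀.map (algebraMap ℤ_[3] ONine)).formalGroupLaw.map ι)) := by
    rw [hE, hV']; ring
  rw [edec, map_sub, mul_sub]
  refine IsIntegral.sub ?_ ?_
  · rw [pow_add, mul_assoc]
    exact (KatzFrobenius.isIntegral_three_pow (d + 1)).mul (hcob e)
  · rw [pow_add, mul_comm ((3 : KNine) ^ (d + 1)), mul_assoc]
    exact (KatzFrobenius.isIntegral_three_pow d').mul hkey

/-- **Rank `≤ 2` over `𝓞` from the `ℤ₃`-statement, under any condition `P` on the special fibre** (the `ℤ₃`-statement is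
asked only for lifts whose reduction satisfies `P`; the conclusion is the rank statement for `𝓞`-models whose special fibre
satisfies `P`). With `P Ē := 3 ∣ tr(Ē)` this is the supersingular door of the K-SEP skeleton (stub `S2k`).
[cite: Katz1981CrystallineDieudonne, Thm. 5.3.3] -/
theorem rankLeTwo_of_padicRankTwo_of (P : WeierstrassCurve (ZMod 3) → Prop)
    (H3P : ∀ (V₀ : WeierstrassCurve ℤ_[3]) [(V₀.map PadicInt.Coe.ringHom).IsElliptic]
      [(V₀.map PadicInt.toZMod).IsElliptic], P (V₀.map PadicInt.toZMod) → ∀ (g : ℚ_[3]⟦X⟧), constantCoeff g = 0 →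
      (∃ d : ℕ, ∀ n : ℕ, ‖(3 : ℚ_[3]) ^ d * ((n : ℚ_[3]) * coeff n g)‖ ≤ 1) →
      (∃ d' : ℕ, ∀ e : Fin 2 →₀ ℕ, ‖(3 : ℚ_[3]) ^ d' * MvPowerSeries.coeff e
        (g.subst (V₀.map PadicInt.Coe.ringHom).formalGroupLaw - g.subst (MvPowerSeries.X 0) -
          g.subst (MvPowerSeries.X 1))‖ ≤ 1) →
      ∃ (a b : ℚ_[3]) (d'' : ℕ), ∀ n : ℕ, ‖(3 : ℚ_[3]) ^ d'' * coeff n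
        (g - PowerSeries.C a * (V₀.map PadicInt.Coe.ringHom).formalLog -
          PowerSeries.C b * expand 3 (by norm_num) (V₀.map PadicInt.Coe.ringHom).formalLog)‖ ≤ 1) :
    ∀ (E : WeierstrassCurve ONine) (ρ : ONine →+* ZMod 3), IsUnit (E.map ρ).Δ → P (E.map ρ) →
      ∀ f : Fin 3 → KNine⟦X⟧,
        (∀ i, constantCoeff (f i) = 0 ∧
          (∃ d : ℕ, ∀ n : ℕ, IsIntegral ℤ_[3] ((3 : KNine) ^ d * ((n : KNine) * coeff n (f i)))) ∧
          (∃ d' : ℕ, ∀ e : Fin 2 →₀ ℕ, IsIntegral ℤ_[3] ((3 : KNine) ^ d' * MvPowerSeries.coeff e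
            ((f i).subst (E.map (algebraMap ONine KNine)).formalGroupLaw - (f i).subst (MvPowerSeries.X 0) -
              (f i).subst (MvPowerSeries.X 1))))) →
        ∃ a : Fin 3 → KNine, a ≠ 0 ∧ HasBoundedDenominators (∑ i, PowerSeries.C (a i) * f i) := by
  intro E ρ hΔ hPE f hf
  set ι := algebraMap ONine KNine with hι
  set ι₃ := algebraMap ℚ_[3] KNine with hι₃
  set pb := zeta_spec.powerBasis ℚ_[3] with hpb
  -- the lift and its fibres
  obtain ⟨V₀, hV⟩ := KatzFrobenius.exists_padicInt_lift (E.map ρ)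
  haveI hEt : (V₀.map PadicInt.toZMod).IsElliptic := ⟨by rw [hV]; exact hΔ⟩
  haveI hE0 : (V₀.map PadicInt.Coe.ringHom).IsElliptic := KatzFrobenius.isElliptic_map_coe_of_isElliptic_map_toZMod V₀
  have hP : P (V₀.map PadicInt.toZMod) := by rw [hV]; exact hPE
  set W₀ := V₀.map (PadicInt.Coe.ringHom (p := 3)) with hW₀
  set F₀ := W₀.formalGroupLaw with hF₀
  set ℓ₀ := W₀.formalLog with hℓ₀
  have hcoe : (PadicInt.Coe.ringHom (p := 3)) = algebraMap ℤ_[3] ℚ_[3] := rfl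
  have hF₀K : (V₀.map (algebraMap ℤ_[3] KNine)).formalGroupLaw = F₀.map ι₃ := by
    rw [hF₀, hW₀, WeierstrassCurve.map_formalGroupLaw, WeierstrassCurve.map_map, hcoe, hι₃,
      ← IsScalarTower.algebraMap_eq ℤ_[3] ℚ_[3] KNine]
  have hF₀0 : MvPowerSeries.constantCoeff F₀ = 0 := W₀.constantCoeff_formalGroupLaw
  have hX0 : ∀ k : Fin 2, (MvPowerSeries.X k : MvPowerSeries (Fin 2) KNine) =
      (MvPowerSeries.X k : MvPowerSeries (Fin 2) ℚ_[3]).map ι₃ := fun k => (MvPowerSeries.map_X ι₃ k).symm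
  have hX00 : ∀ k : Fin 2, MvPowerSeries.constantCoeff (MvPowerSeries.X k : MvPowerSeries (Fin 2) ℚ_[3]) = 0 :=
    fun k => MvPowerSeries.constantCoeff_X k
  -- coordinates of the three series
  have hcoords : ∀ i : Fin 3, ∃ G : Fin pb.dim → ℚ_[3]⟦X⟧,
      ∀ (e : Unit →₀ ℕ) (j : Fin pb.dim), pb.basis.repr (MvPowerSeries.coeff e (f i)) j = MvPowerSeries.coeff e (G j) :=
    fun i => exists_coords (σ := Unit) (f i)
  choose g hg using hcoords
  -- each coordinate series is of the second kind for `F₀`, and `H3` applies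
  have hspan : ∀ i j, ∃ (a b : ℚ_[3]) (d'' : ℕ), ∀ n : ℕ, ‖(3 : ℚ_[3]) ^ d'' * coeff n
      (g i j - PowerSeries.C a * ℓ₀ - PowerSeries.C b * expand 3 (by norm_num) ℓ₀)‖ ≤ 1 := by
    intro i j
    obtain ⟨hf0, ⟨d, hd⟩, ⟨d', hd'⟩⟩ := hf i
    refine H3P V₀ hP (g i j) ?_ ⟨d, fun n => coords_logType (hg i) hd n j⟩ ?_
    · exact coords_constantCoeff (hg i) hf0 j
    · -- coboundary for `F₀`: coordinates of the (bounded) `F_{V₀ ⊗ 𝓞}`-coboundary of `f i`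
      have hcobL := cob_lift_bound E ρ hV hd hd'
      refine ⟨d + 1 + d', fun e => ?_⟩
      have hc : ∀ (e : Fin 2 →₀ ℕ) (j' : Fin pb.dim), pb.basis.repr (MvPowerSeries.coeff e
          ((f i).subst ((V₀.map (algebraMap ℤ_[3] KNine)).formalGroupLaw) - (f i).subst (MvPowerSeries.X 0) -
            (f i).subst (MvPowerSeries.X 1))) j' =
          MvPowerSeries.coeff e ((g i j').subst F₀ - (g i j').subst (MvPowerSeries.X 0 : MvPowerSeries (Fin 2) ℚ_[3]) -
            (g i j').subst (MvPowerSeries.X 1 : MvPowerSeries (Fin 2) ℚ_[3])) := by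
        intro e j'
        rw [hF₀K, hX0 0, hX0 1]
        simp only [map_sub, Finsupp.sub_apply]
        rw [coords_subst (hg i) hF₀0, coords_subst (hg i) (hX00 0), coords_subst (hg i) (hX00 1)]
      have key := ((hbd_coords_iff hc (d + 1 + d')).mp hcobL) j e
      rwa [MvPowerSeries.coeff_C_mul] at key
  choose a b d'' hspan' using hspan
  -- reassemble over `L`
  set A : Fin 3 → KNine := fun i => ∑ j, ι₃ (a i j) * pb.basis j with hA
  set B : Fin 3 → KNine := fun i => ∑ j, ι₃ (b i j) * pb.basis j with hB
  have hrest : ∀ i, HasBoundedDenominators (f i - PowerSeries.C (A i) * ℓ₀.map ι₃ -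
      PowerSeries.C (B i) * expand 3 (by norm_num) (ℓ₀.map ι₃)) := by
    intro i
    have hfi : f i = ∑ j, PowerSeries.C (pb.basis j) * (g i j).map ι₃ := eq_sum_of_coords (hg i)
    have hsummand : ∀ j, PowerSeries.C (pb.basis j) * (g i j - PowerSeries.C (a i j) * ℓ₀ -
        PowerSeries.C (b i j) * expand 3 (by norm_num) ℓ₀).map ι₃ =
        PowerSeries.C (pb.basis j) * (g i j).map ι₃ - PowerSeries.C (ι₃ (a i j) * pb.basis j) * ℓ₀.map ι₃ -
          PowerSeries.C (ι₃ (b i j) * pb.basis j) * expand 3 (by norm_num) (ℓ₀.map ι₃) := by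
      intro j
      rw [map_sub, map_sub, map_mul, map_mul, PowerSeries.map_C, PowerSeries.map_C, PowerSeries.map_expand,
        map_mul PowerSeries.C, map_mul PowerSeries.C]
      ring
    have hAi : PowerSeries.C (A i) * ℓ₀.map ι₃ = ∑ j, PowerSeries.C (ι₃ (a i j) * pb.basis j) * ℓ₀.map ι₃ := by
      rw [hA]; simp only [map_sum, Finset.sum_mul]
    have hBi : PowerSeries.C (B i) * expand 3 (by norm_num) (ℓ₀.map ι₃) =
        ∑ j, PowerSeries.C (ι₃ (b i j) * pb.basis j) * expand 3 (by norm_num) (ℓ₀.map ι₃) := by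
      rw [hB]; simp only [map_sum, Finset.sum_mul]
    have e : f i - PowerSeries.C (A i) * ℓ₀.map ι₃ - PowerSeries.C (B i) * expand 3 (by norm_num) (ℓ₀.map ι₃) =
        ∑ j, PowerSeries.C (pb.basis j) * (g i j - PowerSeries.C (a i j) * ℓ₀ -
          PowerSeries.C (b i j) * expand 3 (by norm_num) ℓ₀).map ι₃ := by
      rw [Finset.sum_congr rfl (fun j _ => hsummand j), Finset.sum_sub_distrib, Finset.sum_sub_distrib, ← hfi, ← hAi,
        ← hBi]
    rw [e]
    refine hbd_sum _ _ fun j _ => hbd_C_mul _ (hbd_map_of_isPadicInt (d := d'' i j) ?_)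
    exact isPadicInt_iff_coeff.mpr fun n => by rw [PowerSeries.coeff_C_mul]; exact hspan' i j n
  -- three vectors in `L²` are dependent
  have hdep : ¬ LinearIndependent KNine (fun i : Fin 3 => (![A i, B i] : Fin 2 → KNine)) := by
    intro hli
    have := hli.fintype_card_le_finrank
    rw [Fintype.card_fin, Module.finrank_fin_fun] at this
    omega
  obtain ⟨c, hc0, i₀, hi₀⟩ := Fintype.not_linearIndependent_iff.mp hdep
  have hcA : ∑ i, c i * A i = 0 := by
    have := congrFun hc0 0
    simpa [Finset.sum_apply, Pi.smul_apply, smul_eq_mul] using this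
  have hcB : ∑ i, c i * B i = 0 := by
    have := congrFun hc0 1
    simpa [Finset.sum_apply, Pi.smul_apply, smul_eq_mul] using this
  refine ⟨c, fun h => hi₀ (by rw [h]; rfl), ?_⟩
  have e : ∑ i, PowerSeries.C (c i) * f i =
      ∑ i, PowerSeries.C (c i) * (f i - PowerSeries.C (A i) * ℓ₀.map ι₃ -
        PowerSeries.C (B i) * expand 3 (by norm_num) (ℓ₀.map ι₃)) +
      PowerSeries.C (∑ i, c i * A i) * ℓ₀.map ι₃ + PowerSeries.C (∑ i, c i * B i) * expand 3 (by norm_num) (ℓ₀.map ι₃) := by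
    simp only [map_sum, map_mul, Finset.sum_mul, ← Finset.sum_add_distrib]
    refine Finset.sum_congr rfl fun i _ => ?_
    ring
  rw [e, hcA, hcB, map_zero, zero_mul, zero_mul, add_zero, add_zero]
  exact hbd_sum _ _ fun i _ => hbd_C_mul _ (hrest i)

/-- **Stub `S2k` of the K-SEP skeletons (`stub_KATZ_rankLeTwo_supersingular`, lead g6, Lines/dfrob_wan v3 /
dfrob_kato v3) FROM the supersingular `ℤ₃`-statement** — the target of W1+W3 (Honda functional equation +
3-adic digit expansion in `End_{𝔽₃}(F̄) = ℤ₃[π]`, which uses `3 ∣ a`). [cite: Katz1981CrystallineDieudonne, Thm. 5.3.3] -/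
theorem stub_KATZ_rankLeTwo_supersingular_of_padicRankTwo
    (H3ss : ∀ (V₀ : WeierstrassCurve ℤ_[3]) [(V₀.map PadicInt.Coe.ringHom).IsElliptic]
      [(V₀.map PadicInt.toZMod).IsElliptic], (3 : ℤ) ∣ HasseManin.tr (V₀.map PadicInt.toZMod) →
      ∀ (g : ℚ_[3]⟦X⟧), constantCoeff g = 0 →
      (∃ d : ℕ, ∀ n : ℕ, ‖(3 : ℚ_[3]) ^ d * ((n : ℚ_[3]) * coeff n g)‖ ≤ 1) →
      (∃ d' : ℕ, ∀ e : Fin 2 →₀ ℕ, ‖(3 : ℚ_[3]) ^ d' * MvPowerSeries.coeff e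
        (g.subst (V₀.map PadicInt.Coe.ringHom).formalGroupLaw - g.subst (MvPowerSeries.X 0) -
          g.subst (MvPowerSeries.X 1))‖ ≤ 1) →
      ∃ (a b : ℚ_[3]) (d'' : ℕ), ∀ n : ℕ, ‖(3 : ℚ_[3]) ^ d'' * coeff n
        (g - PowerSeries.C a * (V₀.map PadicInt.Coe.ringHom).formalLog -
          PowerSeries.C b * expand 3 (by norm_num) (V₀.map PadicInt.Coe.ringHom).formalLog)‖ ≤ 1) :
    ∀ (E : WeierstrassCurve ONine) (ρ : ONine →+* ZMod 3), IsUnit (E.map ρ).Δ → (3 : ℤ) ∣ HasseManin.tr (E.map ρ) →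
      ∀ f : Fin 3 → KNine⟦X⟧,
        (∀ i, constantCoeff (f i) = 0 ∧
          (∃ d : ℕ, ∀ n : ℕ, IsIntegral ℤ_[3] ((3 : KNine) ^ d * ((n : KNine) * coeff n (f i)))) ∧
          (∃ d' : ℕ, ∀ e : Fin 2 →₀ ℕ, IsIntegral ℤ_[3] ((3 : KNine) ^ d' * MvPowerSeries.coeff e
            ((f i).subst (E.map (algebraMap ONine KNine)).formalGroupLaw - (f i).subst (MvPowerSeries.X 0) -
              (f i).subst (MvPowerSeries.X 1))))) →
        ∃ a : Fin 3 → KNine, a ≠ 0 ∧ HasBoundedDenominators (∑ i, PowerSeries.C (a i) * f i) :=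
  rankLeTwo_of_padicRankTwo_of (fun Ē => (3 : ℤ) ∣ HasseManin.tr Ē) (fun V₀ _ _ hV₀ => H3ss V₀ hV₀)

end Literature.NumberTheory.EllipticCurves.DescendedFrobenius.KatzRankBaseChange

end Part13

/-!
## Part 14 — port of `Summits/BirchSwinnertonDyer/BirchSwinnertonDyer/Theorems/CyclotomicUntwistKatzRankSupersingular.lean` (3 declarations kept)

# Katz 1981 Thm. 5.3.3 for good models over `𝓞_{ℚ₃(ζ₉)}` with supersingular fibre: any three second-kind series are `ℚ₃(ζ₉)`-dependent modulo bounded denominators (Honda's step, the digit bridge and base change)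

Declarations of this Part (verbatim port; each keeps its own docstring and citation): `honda_step`, `padicRankTwo_supersingular_of_digits`, `stub_KATZ_rankLeTwo_supersingular_of_digits`.

Reference keys (see `references.bib` and the declarations' citations): [Katz1981CrystallineDieudonne], [Honda1970].
-/

section Part14

open scoped _root_.Classical
open _root_.PowerSeries _root_.WeierstrassCurve Literature.NumberTheory.EllipticCurves
  Literature.NumberTheory.EllipticCurves.DescendedFrobenius
  Literature.NumberTheory.EllipticCurves.DescendedFrobenius

namespace Literature.NumberTheory.EllipticCurves.DescendedFrobenius.KatzRankSupersingular

/-- **Honda's step for every `V₀/ℤ₃` with elliptic fibres** (g8's `exists_isPadicInt_formalLog_subst_eq`, in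
the lead's binder shape `hW1`). [cite: Honda1970, Thm. 2] -/
theorem honda_step (V₀ : WeierstrassCurve ℤ_[3]) [(V₀.map PadicInt.Coe.ringHom).IsElliptic]
    [(V₀.map PadicInt.toZMod).IsElliptic] (g : ℚ_[3]⟦X⟧) (hg0 : constantCoeff g = 0)
    (_hd : ∃ d : ℕ, ∀ n : ℕ, ‖(3 : ℚ_[3]) ^ d * ((n : ℚ_[3]) * coeff n g)‖ ≤ 1)
    (hd' : ∃ d' : ℕ, ∀ e : Fin 2 →₀ ℕ, ‖(3 : ℚ_[3]) ^ d' * MvPowerSeries.coeff e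
      (g.subst (V₀.map PadicInt.Coe.ringHom).formalGroupLaw - g.subst (MvPowerSeries.X 0) -
        g.subst (MvPowerSeries.X 1))‖ ≤ 1) :
    ∃ (k : ℕ) (h : ℚ_[3]⟦X⟧), constantCoeff h = 0 ∧ IsPadicInt h ∧
      (V₀.map PadicInt.Coe.ringHom).formalLog.subst h = C ((3 : ℚ_[3]) ^ k) * g := by
  obtain ⟨d', hSK⟩ := hd'
  obtain ⟨k, ψ, hψint, hψ0, hψ⟩ := SecondKindLog.exists_isPadicInt_formalLog_subst_eq V₀ hg0 hSK (by norm_num)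
  exact ⟨k, ψ, hψ0, hψint, by rw [hψ]; norm_cast⟩

/-- **`H3ss` FROM THE DIGIT THEOREM ALONE.** If for every `V₀/ℤ₃` with elliptic fibres and supersingular reduction every
integral `H ∈ Xℤ₃⟦X⟧` whose reduction is an endomorphism of the reduced formal group admits the finite-level digit
expansions `H̄ = F̄(F̄([a_J]X, [b_J](X³)), [3ᴶ](g_J))` with `a_J → A`, `b_J → B` in `ℤ₃` (g7's `★`), then every
second-kind `ℚ₃`-series of such a `V₀` is `≡ a·log + b·log(X³)` modulo `3`-power-bounded denominators.
[cite: Katz1981CrystallineDieudonne, Thm. 5.3.3] -/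
theorem padicRankTwo_supersingular_of_digits
    (hDigAll : ∀ (V₀ : WeierstrassCurve ℤ_[3]) [(V₀.map PadicInt.Coe.ringHom).IsElliptic]
      [(V₀.map PadicInt.toZMod).IsElliptic], (3 : ℤ) ∣ HasseManin.tr (V₀.map PadicInt.toZMod) →
      ∀ H : ℤ_[3]⟦X⟧, constantCoeff H = 0 →
      (H.map PadicInt.toZMod).subst (V₀.map PadicInt.toZMod).formalGroupLaw =
        MvPowerSeries.subst ![(H.map PadicInt.toZMod).subst (MvPowerSeries.X 0 : MvPowerSeries (Fin 2) (ZMod 3)),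
          (H.map PadicInt.toZMod).subst (MvPowerSeries.X 1 : MvPowerSeries (Fin 2) (ZMod 3))]
          (V₀.map PadicInt.toZMod).formalGroupLaw →
      ∃ (A B : ℤ_[3]) (a b : ℕ → ℕ) (g : ℕ → (ZMod 3)⟦X⟧),
        (∀ J, constantCoeff (g J) = 0) ∧
        (∀ J, ‖((a J : ℤ_[3]) - A : ℤ_[3])‖ ≤ (3 : ℝ) ^ (-(J : ℤ)) ∧ ‖((b J : ℤ_[3]) - B : ℤ_[3])‖ ≤ (3 : ℝ) ^ (-(J : ℤ))) ∧
        ∀ J, H.map PadicInt.toZMod =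
          MvPowerSeries.subst ![MvPowerSeries.subst ![(V₀.map PadicInt.toZMod).formalMul (a J),
              expand 3 (by norm_num) ((V₀.map PadicInt.toZMod).formalMul (b J))] (V₀.map PadicInt.toZMod).formalGroupLaw,
            ((V₀.map PadicInt.toZMod).formalMul (3 ^ J)).subst (g J)] (V₀.map PadicInt.toZMod).formalGroupLaw) :
    ∀ (V₀ : WeierstrassCurve ℤ_[3]) [(V₀.map PadicInt.Coe.ringHom).IsElliptic]
      [(V₀.map PadicInt.toZMod).IsElliptic], (3 : ℤ) ∣ HasseManin.tr (V₀.map PadicInt.toZMod) →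
      ∀ (g : ℚ_[3]⟦X⟧), constantCoeff g = 0 →
      (∃ d : ℕ, ∀ n : ℕ, ‖(3 : ℚ_[3]) ^ d * ((n : ℚ_[3]) * coeff n g)‖ ≤ 1) →
      (∃ d' : ℕ, ∀ e : Fin 2 →₀ ℕ, ‖(3 : ℚ_[3]) ^ d' * MvPowerSeries.coeff e
        (g.subst (V₀.map PadicInt.Coe.ringHom).formalGroupLaw - g.subst (MvPowerSeries.X 0) -
          g.subst (MvPowerSeries.X 1))‖ ≤ 1) →
      ∃ (a b : ℚ_[3]) (d'' : ℕ), ∀ n : ℕ, ‖(3 : ℚ_[3]) ^ d'' * coeff n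
        (g - PowerSeries.C a * (V₀.map PadicInt.Coe.ringHom).formalLog -
          PowerSeries.C b * expand 3 (by norm_num) (V₀.map PadicInt.Coe.ringHom).formalLog)‖ ≤ 1 := by
  intro V₀ _ _ hss g hg0 hd hd'
  exact PadicDigitLimit.padicRankTwo_of_honda_of_digits V₀ (by norm_num) (honda_step V₀) (hDigAll V₀ hss) g hg0 hd hd'

/-- **Stub `S2k` (`stub_KATZ_rankLeTwo_supersingular`, Lines/dfrob_wan v3 / dfrob_kato v3) FROM THE DIGIT THEOREM ALONE.**
[cite: Katz1981CrystallineDieudonne, Thm. 5.3.3] -/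
theorem stub_KATZ_rankLeTwo_supersingular_of_digits
    (hDigAll : ∀ (V₀ : WeierstrassCurve ℤ_[3]) [(V₀.map PadicInt.Coe.ringHom).IsElliptic]
      [(V₀.map PadicInt.toZMod).IsElliptic], (3 : ℤ) ∣ HasseManin.tr (V₀.map PadicInt.toZMod) →
      ∀ H : ℤ_[3]⟦X⟧, constantCoeff H = 0 →
      (H.map PadicInt.toZMod).subst (V₀.map PadicInt.toZMod).formalGroupLaw =
        MvPowerSeries.subst ![(H.map PadicInt.toZMod).subst (MvPowerSeries.X 0 : MvPowerSeries (Fin 2) (ZMod 3)),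
          (H.map PadicInt.toZMod).subst (MvPowerSeries.X 1 : MvPowerSeries (Fin 2) (ZMod 3))]
          (V₀.map PadicInt.toZMod).formalGroupLaw →
      ∃ (A B : ℤ_[3]) (a b : ℕ → ℕ) (g : ℕ → (ZMod 3)⟦X⟧),
        (∀ J, constantCoeff (g J) = 0) ∧
        (∀ J, ‖((a J : ℤ_[3]) - A : ℤ_[3])‖ ≤ (3 : ℝ) ^ (-(J : ℤ)) ∧ ‖((b J : ℤ_[3]) - B : ℤ_[3])‖ ≤ (3 : ℝ) ^ (-(J : ℤ))) ∧
        ∀ J, H.map PadicInt.toZMod =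
          MvPowerSeries.subst ![MvPowerSeries.subst ![(V₀.map PadicInt.toZMod).formalMul (a J),
              expand 3 (by norm_num) ((V₀.map PadicInt.toZMod).formalMul (b J))] (V₀.map PadicInt.toZMod).formalGroupLaw,
            ((V₀.map PadicInt.toZMod).formalMul (3 ^ J)).subst (g J)] (V₀.map PadicInt.toZMod).formalGroupLaw) :
    ∀ (E : WeierstrassCurve ONine) (ρ : ONine →+* ZMod 3), IsUnit (E.map ρ).Δ → (3 : ℤ) ∣ HasseManin.tr (E.map ρ) →
      ∀ f : Fin 3 → KNine⟦X⟧,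
        (∀ i, constantCoeff (f i) = 0 ∧
          (∃ d : ℕ, ∀ n : ℕ, _root_.IsIntegral ℤ_[3] ((3 : KNine) ^ d * ((n : KNine) * coeff n (f i)))) ∧
          (∃ d' : ℕ, ∀ e : Fin 2 →₀ ℕ, _root_.IsIntegral ℤ_[3] ((3 : KNine) ^ d' * MvPowerSeries.coeff e
            ((f i).subst (E.map (algebraMap ONine KNine)).formalGroupLaw - (f i).subst (MvPowerSeries.X 0) -
              (f i).subst (MvPowerSeries.X 1))))) →
        ∃ a : Fin 3 → KNine, a ≠ 0 ∧ HasBoundedDenominators (∑ i, PowerSeries.C (a i) * f i) :=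
  KatzRankBaseChange.stub_KATZ_rankLeTwo_supersingular_of_padicRankTwo (padicRankTwo_supersingular_of_digits hDigAll)

end Literature.NumberTheory.EllipticCurves.DescendedFrobenius.KatzRankSupersingular

end Part14

/-!
## Part 15 — port of `Summits/BirchSwinnertonDyer/BirchSwinnertonDyer/Theorems/CyclotomicUntwistFormalEtaCoboundaryPrep.lean` (9 declarations kept)

# The class of `η = x·ω` is of the second kind — Part I (preparations): the derivative of `formalEtaIntegral`, the Vieta product `D·w₁w₂w₃ = ν³`, the differentiated incidences, and the algebraic bridge

Declarations of this Part (verbatim port; each keeps its own docstring and citation): `derivative_formalEtaIntegral`, `X_sq_mul_derivative_formalEtaIntegral`, `X_sq_mul_formalEta_mul_derivative_formalEtaIntegral`, `X_mul_other`, `formalSlope_mul_X_add_formalIntercept`, `formalChordDenom_mul_prod_w`, `formalEta_mul_pderiv_formalSlope`, `formalChordZ_mul_S₃`, `bridge`.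

Reference keys (see `references.bib` and the declarations' citations): [SilvermanAEC2009], [Katz1981CrystallineDieudonne].
-/

section Part15

open _root_.PowerSeries Literature.NumberTheory.EllipticCurves
open Literature.AlgebraicGeometry.Resolution (MvPowerSeries.pderiv MvPowerSeries.coeff_pderiv
  MvPowerSeries.pderiv_X MvPowerSeries.pderiv_C MvPowerSeries.pderiv_powerSeries_subst
  MvPowerSeries.pderiv_powerSeries_subst_X MvPowerSeries.coeff_eq_zero_of_pderiv_eq_zero)

namespace Literature.NumberTheory.EllipticCurves.DescendedFrobenius.FormalEtaCoboundary

/-! ## §1 One variable: the derivative `e = (P − 1)/z²` of `L_η` and `q = e·η = (z²x − η)/z²` -/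

section OneVariable

variable {A : Type*} [CommRing A] [Algebra ℚ A] (W : WeierstrassCurve A)

/-- `dL_η/dz = Σ_{n ≥ 0} P_{n+2} zⁿ` (term-by-term: `[zⁿ⁺¹]L_η = P_{n+2}/(n+1)`).
[cite: Katz1981CrystallineDieudonne, Lemma 5.1.2] -/
theorem derivative_formalEtaIntegral :
    d⁄dX A W.formalEtaIntegral = PowerSeries.mk fun n => coeff (n + 2) (W.formalXMulSq * W.formalOmega) := by
  ext n
  rw [coeff_derivative, W.coeff_succ_formalEtaIntegral, coeff_mk]
  have h : algebraMap ℚ A (1 / (n + 1 : ℚ)) * ((n : A) + 1) = 1 := by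
    have h2 : ((n : A) + 1) = algebraMap ℚ A (n + 1 : ℚ) := by simp
    rw [h2, ← map_mul, ← map_one (algebraMap ℚ A)]
    congr 1
    field_simp
  linear_combination coeff (n + 2) (W.formalXMulSq * W.formalOmega) * h

/-- `z² · (dL_η/dz) = P − 1` (`P₀ = 1`, `P₁ = 0`: the double pole and the residue of `x·ω` are removed).
[cite: Katz1981CrystallineDieudonne, Lemma 5.1.2] -/
theorem X_sq_mul_derivative_formalEtaIntegral :
    X ^ 2 * d⁄dX A W.formalEtaIntegral = W.formalXMulSq * W.formalOmega - 1 := by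
  rw [derivative_formalEtaIntegral W]
  ext d
  rw [coeff_X_pow_mul', map_sub, coeff_one]
  rcases Nat.lt_or_ge d 2 with hd | hd
  · rw [if_neg (by omega)]
    interval_cases d
    · rw [if_pos rfl, coeff_zero_eq_constantCoeff_apply,
        FormalEtaResidue.constantCoeff_formalXMulSq_mul_formalOmega, sub_self]
    · rw [if_neg one_ne_zero, FormalEtaResidue.coeff_one_formalXMulSq_mul_formalOmega, sub_zero]
  · rw [if_pos hd, coeff_mk, if_neg (by omega), sub_zero, Nat.sub_add_cancel hd]

/-- **`z² · (η · dL_η/dz) = z²x − η`**: with `ω·η = 1`, `η(P − 1) = z²x·ω·η − η = z²x − η`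
(`z²x = formalXMulSq`, `η = formalEta`). [cite: SilvermanAEC2009, IV.1] -/
theorem X_sq_mul_formalEta_mul_derivative_formalEtaIntegral :
    X ^ 2 * (W.formalEta * d⁄dX A W.formalEtaIntegral) = W.formalXMulSq - W.formalEta := by
  have h := X_sq_mul_derivative_formalEtaIntegral W
  linear_combination W.formalEta * h + W.formalXMulSq * W.formalOmega_mul_formalEta

end OneVariable

/-! ## §2 Two variables: Vieta products, the differentiated incidences, and the algebraic bridge -/

section TwoVariables

variable {R : Type*} [CommRing R] (W : WeierstrassCurve R)

/-- `zᵢ · zⱼ = z₁z₂` and `zᵢ + zⱼ = z₁ + z₂` for `zⱼ := z₁ + z₂ − zᵢ` (the other variable). [cite: SilvermanAEC2009, IV.1.1] -/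
theorem X_mul_other (i : Fin 2) :
    (MvPowerSeries.X i : MvPowerSeries (Fin 2) R) *
        ((MvPowerSeries.X 0 : MvPowerSeries (Fin 2) R) + MvPowerSeries.X 1 - MvPowerSeries.X i) =
      MvPowerSeries.X 0 * MvPowerSeries.X 1 := by
  fin_cases i <;> simp [mul_comm]

/-- `λ zᵢ + ν = w(zᵢ)` for `i = 0, 1`. [cite: SilvermanAEC2009, IV.1.1] -/
theorem formalSlope_mul_X_add_formalIntercept (i : Fin 2) :
    W.formalSlope * (MvPowerSeries.X i : MvPowerSeries (Fin 2) R) + W.formalIntercept =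
      W.formalW.subst (MvPowerSeries.X i : MvPowerSeries (Fin 2) R) := by
  fin_cases i
  · exact W.formalSlope_mul_X_zero_add_formalIntercept
  · exact W.formalSlope_mul_X_one_add_formalIntercept

variable [IsDomain R]

/-- **Vieta, product form: `D · w₁ w₂ w₃ = ν³`** (`wₖ = λzₖ + ν` the three collinear points; from the
coefficient identities `c₀ = −D z₁z₂z₃`, `c₁ = D Σ zₖzₗ`, `N = −D Σ zₖ` of the chord cubic — the value of
`λ³·G(Z, λZ+ν)` at `λZ + ν = 0`). [cite: SilvermanAEC2009, IV.1.1] -/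
theorem formalChordDenom_mul_prod_w :
    W.formalChordDenom * (W.formalSlope * (MvPowerSeries.X 0 : MvPowerSeries (Fin 2) R) + W.formalIntercept) *
        (W.formalSlope * (MvPowerSeries.X 1 : MvPowerSeries (Fin 2) R) + W.formalIntercept) *
        (W.formalSlope * W.formalChordZ + W.formalIntercept) =
      W.formalIntercept ^ 3 := by
  obtain ⟨hc₁, hc₀⟩ := W.formalChord_vieta_coeff
  have hDD' := W.formalChordDenom_mul_invOfUnit
  have hN : W.formalChordNum = -W.formalChordDenom *
      ((MvPowerSeries.X 0 : MvPowerSeries (Fin 2) R) + MvPowerSeries.X 1 + W.formalChordZ) := by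
    have hz₃ : W.formalChordZ = -(MvPowerSeries.X 0 : MvPowerSeries (Fin 2) R) - MvPowerSeries.X 1 -
        W.formalChordNum * MvPowerSeries.invOfUnit W.formalChordDenom 1 := rfl
    rw [hz₃]; linear_combination (-W.formalChordNum) * hDD'
  have hD : W.formalChordDenom = 1 + MvPowerSeries.C W.a₂ * W.formalSlope +
      MvPowerSeries.C W.a₄ * W.formalSlope ^ 2 + MvPowerSeries.C W.a₆ * W.formalSlope ^ 3 := rfl
  unfold WeierstrassCurve.formalChordNum at hN
  set L := W.formalSlope
  set V := W.formalIntercept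
  set D := W.formalChordDenom
  linear_combination (L ^ 3) * hc₀ - (L ^ 2 * V) * hc₁ + (L * V ^ 2) * hN + V ^ 3 * hD

/-- **The differentiated incidences**: `ηᵢ · ∂ᵢλ = D (zᵢ − z₃)` and `∂ᵢν = −zⱼ · ∂ᵢλ`
(`ηᵢ = η(zᵢ) = −Γ(zᵢ, wᵢ)`; from `D∏_{k≠l}(ζ_l − ζ_k)∂ᵢζ_l + Γ_l(ζ_l∂ᵢλ + ∂ᵢν) = 0` at `ζ = zᵢ` (`∂ᵢzᵢ = 1`) and
`ζ = zⱼ` (`∂ᵢzⱼ = 0`)). [cite: SilvermanAEC2009, III.5.1] -/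
theorem formalEta_mul_pderiv_formalSlope (i : Fin 2) :
    W.formalEta.subst (MvPowerSeries.X i : MvPowerSeries (Fin 2) R) * MvPowerSeries.pderiv i W.formalSlope =
        W.formalChordDenom * ((MvPowerSeries.X i : MvPowerSeries (Fin 2) R) - W.formalChordZ) ∧
      MvPowerSeries.pderiv i W.formalIntercept =
        -((MvPowerSeries.X 0 : MvPowerSeries (Fin 2) R) + MvPowerSeries.X 1 - MvPowerSeries.X i) *
          MvPowerSeries.pderiv i W.formalSlope := by
  classical
  have hΓ : ∀ j : Fin 2, (MvPowerSeries.C W.a₁ * ((MvPowerSeries.X j : MvPowerSeries (Fin 2) R)) +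
      MvPowerSeries.C W.a₂ * ((MvPowerSeries.X j : MvPowerSeries (Fin 2) R)) ^ 2 + 2 *
      MvPowerSeries.C W.a₃ * (W.formalW.subst (MvPowerSeries.X j : MvPowerSeries (Fin 2) R)) +
        2 * MvPowerSeries.C W.a₄ * ((MvPowerSeries.X j : MvPowerSeries (Fin 2) R)) *
            (W.formalW.subst (MvPowerSeries.X j : MvPowerSeries (Fin 2) R)) + 3 *
            MvPowerSeries.C W.a₆ *
            (W.formalW.subst (MvPowerSeries.X j : MvPowerSeries (Fin 2) R)) ^ 2 - 1) ≠ 0 := by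
    intro j hj
    have hw : MvPowerSeries.constantCoeff (W.formalW.subst (MvPowerSeries.X j : MvPowerSeries (Fin 2) R)) = 0 :=
      constantCoeff_powerSeries_subst_eq_zero (MvPowerSeries.constantCoeff_X j) W.constantCoeff_formalW
    have := congrArg MvPowerSeries.constantCoeff hj
    rw [W.constantCoeff_Gamma (MvPowerSeries.constantCoeff_X j) hw, map_zero] at this
    norm_num at this
  have h0 := W.chord_incidence_deriv (MvPowerSeries.pderiv i) (ζ := (MvPowerSeries.X 0 : MvPowerSeries (Fin 2) R))
    (by rw [W.formalSlope_mul_X_zero_add_formalIntercept]; exact W.curveCubic_formalW_subst_X 0)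
  have h1 := W.chord_incidence_deriv (MvPowerSeries.pderiv i) (ζ := (MvPowerSeries.X 1 : MvPowerSeries (Fin 2) R))
    (by rw [W.formalSlope_mul_X_one_add_formalIntercept]; exact W.curveCubic_formalW_subst_X 1)
  rw [W.formalSlope_mul_X_zero_add_formalIntercept, MvPowerSeries.pderiv_X] at h0
  rw [W.formalSlope_mul_X_one_add_formalIntercept, MvPowerSeries.pderiv_X] at h1
  rw [W.formalEta_subst (PowerSeries.HasSubst.X i)]
  fin_cases i
  · simp only [Fin.zero_eta, Fin.isValue, ↓reduceIte, mul_one, one_ne_zero, mul_zero, zero_add,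
      sub_self, zero_mul] at h0 h1 ⊢
    have hν : MvPowerSeries.pderiv 0 W.formalIntercept =
        -(MvPowerSeries.X 1 : MvPowerSeries (Fin 2) R) * MvPowerSeries.pderiv 0 W.formalSlope := by
      have := (mul_eq_zero.mp h1).resolve_left (hΓ 1)
      linear_combination this
    refine ⟨?_, by simpa using hν⟩
    rw [hν] at h0
    have h0' : ((MvPowerSeries.X 0 : MvPowerSeries (Fin 2) R) - MvPowerSeries.X 1) *
        (W.formalChordDenom * ((MvPowerSeries.X 0 : MvPowerSeries (Fin 2) R) - W.formalChordZ) +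
          (MvPowerSeries.C W.a₁ * (MvPowerSeries.X 0 : MvPowerSeries (Fin 2) R) +
      MvPowerSeries.C W.a₂ * (MvPowerSeries.X 0 : MvPowerSeries (Fin 2) R) ^ 2 + 2 *
      MvPowerSeries.C W.a₃ * (W.formalW.subst (MvPowerSeries.X 0 : MvPowerSeries (Fin 2) R)) +
        2 * MvPowerSeries.C W.a₄ * (MvPowerSeries.X 0 : MvPowerSeries (Fin 2) R) *
            (W.formalW.subst (MvPowerSeries.X 0 : MvPowerSeries (Fin 2) R)) + 3 *
            MvPowerSeries.C W.a₆ *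
            (W.formalW.subst (MvPowerSeries.X 0 : MvPowerSeries (Fin 2) R)) ^ 2 - 1) *
            MvPowerSeries.pderiv 0 W.formalSlope) = 0 := by
      linear_combination h0
    have := (mul_eq_zero.mp h0').resolve_left WeierstrassCurve.X_zero_sub_X_one_ne_zero
    linear_combination -this
  · simp only [Fin.mk_one, Fin.isValue, zero_ne_one, ↓reduceIte, mul_zero, zero_add, mul_one,
      sub_self, zero_mul] at h0 h1 ⊢
    have hν : MvPowerSeries.pderiv 1 W.formalIntercept =
        -(MvPowerSeries.X 0 : MvPowerSeries (Fin 2) R) * MvPowerSeries.pderiv 1 W.formalSlope := by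
      have := (mul_eq_zero.mp h0).resolve_left (hΓ 0)
      linear_combination this
    refine ⟨?_, by simpa using hν⟩
    rw [hν] at h1
    have h1' : ((MvPowerSeries.X 1 : MvPowerSeries (Fin 2) R) - MvPowerSeries.X 0) *
        (W.formalChordDenom * ((MvPowerSeries.X 1 : MvPowerSeries (Fin 2) R) - W.formalChordZ) +
          (MvPowerSeries.C W.a₁ * (MvPowerSeries.X 1 : MvPowerSeries (Fin 2) R) +
      MvPowerSeries.C W.a₂ * (MvPowerSeries.X 1 : MvPowerSeries (Fin 2) R) ^ 2 + 2 *
      MvPowerSeries.C W.a₃ * (W.formalW.subst (MvPowerSeries.X 1 : MvPowerSeries (Fin 2) R)) +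
        2 * MvPowerSeries.C W.a₄ * (MvPowerSeries.X 1 : MvPowerSeries (Fin 2) R) *
            (W.formalW.subst (MvPowerSeries.X 1 : MvPowerSeries (Fin 2) R)) + 3 *
            MvPowerSeries.C W.a₆ *
            (W.formalW.subst (MvPowerSeries.X 1 : MvPowerSeries (Fin 2) R)) ^ 2 - 1) *
            MvPowerSeries.pderiv 1 W.formalSlope) = 0 := by
      linear_combination h1
    have hne : (MvPowerSeries.X 1 : MvPowerSeries (Fin 2) R) - MvPowerSeries.X 0 ≠ 0 := fun h =>
      WeierstrassCurve.X_zero_sub_X_one_ne_zero (by linear_combination -h)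
    have := (mul_eq_zero.mp h1').resolve_left hne
    linear_combination -this

/-- `z₃ · (z₃² B(z₃)) = w₃ = λz₃ + ν` (`w = z³B`, and `w(z₃) = λz₃ + ν`). [cite: SilvermanAEC2009, IV.1.1] -/
theorem formalChordZ_mul_S₃ :
    W.formalChordZ * (W.formalChordZ ^ 2 * W.formalWDivCube.subst W.formalChordZ) =
      W.formalSlope * W.formalChordZ + W.formalIntercept := by
  have hg := W.hasSubst_formalChordZ
  rw [← W.formalW_subst_formalChordZ, W.formalW_eq_X_pow_mul_formalWDivCube, PowerSeries.subst_mul hg,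
    PowerSeries.subst_pow hg, PowerSeries.subst_X hg]
  ring

/-- **The algebraic bridge**: the power series
`Φ = a₁ − (a₁ + a₃λ + a₄ν + 2a₆λν)(1 − a₃ν − a₆ν²)⁻¹ + a₃ z₃²B(z₃)` satisfies
`F ν z₁z₂ · Φ = ν(z₁z₂ − F(z₁ + z₂)) − λ F z₁z₂`, i.e. "`Φ = 1/F − 1/z₁ − 1/z₂ − λ/ν`" (from `1/F = −u/z₃ =
−1/z₃ + a₁ + a₃w₃/z₃` and Vieta `D z₁z₂z₃ = ν(1 − a₃ν − a₆ν²)`, `D Σzₖzₗ = c₁`). [cite: SilvermanAEC2009, IV.1.1] -/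
theorem bridge :
    W.formalGroupLaw * W.formalIntercept * (MvPowerSeries.X 0 : MvPowerSeries (Fin 2) R) * MvPowerSeries.X 1 *
        (MvPowerSeries.C W.a₁ - (MvPowerSeries.C W.a₁ + MvPowerSeries.C W.a₃ * W.formalSlope +
            MvPowerSeries.C W.a₄ * W.formalIntercept + 2 * MvPowerSeries.C W.a₆ * W.formalSlope * W.formalIntercept) *
          MvPowerSeries.invOfUnit (1 - MvPowerSeries.C W.a₃ * W.formalIntercept -
            MvPowerSeries.C W.a₆ * W.formalIntercept ^ 2) 1 +
          MvPowerSeries.C W.a₃ * (W.formalChordZ ^ 2 * W.formalWDivCube.subst W.formalChordZ)) =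
      W.formalIntercept * ((MvPowerSeries.X 0 : MvPowerSeries (Fin 2) R) * MvPowerSeries.X 1 -
          W.formalGroupLaw * (MvPowerSeries.X 0 + MvPowerSeries.X 1)) -
        W.formalSlope * W.formalGroupLaw * MvPowerSeries.X 0 * MvPowerSeries.X 1 := by
  obtain ⟨hc₁, hc₀⟩ := W.formalChord_vieta_coeff
  have hFu := W.formalGroupLaw_mul_formalNegDenom
  have hS₃ := formalChordZ_mul_S₃ W
  have hM : (1 - MvPowerSeries.C W.a₃ * W.formalIntercept - MvPowerSeries.C W.a₆ * W.formalIntercept ^ 2) *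
      MvPowerSeries.invOfUnit (1 - MvPowerSeries.C W.a₃ * W.formalIntercept -
        MvPowerSeries.C W.a₆ * W.formalIntercept ^ 2) 1 = 1 :=
    MvPowerSeries.mul_invOfUnit _ 1 (by simp [W.constantCoeff_formalIntercept])
  -- cancel the non-zero-divisor `M · u · D`
  have hMne : (1 - MvPowerSeries.C W.a₃ * W.formalIntercept - MvPowerSeries.C W.a₆ * W.formalIntercept ^ 2) ≠ 0 := by
    intro h; have := congrArg MvPowerSeries.constantCoeff h
    simp [W.constantCoeff_formalIntercept] at this
  have hune : (1 - MvPowerSeries.C W.a₁ * W.formalChordZ -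
      MvPowerSeries.C W.a₃ * (W.formalSlope * W.formalChordZ + W.formalIntercept)) ≠ 0 :=
    W.isUnit_formalNegDenom_formalChordZ.ne_zero
  have hDne := W.formalChordDenom_ne_zero
  refine mul_right_cancel₀ (mul_ne_zero (mul_ne_zero hMne hune) hDne) ?_
  set S₃ := W.formalChordZ ^ 2 * W.formalWDivCube.subst W.formalChordZ
  set Mi := MvPowerSeries.invOfUnit (1 - MvPowerSeries.C W.a₃ * W.formalIntercept -
    MvPowerSeries.C W.a₆ * W.formalIntercept ^ 2) 1
  set F := W.formalGroupLaw
  set L := W.formalSlope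
  set V := W.formalIntercept
  set D := W.formalChordDenom
  set z₃ := W.formalChordZ
  set z₁ := (MvPowerSeries.X 0 : MvPowerSeries (Fin 2) R)
  set z₂ := (MvPowerSeries.X 1 : MvPowerSeries (Fin 2) R)
  set A₁ := (MvPowerSeries.C W.a₁ : MvPowerSeries (Fin 2) R)
  set A₃ := (MvPowerSeries.C W.a₃ : MvPowerSeries (Fin 2) R)
  set A₄ := (MvPowerSeries.C W.a₄ : MvPowerSeries (Fin 2) R)
  set A₆ := (MvPowerSeries.C W.a₆ : MvPowerSeries (Fin 2) R)
  linear_combination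
    (-(V * (A₁ * (1 - A₃ * V - A₆ * V ^ 2) - (A₁ + A₃ * L + A₄ * V + 2 * A₆ * L * V) +
          A₃ * S₃ * (1 - A₃ * V - A₆ * V ^ 2))) -
        (1 - A₃ * V - A₆ * V ^ 2) * (L - V * (A₁ + A₃ * S₃))) * hc₀ +
      ((1 - A₃ * V - A₆ * V ^ 2) * V) * hc₁ +
      (V * z₁ * z₂ * D * (A₁ * (1 - A₃ * V - A₆ * V ^ 2) - (A₁ + A₃ * L + A₄ * V + 2 * A₆ * L * V) +
          A₃ * S₃ * (1 - A₃ * V - A₆ * V ^ 2)) +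
        (1 - A₃ * V - A₆ * V ^ 2) * D * (V * (z₁ + z₂) + L * z₁ * z₂)) * hFu -
      (F * V * z₁ * z₂ * (1 - A₁ * z₃ - A₃ * (L * z₃ + V)) * D *
        (A₁ + A₃ * L + A₄ * V + 2 * A₆ * L * V)) * hM -
      ((1 - A₃ * V - A₆ * V ^ 2) * D * V * z₁ * z₂ * A₃) * hS₃

end TwoVariables

end Literature.NumberTheory.EllipticCurves.DescendedFrobenius.FormalEtaCoboundary

end Part15

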